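import Literature.Computability.Complexity.GapPVEncode
import Literature.Computability.Complexity.CNFToBCSP
import Literature.Computability.Complexity.TesterQueries
import Literature.Computability.Complexity.ArityReduction
import Literature.Computability.Complexity.ExpanderOps
import Literature.Computability.Complexity.Quotient
import Literature.Computability.Complexity.Expanderize
import Literature.Computability.Complexity.DegreeReductionGraph
import Literature.Computability.Complexity.GabberGalilKit
import Literature.Computability.Complexity.PoweringConstruction
import Literature.Computability.Complexity.Round
import HarnessLib

/-!
# Dinur's reduction on coded instances: the state and one round

Infrastructure for the discharge of the PCP theorem `pcp_theorem_exact` (`ApproximationProofs.lean`):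
Dinur's gap-amplifying reduction `ggP.dinur` (`RoundInstance.lean`, `GabberGalilKit.lean`) is rendered
on *string numbers* inside Cobham's function algebra (`IsPVDefinable`; toolkit `PVToolkit*`, `PVSeq`,
`PVYard`, `PVStrings`; parser `GapPVParse.lean` (chapter I), encoder `GapPVEncode.lean` (chapter II)),
so that Cobham's theorem (`PVBridge.lean`) places it in `FP`.  This file holds the *data level* of
that rendering, in two parts, each opened by its own module docstring and divided into chapters:

* **Part A — the state of the reduction** (chapters III–V and counting lemmas): recognising codes of
  3CNFs (`Valid`, `valid_iff`); the coded `q₀`-CSP state `Rep e N S φ`, `build`/`rep_build`, the first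
  stage `ofS`/`rep_ofS`; flat indexing of concatenations (`blk`, `off`, the yardstick `ydT`).
* **Part B — one round on coded instances** (chapters IX–XVIII): the round `ggP.round` mirrored by
  number-theoretic functions — rotation maps, walks and powering, the graph operations, degree
  reduction, the Gabber–Galil expanders, balls and the walk constraints, the tester's coins, truth-table
  quadratic systems, queries and verdict — ending with `roundS e N S` and
  **`rep_roundS : Rep e N S φ → … → Rep e N (roundS e N S) (ggP.round φ)`**.

The last stage `toE3CNF` (chapters VI–VIII), the definability of all these functions, the size
bookkeeping along the `⌊log₂ m⌋ + 1` rounds and the machine itself are in `ApproximationProofs.lean`.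

## References

* S. Arora, B. Barak, *Computational Complexity: A Modern Approach*, Cambridge University Press 2009,
  §11.3, Chapter 22 (Lemmas 22.4–22.6, Claims 22.36–22.37, Lemma 22.9, §22.2.5), §21.2.
* I. Dinur, *The PCP theorem by gap amplification*, J. ACM 54(3) (2007).
* O. Gabber, Z. Galil, *Explicit constructions of linear-sized superconcentrators*, JCSS 22 (1981).
* A. Cobham, *The intrinsic computational difficulty of functions*, 1965.
-/

set_option exponentiation.threshold 4096

/-!
# Part A — the state of the reduction

This module renders the *data* of Dinur's reduction on string numbers, inside Cobham's function algebra
(`IsPVDefinable`, files `PVToolkit*`, `PVSeq`, `PVYard`, `PVStrings`; the parser `GapPVParse` and the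
encoder `GapPVEncode`).  It has four parts, each with its own header below:

1. **recognising the codes of 3CNFs** (`validN`, `Valid`, `parsed`, `valid_iff`);
2. **the coded `q₀`-CSP state** (`Rep e N S φ`: the number `S` codes the instance `φ : BCSP q₀` under the
   cap `capL e N`; `build`/`rep_build`; the first state `ofS` with `rep_ofS`);
3. **flat indexing** of concatenations of blocks of definable sizes (`blk`, `off`, yardstick `ydT`);
4. **counting lemmas** (`countBelow`/filters/`idxOf`) used by the later stages.

Everything here is infrastructure for the discharge of `pcp_theorem_exact` (`ApproximationProofs.lean`).
-/

/-!
## III. Recognising the codes of 3CNFs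

Combining the parser (`GapPVParse.lean`) with the encoder (`GapPVEncode.lean`): the string number `N`
is the code of a CNF of width `≤ 3` iff re-encoding the parsed formula gives `N` back and every parsed
clause has at most three literals.  This is the case distinction of the gap machine
(`GapAssembly.GapMachine.junk`: every string that is not such a code is sent to the fixed no-instance).

* `parsed N` — the formula read off `N` (`= φ` on `N = sn (encode φ)`, `parsed_sn_encode`);
* `reEnc N` — its code, in Cobham's class (`pv_reEnc`), and `reEnc_eq : reEnc N = sn (encode (parsed N))`
  (the code of the parsed formula always fits under the cap `capL 3 N = |yd N|^4`);
* `Valid N` / `validN N ∈ {0,1}` (`pv_validN`) and **`valid_iff`**: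
  `Valid N ↔ ∃ φ, φ.IsWidthLE 3 ∧ N = sn (encodingCNF.encode φ)`, with `parsed N = φ` then.

## References

* S. Arora, B. Barak, *Computational Complexity: A Modern Approach*, CUP 2009, §2.3.
-/

namespace Literature.Computability.Complexity

open _root_.Computability Literature.Analysis.FunctionSpaces

namespace GapPV

open StrNum

/-! ### Size of codes -/

/-- The length of the code of a CNF with `m` clauses of `≤ k` literals on variables of size `≤ s`. [folklore] -/
theorem length_encode_le (φ : CNF ℕ) {k s : ℕ} (hk : ∀ c ∈ φ, c.length ≤ k) (hs : ∀ c ∈ φ, ∀ l ∈ c, (l.1 : ℕ).size ≤ s) :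
    (encodingCNF.encode φ).length ≤ 2 * φ.length + 2 + φ.length * (2 * (2 * k + 2 + k * (4 * s + 8)) + 2) := by
  rw [encode_eq_body, length_boolPair, List.length_replicate, length_body]
  have hcl : ∀ j < φ.length, (encodingClause.encode (φ.getD j [])).length ≤ 2 * k + 2 + k * (4 * s + 8) := by
    intro j hj
    rw [List.getD_eq_getElem?_getD, List.getElem?_eq_getElem hj, Option.getD_some, encode_clause_eq_body, length_boolPair,
      List.length_replicate, length_body]
    have hkj := hk _ (List.getElem_mem hj)
    have hlit : ∀ i < (φ[j]).length, (encodingLiteral.encode ((φ[j]).getD i (0, false))).length ≤ 2 * s + 3 := by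
      intro i hi
      rw [List.getD_eq_getElem?_getD, List.getElem?_eq_getElem hi, Option.getD_some, encode_literal, length_boolPair,
        TM2Pass.length_encodeNat_eq_size]
      have := hs _ (List.getElem_mem hj) _ (List.getElem_mem hi)
      simp; omega
    have hsum : sumBelow (fun i => 2 * (encodingLiteral.encode ((φ[j]).getD (0 + i) (0, false))).length + 2) (φ[j]).length ≤ (φ[j]).length * (4 * s + 8) := by
      unfold sumBelow
      calc ∑ i ∈ Finset.range (φ[j]).length, (2 * (encodingLiteral.encode ((φ[j]).getD (0 + i) (0, false))).length + 2)
          ≤ ∑ i ∈ Finset.range (φ[j]).length, (4 * s + 8) := Finset.sum_le_sum fun i hi => by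
              have := hlit i (by simpa using hi); rw [zero_add]; omega
        _ = (φ[j]).length * (4 * s + 8) := by rw [Finset.sum_const, Finset.card_range, smul_eq_mul]
    calc 2 * (φ[j]).length + 2 + sumBelow (fun i => 2 * (encodingLiteral.encode ((φ[j]).getD (0 + i) (0, false))).length + 2) (φ[j]).length
        ≤ 2 * k + 2 + (φ[j]).length * (4 * s + 8) := by omega
      _ ≤ 2 * k + 2 + k * (4 * s + 8) := by have := Nat.mul_le_mul_right (4 * s + 8) hkj; omega
  have hsum : sumBelow (fun j => 2 * (encodingClause.encode (φ.getD (0 + j) [])).length + 2) φ.length ≤ φ.length * (2 * (2 * k + 2 + k * (4 * s + 8)) + 2) := by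
    unfold sumBelow
    calc ∑ j ∈ Finset.range φ.length, (2 * (encodingClause.encode (φ.getD (0 + j) [])).length + 2)
        ≤ ∑ j ∈ Finset.range φ.length, (2 * (2 * k + 2 + k * (4 * s + 8)) + 2) := Finset.sum_le_sum fun j hj => by
            have := hcl j (by simpa using hj); rw [zero_add]; omega
      _ = φ.length * (2 * (2 * k + 2 + k * (4 * s + 8)) + 2) := by rw [Finset.sum_const, Finset.card_range, smul_eq_mul]
  omega

/-- `vVal < 2^{|N|}`. [folklore] -/
theorem vVal_lt (N p s : ℕ) : vVal N p s < 2 ^ N.size := by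
  unfold vVal
  have key : ∀ k, sumBelow (fun i => vbit N p s (2 * i) * 2 ^ i) k < 2 ^ k := by
    intro k
    induction k with
    | zero => simp [sumBelow]
    | succ k ih =>
      rw [sumBelow, Finset.sum_range_succ, ← sumBelow, pow_succ]
      have := Bool.toNat_le (Nat.testBit N (p + s * (2 * k)))
      unfold vbit at *
      nlinarith
  exact (key _).trans_le (Nat.pow_le_pow_right two_pos (vEnd_le N p s))

/-- Parsed variables have size `≤ |N|`. [folklore] -/
theorem size_pVar_le (N j i : ℕ) : (pVar N j i).size ≤ N.size := Nat.size_le.2 (vVal_lt N _ _)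

/-! ### The parsed formula and its code -/

/-- **The formula parsed from `N`.** [cite: AroraBarakCC2009, §2.3] -/
def parsed (N : ℕ) : CNF ℕ := descCNF pM pK pVar pPol N

/-- The number of clauses of the parsed formula. [folklore] -/
theorem length_parsed (N : ℕ) : (parsed N).length = pM N := length_descCNF N

/-- **Parsing a code gives the formula back.** [cite: AroraBarakCC2009, §2.3] -/
theorem parsed_sn_encode (φ : CNF ℕ) : parsed (sn (encodingCNF.encode φ)) = φ := by
  unfold parsed descCNF
  refine List.ext_getElem (by simp [pM_eq]) fun j h1 h2 => ?_
  simp only [List.getElem_map, List.getElem_range]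
  refine List.ext_getElem (by simp [pK_eq φ h2]) fun i h3 h4 => ?_
  simp only [List.getElem_map, List.getElem_range]
  rw [pVar_eq φ h2 h4, pPol_eq φ h2 h4]
  ext
  · rfl
  · simp only
    cases ((φ[j])[i]).2 <;> simp

/-- The code of the parsed formula fits under the cap `|yd N|^4`. [folklore] -/
theorem length_encode_parsed_le (N : ℕ) : (encodingCNF.encode (parsed N)).length ≤ capL 3 N := by
  have hk : ∀ c ∈ parsed N, c.length ≤ N.size := by
    intro c hc
    unfold parsed descCNF at hc
    rw [List.mem_map] at hc
    obtain ⟨j, hj, rfl⟩ := hc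
    rw [List.length_map, List.length_range]
    exact vEnd_le _ _ _
  have hs : ∀ c ∈ parsed N, ∀ l ∈ c, (l.1 : ℕ).size ≤ N.size := by
    intro c hc l hl
    unfold parsed descCNF at hc
    rw [List.mem_map] at hc
    obtain ⟨j, hj, rfl⟩ := hc
    rw [List.mem_map] at hl
    obtain ⟨i, hi, rfl⟩ := hl
    exact size_pVar_le N j i
  have hm : (parsed N).length ≤ N.size := by rw [length_parsed]; exact vEnd_le _ _ _
  refine (length_encode_le (parsed N) hk hs).trans ?_
  -- `2n + 2 + n (2(2n + 2 + n(4n + 8)) + 2) ≤ B^4` for `n ≤ B`, `65 ≤ B`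
  set n := N.size
  have hB : n ≤ Bsz N := size_le_size_yd N
  have hB65 : 65 ≤ Bsz N := size_yd_ge N
  unfold capL
  set B := Bsz N
  have h1 : (parsed N).length * (2 * (2 * n + 2 + n * (4 * n + 8)) + 2) ≤ n * (2 * (2 * n + 2 + n * (4 * n + 8)) + 2) :=
    Nat.mul_le_mul_right _ hm
  have h2 : n * (2 * (2 * n + 2 + n * (4 * n + 8)) + 2) ≤ B * (2 * (2 * B + 2 + B * (4 * B + 8)) + 2) := by
    have := Nat.mul_le_mul hB hB; nlinarith
  have hB1 : 1 ≤ B := by omega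
  have hb2 : B ^ 2 ≤ B ^ 3 := Nat.pow_le_pow_right hB1 (by norm_num)
  have hb1 : B ≤ B ^ 3 := by calc B = B ^ 1 := (pow_one B).symm
    _ ≤ B ^ 3 := Nat.pow_le_pow_right hB1 (by norm_num)
  have hb0 : 1 ≤ B ^ 3 := Nat.one_le_pow _ _ hB1
  calc 2 * (parsed N).length + 2 + (parsed N).length * (2 * (2 * n + 2 + n * (4 * n + 8)) + 2)
      ≤ 2 * B + 2 + B * (2 * (2 * B + 2 + B * (4 * B + 8)) + 2) := by omega
    _ = 8 * B ^ 3 + 20 * B ^ 2 + 8 * B + 2 := by ring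
    _ ≤ 38 * B ^ 3 := by omega
    _ ≤ 65 * B ^ 3 := by omega
    _ ≤ B * B ^ 3 := Nat.mul_le_mul_right _ hB65
    _ = B ^ (3 + 1) := by ring

/-- **The re-encoding of the parsed formula**, `snEnc 3` of the parsed descriptor. [folklore] -/
def reEnc (N : ℕ) : ℕ := snEnc 3 pM pK pVar pPol N

/-- `reEnc` is in Cobham's class. [cite: Cobham1965] -/
theorem pv_reEnc : PV₁ reEnc := pv_snEnc 3 pv_pM pv_pK pv_pVar pv_pPol

/-- **`reEnc N` is the code of the parsed formula.** [cite: AroraBarakCC2009, §2.3] -/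
theorem reEnc_eq (N : ℕ) : reEnc N = sn (encodingCNF.encode (parsed N)) :=
  snEnc_eq 3 (describes_descCNF fun _ _ => Bool.toNat_le _) (length_encode_parsed_le N)

/-! ### Validity -/

/-- `N` codes a CNF of width `≤ 3`: re-encoding gives `N` back and all parsed clauses are short. [folklore] -/
def Valid (N : ℕ) : Prop := reEnc N = N ∧ ∀ j < pM N, pK N j ≤ 3

/-- The number of short parsed clauses. [folklore] -/
def shortCount (N : ℕ) : ℕ := countBelow (fun j => if pK N j ≤ 3 then 1 else 0) (pM N)

/-- All parsed clauses are short iff the count is full. [folklore] -/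
theorem shortCount_eq_iff (N : ℕ) : shortCount N = pM N ↔ ∀ j < pM N, pK N j ≤ 3 := by
  unfold shortCount countBelow
  constructor
  · intro h j hj
    have hsub : (Finset.range (pM N)).filter (fun j => (if pK N j ≤ 3 then 1 else 0) ≠ 0) = Finset.range (pM N) :=
      Finset.eq_of_subset_of_card_le (Finset.filter_subset _ _) (by rw [Finset.card_range]; exact h.ge)
    have hmem : j ∈ (Finset.range (pM N)).filter (fun j => (if pK N j ≤ 3 then 1 else 0) ≠ 0) := by rw [hsub]; exact Finset.mem_range.2 hj
    rw [Finset.mem_filter] at hmem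
    by_contra hc
    exact hmem.2 (by simp [hc])
  · intro h
    rw [Finset.filter_true_of_mem fun j hj => by simp [h j (Finset.mem_range.1 hj)], Finset.card_range]

/-- The characteristic function of validity. [folklore] -/
noncomputable def validN (N : ℕ) : ℕ := by classical exact if Valid N then 1 else 0

/-- `validN` in terms of definable tests. [folklore] -/
theorem validN_eq (N : ℕ) : validN N = (if reEnc N = N then 1 else 0) * (if shortCount N = pM N then 1 else 0) := by
  unfold validN Valid
  rw [← shortCount_eq_iff]
  by_cases h1 : reEnc N = N <;> by_cases h2 : shortCount N = pM N <;> simp [h1, h2]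

/-- `shortCount` is in Cobham's class. [cite: Buss1986, Ch. 1] -/
theorem pv_shortCount : PV₁ shortCount :=
  PV₁.countBelow (P₂ := fun N j => if pK N j ≤ 3 then 1 else 0) (S := fun N => N)
    ((pv_pK.comp (IsPVDefinable.proj 0) (IsPVDefinable.proj 1)).ite_le (IsPVDefinable.const 3) (IsPVDefinable.const 1) (IsPVDefinable.const 0))
    pv_pM (IsPVDefinable.proj 0) fun N => vEnd_le N 0 1

/-- **Validity is decided inside Cobham's class.** [cite: Cobham1965] -/
theorem pv_validN : PV₁ validN :=
  (((pv_reEnc.comp (IsPVDefinable.proj 0)).eqTest (IsPVDefinable.proj 0)).mul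
    ((pv_shortCount.comp (IsPVDefinable.proj 0)).eqTest (pv_pM.comp (IsPVDefinable.proj 0)))).of_eq fun v => (validN_eq (v 0)).symm

/-- `validN ≤ 1`, and `validN = 1 ↔ Valid`. [folklore] -/
theorem validN_eq_one_iff (N : ℕ) : validN N = 1 ↔ Valid N := by
  unfold validN; split_ifs with h <;> simp [h]

/-- `validN = 0` iff the input is invalid. [folklore] -/
theorem validN_eq_zero_iff (N : ℕ) : validN N = 0 ↔ ¬ Valid N := by
  unfold validN; split_ifs with h <;> simp [h]

/-- **Codes of 3CNFs are valid, and parse to themselves.** [cite: AroraBarakCC2009, §2.3] -/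
theorem valid_sn_encode {φ : CNF ℕ} (hw : φ.IsWidthLE 3) : Valid (sn (encodingCNF.encode φ)) := by
  refine ⟨?_, fun j hj => ?_⟩
  · rw [reEnc_eq, parsed_sn_encode]
  · rw [pM_eq] at hj
    rw [pK_eq φ hj]
    exact hw _ (List.getElem_mem hj)

/-- **Valid string numbers are codes of 3CNFs** (namely of the parsed formula). [cite: AroraBarakCC2009, §2.3] -/
theorem eq_sn_encode_of_valid {N : ℕ} (h : Valid N) : N = sn (encodingCNF.encode (parsed N)) ∧ (parsed N).IsWidthLE 3 := by
  refine ⟨by rw [← reEnc_eq, h.1], fun c hc => ?_⟩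
  unfold parsed descCNF at hc
  rw [List.mem_map] at hc
  obtain ⟨j, hj, rfl⟩ := hc
  rw [List.length_map, List.length_range]
  exact h.2 j (List.mem_range.1 hj)

/-- **Characterisation of validity.** [cite: AroraBarakCC2009, §2.3] -/
theorem valid_iff (N : ℕ) : Valid N ↔ ∃ φ : CNF ℕ, φ.IsWidthLE 3 ∧ N = sn (encodingCNF.encode φ) :=
  ⟨fun h => ⟨parsed N, (eq_sn_encode_of_valid h).2, (eq_sn_encode_of_valid h).1⟩, fun ⟨_, hw, hN⟩ => hN ▸ valid_sn_encode hw⟩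

end GapPV

end Literature.Computability.Complexity

/-!
## IV. Coded constraint systems and the first stage `ofCNF`

The instances between the rounds of Dinur's gap amplification are Boolean constraint systems
`BCSP q₀` (`BCSP.lean`; `q₀ = 864`).  At the machine level such an instance is ONE number `S`, a
sequence of digits of width `wd e N = 2^{q₀} + capL e N` (`PVSeq.dig`):

  digit `0` = `nV`, digit `1` = `m`, digit `2 + s q₀ + k` = the variable read at position `k` of constraint
  `s`, digit `2 + m q₀ + s` = the truth table of constraint `s` (bit `t` = acceptance of the local
  assignment `τ_t`, `τ_t k = testBit t k`, which is the spec's `(boolVecEquiv q₀)⁻¹ t`).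

`Rep e N S φ` says that `S` codes `φ : BCSP q₀` in this way.  This file sets the format up (accessors
`stNV`, `stM`, `stVar`, `stTbl`, `stAcc`, all in Cobham's class) and implements the first stage of the
reduction, `CNFToBCSP.ofCNF q₀` applied to the parsed input formula: `ofS e N` with `pv_ofS` and
**`rep_ofS : Rep e N (ofS e N) (ofCNF q₀ (parsed N))`**.

## References

* S. Arora, B. Barak, *Computational Complexity: A Modern Approach*, CUP 2009, Def. 11.11, §11.3.1, §22.2.1.
-/

set_option exponentiation.threshold 4096

namespace Literature.Computability.Complexity

open _root_.Computability Literature.Analysis.FunctionSpaces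

namespace GapPV

open StrNum Expander Expander.BCSP BLR.Table

/-- `q₀ > 0`. [folklore] -/
theorem q₀_pos' : 0 < q₀ := by rw [q₀_eq]; norm_num

/-- The number of local assignments `2^{q₀}`, kept irreducible (a 261-digit number). [folklore] -/
@[irreducible] def tQ : ℕ := 2 ^ q₀

/-- `tQ = 2^{q₀}`. [folklore] -/
theorem tQ_eq : tQ = 2 ^ q₀ := by unfold tQ; rfl

/-- `tQ > 0`. [folklore] -/
theorem tQ_pos : 0 < tQ := by rw [tQ_eq]; exact Nat.two_pow_pos _

/-! ### Local assignments as numbers -/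

/-- The local assignment with code `t`: `τ_t k = testBit t k`. [folklore] -/
def τof (t : ℕ) : Fin q₀ → Bool := fun k => t.testBit k.val

/-- The spec's enumeration of local assignments is `τof`. [folklore] -/
theorem boolVecEquiv_symm_apply (t : Fin (2 ^ q₀)) (k : Fin q₀) : (boolVecEquiv q₀).symm t k = τof t.val k := by
  unfold τof boolVecEquiv
  simp only [Equiv.symm_trans_apply, Equiv.arrowCongr_symm, Equiv.arrowCongr_apply, Equiv.refl_symm, Equiv.coe_refl,
    Function.comp_apply, id_eq, Equiv.symm_symm]
  rw [Nat.testBit_eq_decide_div_mod_eq]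
  have h : ((finFunctionFinEquiv.symm t) k : ℕ) = t.val / 2 ^ k.val % 2 := finFunctionFinEquiv_symm_apply_val t k
  generalize hx : finFunctionFinEquiv.symm t k = x at h
  unfold finTwoEquiv
  simp only [Equiv.coe_fn_mk]
  rcases Nat.mod_two_eq_zero_or_one (t.val / 2 ^ k.val) with h0 | h1
  · rw [h0] at h ⊢; have : x = 0 := Fin.ext h; subst this; decide
  · rw [h1] at h ⊢; have : x = 1 := Fin.ext h; subst this; decide

/-- The code of `τof t` is `t`. [folklore] -/
theorem boolVecEquiv_τof {t : ℕ} (ht : t < 2 ^ q₀) : boolVecEquiv q₀ (τof t) = ⟨t, ht⟩ := by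
  rw [Equiv.apply_eq_iff_eq_symm_apply]; funext k; exact (boolVecEquiv_symm_apply ⟨t, ht⟩ k).symm

/-! ### The state format -/

variable (e : ℕ)

/-- The digit width of states: `2^{q₀} + capL e N`. [folklore] -/
def wd (N : ℕ) : ℕ := tQ + capL e N

/-- `wd` is in Cobham's class. [cite: Cobham1965] -/
theorem pv_wd : PV₁ (wd e) := (IsPVDefinable.const _).add ((pv_capL e).comp (IsPVDefinable.proj 0))

/-- `wd ≤ |yd|^{e+2}` (so digits of width `wd` are yardstick-bounded… as a count bound we use `wd ≤ |ypow|`). [folklore] -/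
theorem capL_lt_wd (N : ℕ) : capL e N < wd e N := by
  have h := tQ_pos
  unfold wd; omega

/-- The number of variables. [folklore] -/
def stNV (N S : ℕ) : ℕ := dig (wd e N) S 0

/-- The number of constraints. [folklore] -/
def stM (N S : ℕ) : ℕ := dig (wd e N) S 1

/-- The variable at position `k` of constraint `s`. [folklore] -/
def stVar (N S s k : ℕ) : ℕ := dig (wd e N) S (2 + s * q₀ + k)

/-- The truth table of constraint `s`. [folklore] -/
def stTbl (N S s : ℕ) : ℕ := dig (wd e N) S (2 + stM e N S * q₀ + s)

/-- Acceptance of the local assignment with code `t` by constraint `s` (`0/1`). [folklore] -/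
def stAcc (N S s t : ℕ) : ℕ := (Nat.testBit (stTbl e N S s) t).toNat

/-- `stNV` is in Cobham's class. [cite: Cobham1965] -/
theorem pv_stNV : PV₂ (stNV e) := pv_dig.comp ((pv_wd e).comp (IsPVDefinable.proj 0)) (IsPVDefinable.proj 1) (IsPVDefinable.const 0)

/-- `stM` is in Cobham's class. [cite: Cobham1965] -/
theorem pv_stM : PV₂ (stM e) := pv_dig.comp ((pv_wd e).comp (IsPVDefinable.proj 0)) (IsPVDefinable.proj 1) (IsPVDefinable.const 1)

/-- `stVar` is in Cobham's class. [cite: Cobham1965] -/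
theorem pv_stVar : PV₄ (stVar e) :=
  pv_dig.comp ((pv_wd e).comp (IsPVDefinable.proj 0)) (IsPVDefinable.proj 1)
    ((((IsPVDefinable.const 2).add ((IsPVDefinable.proj 2).mul (IsPVDefinable.const q₀)))).add (IsPVDefinable.proj 3))

/-- `stTbl` is in Cobham's class. [cite: Cobham1965] -/
theorem pv_stTbl : PV₃ (stTbl e) :=
  pv_dig.comp ((pv_wd e).comp (IsPVDefinable.proj 0)) (IsPVDefinable.proj 1)
    (((IsPVDefinable.const 2).add (((pv_stM e).comp (IsPVDefinable.proj 0) (IsPVDefinable.proj 1)).mul (IsPVDefinable.const q₀))).add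
      (IsPVDefinable.proj 2))

/-- `stAcc` is in Cobham's class. [cite: Cobham1965] -/
theorem pv_stAcc : PV₄ (stAcc e) :=
  pv_tb.comp ((pv_stTbl e).comp (IsPVDefinable.proj 0) (IsPVDefinable.proj 1) (IsPVDefinable.proj 2)) (IsPVDefinable.proj 3)

/-- **`S` codes the instance `φ`** (at yardstick `N`, cap exponent `e`). [cite: AroraBarakCC2009, Def. 11.11 (qCSP instances given by truth tables)] -/
structure Rep (N S : ℕ) (φ : BCSP q₀) : Prop where
  /-- number of variables -/
  nV_eq : stNV e N S = φ.nV
  /-- number of constraints -/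
  m_eq : stM e N S = φ.cons.length
  /-- the variables read -/
  var_eq : ∀ s (hs : s < φ.cons.length) (k : Fin q₀), stVar e N S s k = (φ.vars ⟨s, hs⟩ k).val
  /-- the truth tables -/
  acc_eq : ∀ s (hs : s < φ.cons.length) t, t < tQ → stAcc e N S s t = (φ.acc ⟨s, hs⟩ (τof t)).toNat
  /-- the sizes fit under the cap -/
  nV_le : φ.nV ≤ 2 ^ capL e N
  m_le : 2 + φ.cons.length * (q₀ + 1) ≤ capL e N

/-! ### Building a state from definable components -/

section Build

variable {nVf mf : ℕ → ℕ} {varf : ℕ → ℕ → ℕ → ℕ} {accf : ℕ → ℕ → ℕ → ℕ}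

/-- The digit function of the state with components `nV, m, var, acc`. [folklore] -/
def buildDigit (nVf mf : ℕ → ℕ) (varf accf : ℕ → ℕ → ℕ → ℕ) (N i : ℕ) : ℕ :=
  if i = 0 then nVf N
  else if i = 1 then mf N
  else if i < 2 + mf N * q₀ then varf N ((i - 2) / q₀) ((i - 2) % q₀)
  else seqOf 1 (accf N (i - 2 - mf N * q₀)) tQ

/-- **The state with components `nV, m, var, acc`** (a sequence of `2 + m (q₀ + 1)` digits of width `wd`). [folklore] -/
def build (nVf mf : ℕ → ℕ) (varf accf : ℕ → ℕ → ℕ → ℕ) (N : ℕ) : ℕ :=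
  seqOf (wd e N) (buildDigit nVf mf varf accf N) (min (2 + mf N * (q₀ + 1)) (capL e N))

/-- Tables are in Cobham's class: `2^{q₀}` rounds, a constant. [cite: Buss1986, §2.5] -/
theorem pv_table (haccf : PV₃ accf) : PV₂ fun N s => seqOf 1 (accf N s) tQ :=
  PV₂.seqOf (B₂ := fun _ _ => 1) (K₂ := fun _ _ => tQ) (S₂ := fun _ _ => 2 ^ tQ) (T₂ := fun _ _ => 1) haccf
    (IsPVDefinable.const 1) (IsPVDefinable.const _) (IsPVDefinable.const _) (IsPVDefinable.const 1)
    (fun _ _ => by rw [Nat.size_pow]; exact Nat.le_succ _) fun _ _ => by rw [Nat.size_one]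

/-- The digit function is in Cobham's class. [cite: Cobham1965] -/
theorem pv_buildDigit (hnV : PV₁ nVf) (hm : PV₁ mf) (hvar : PV₃ varf) (haccf : PV₃ accf) : PV₂ (buildDigit nVf mf varf accf) := by
  unfold PV₂ buildDigit
  have hi : IsPVDefinable fun v : Fin 2 → ℕ => v 1 := IsPVDefinable.proj 1
  have hmN : IsPVDefinable fun v : Fin 2 → ℕ => mf (v 0) := hm.comp (IsPVDefinable.proj 0)
  refine hi.ite_eq (IsPVDefinable.const 0) (hnV.comp (IsPVDefinable.proj 0)) ?_
  refine hi.ite_eq (IsPVDefinable.const 1) hmN ?_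
  refine hi.ite_lt ((IsPVDefinable.const 2).add (hmN.mul (IsPVDefinable.const q₀))) ?_ ?_
  · exact hvar.comp (IsPVDefinable.proj 0) ((hi.sub (IsPVDefinable.const 2)).div (IsPVDefinable.const q₀))
      ((hi.sub (IsPVDefinable.const 2)).mod (IsPVDefinable.const q₀))
  · exact (pv_table haccf).comp (IsPVDefinable.proj 0) ((hi.sub (IsPVDefinable.const 2)).sub (hmN.mul (IsPVDefinable.const q₀)))

/-- **`build` is in Cobham's class.** [cite: Buss1986, §2.5] -/
theorem pv_build (hnV : PV₁ nVf) (hm : PV₁ mf) (hvar : PV₃ varf) (haccf : PV₃ accf) : PV₁ (build e nVf mf varf accf) := by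
  refine PV₁.seqOf (pv_buildDigit hnV hm hvar haccf) (pv_wd e) (((IsPVDefinable.const 2).add ((hm.comp (IsPVDefinable.proj 0)).mul
    (IsPVDefinable.const _))).inf ((pv_capL e).comp (IsPVDefinable.proj 0))) ((pv_yd.comp (IsPVDefinable.proj 0)).ypow (e + 1))
    (T := fun N => 2 ^ tQ * ypow (yd N) (e + 1)) ((IsPVDefinable.const _).mul ((pv_yd.comp (IsPVDefinable.proj 0)).ypow (e + 1)))
    (fun N => (min_le_right _ _).trans (capL_le_size_ypow e N)) fun N => ?_
  unfold wd
  have h1 := capL_le_size_ypow e N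
  have h2 : (2 ^ tQ * ypow (yd N) (e + 1)).size = tQ + (ypow (yd N) (e + 1)).size := by
    have hy : ypow (yd N) (e + 1) ≠ 0 := fun h => by rw [h] at h1; simp at h1; unfold capL Bsz at h1; have := size_yd_ge N; simp_all
    rw [mul_comm, ← Nat.shiftLeft_eq, Nat.size_shiftLeft hy]; ring
  rw [h2]; omega

/-- **Reading a built state**: digits below the cap. [folklore] -/
theorem dig_build {N i : ℕ} (hi : i < 2 + mf N * (q₀ + 1)) (hcap : 2 + mf N * (q₀ + 1) ≤ capL e N)
    (hfit : buildDigit nVf mf varf accf N i < 2 ^ wd e N) : dig (wd e N) (build e nVf mf varf accf N) i = buildDigit nVf mf varf accf N i := by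
  unfold build; rw [min_eq_left hcap]; exact dig_seqOf_of_lt hi hfit

/-- Tables fit in a digit. [folklore] -/
theorem table_lt (f : ℕ → ℕ) (N : ℕ) : seqOf 1 f tQ < 2 ^ wd e N := by
  have h1 : tQ * 1 ≤ wd e N := by rw [mul_one]; exact Nat.le_add_right _ _
  exact (seqOf_lt 1 f _).trans_le (Nat.pow_le_pow_right two_pos h1)

/-- Reading a table bit. [folklore] -/
theorem tb_table (f : ℕ → ℕ) {t : ℕ} (ht : t < tQ) (hf : ∀ t, f t ≤ 1) : (Nat.testBit (seqOf 1 f tQ) t).toNat = f t := by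
  have h := dig_seqOf_of_lt (b := 1) (f := f) ht (by have := hf t; omega)
  unfold dig at h; rw [tbN_def]
  simpa using h

/-- The index arithmetic of variable digits. [folklore] -/
theorem var_index (s k : ℕ) (hk : k < q₀) : (2 + s * q₀ + k - 2) / q₀ = s ∧ (2 + s * q₀ + k - 2) % q₀ = k := by
  have hq := q₀_pos'
  rw [show 2 + s * q₀ + k - 2 = k + q₀ * s by rw [mul_comm]; omega]
  exact ⟨by rw [Nat.add_mul_div_left _ _ hq, Nat.div_eq_of_lt hk, zero_add], by rw [Nat.add_mul_mod_self_left, Nat.mod_eq_of_lt hk]⟩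

/-- **The representation lemma for built states.** [folklore] -/
theorem rep_build {N : ℕ} {φ : BCSP q₀} (hnV : nVf N = φ.nV) (hm : mf N = φ.cons.length)
    (hvar : ∀ s (hs : s < φ.cons.length) (k : Fin q₀), varf N s k = (φ.vars ⟨s, hs⟩ k).val)
    (hacc : ∀ s (hs : s < φ.cons.length) t, t < tQ → accf N s t = (φ.acc ⟨s, hs⟩ (τof t)).toNat)
    (hacc1 : ∀ s t, accf N s t ≤ 1) (hnVle : φ.nV ≤ 2 ^ capL e N) (hmle : 2 + φ.cons.length * (q₀ + 1) ≤ capL e N) :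
    Rep e N (build e nVf mf varf accf N) φ := by
  have hq := q₀_pos'
  have hcap : 2 + mf N * (q₀ + 1) ≤ capL e N := by rw [hm]; exact hmle
  have hpow : 2 ^ capL e N < 2 ^ wd e N := Nat.pow_lt_pow_right one_lt_two (capL_lt_wd e N)
  have hcapl : capL e N < 2 ^ capL e N := Nat.lt_pow_self one_lt_two
  -- every digit fits
  have hfit : ∀ i < 2 + mf N * (q₀ + 1), buildDigit nVf mf varf accf N i < 2 ^ wd e N := by
    intro i hi
    unfold buildDigit
    have hmm : φ.cons.length ≤ φ.cons.length * (q₀ + 1) := Nat.le_mul_of_pos_right _ (Nat.succ_pos _)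
    split_ifs with h0 h1 h2
    · rw [hnV]; omega
    · rw [hm]; omega
    · have hs : (i - 2) / q₀ < φ.cons.length := by
        rw [← hm]; exact Nat.div_lt_of_lt_mul (by rw [mul_comm]; omega)
      have := hvar _ hs ⟨(i - 2) % q₀, Nat.mod_lt _ hq⟩
      simp only at this
      rw [this]
      have := (φ.vars ⟨(i - 2) / q₀, hs⟩ ⟨(i - 2) % q₀, Nat.mod_lt _ hq⟩).2
      omega
    · exact table_lt e _ N
  have hread : ∀ i < 2 + mf N * (q₀ + 1), dig (wd e N) (build e nVf mf varf accf N) i = buildDigit nVf mf varf accf N i :=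
    fun i hi => dig_build e hi hcap (hfit i hi)
  refine ⟨?_, ?_, fun s hs k => ?_, fun s hs t ht => ?_, hnVle, hmle⟩
  · unfold stNV; rw [hread 0 (by omega)]; unfold buildDigit; rw [if_pos rfl, hnV]
  · unfold stM; rw [hread 1 (by omega)]; unfold buildDigit; rw [if_neg one_ne_zero, if_pos rfl, hm]
  · have hs' : s < mf N := by rw [hm]; exact hs
    have hi : 2 + s * q₀ + k.val < 2 + mf N * q₀ := by
      have := Nat.mul_le_mul_right q₀ (Nat.succ_le_of_lt hs'); rw [Nat.succ_mul] at this; have := k.2; omega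
    unfold stVar
    rw [hread _ (by nlinarith)]
    unfold buildDigit
    rw [if_neg (by omega), if_neg (by omega), if_pos hi, (var_index s k k.2).1, (var_index s k k.2).2]
    exact hvar s hs k
  · have hs' : s < mf N := by rw [hm]; exact hs
    have hM : stM e N (build e nVf mf varf accf N) = mf N := by
      unfold stM; rw [hread 1 (by omega)]; unfold buildDigit; rw [if_neg one_ne_zero, if_pos rfl]
    unfold stAcc stTbl
    rw [hM, hread _ (by nlinarith)]
    unfold buildDigit
    rw [if_neg (by omega), if_neg (by omega), if_neg (by omega), show 2 + mf N * q₀ + s - 2 - mf N * q₀ = s by omega,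
      tb_table _ ht (hacc1 s)]
    exact hacc s hs t ht

end Build

/-! ### Maxima over a range -/

/-- `maxBelow h k = max_{i<k} h i` (`0` if `k = 0`), as a loop. [folklore] -/
def maxBelow (h : ℕ → ℕ) (k : ℕ) : ℕ := loopNat 0 (fun i acc => max acc (h i)) k

/-- `maxBelow` at `k + 1`. [folklore] -/
theorem maxBelow_succ (h : ℕ → ℕ) (k : ℕ) : maxBelow h (k + 1) = max (maxBelow h k) (h k) := rfl

/-- `maxBelow` bounds its entries. [folklore] -/
theorem le_maxBelow (h : ℕ → ℕ) {i k : ℕ} (hi : i < k) : h i ≤ maxBelow h k := by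
  induction k with
  | zero => exact absurd hi (Nat.not_lt_zero _)
  | succ k ih =>
    rw [maxBelow_succ]
    rcases Nat.lt_succ_iff_lt_or_eq.1 hi with hi | rfl
    · exact (ih hi).trans (le_max_left _ _)
    · exact le_max_right _ _

/-- `maxBelow` is bounded by a common bound of its entries. [folklore] -/
theorem maxBelow_le {h : ℕ → ℕ} {k M : ℕ} (hM : ∀ i < k, h i ≤ M) : maxBelow h k ≤ M := by
  induction k with
  | zero => exact Nat.zero_le _
  | succ k ih => rw [maxBelow_succ]; exact max_le (ih fun i hi => hM i (Nat.lt_succ_of_lt hi)) (hM k (Nat.lt_succ_self k))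

/-- `foldr max` over an appended list. [folklore] -/
theorem foldr_max_eq (l : List ℕ) (a : ℕ) : l.foldr max a = max (l.foldr max 0) a := by
  induction l with
  | nil => simp
  | cons b l ih => rw [List.foldr_cons, List.foldr_cons, ih, max_assoc]

/-- **`maxBelow` is the `foldr max 0` of the mapped range.** [folklore] -/
theorem maxBelow_eq_foldr (h : ℕ → ℕ) (k : ℕ) : maxBelow h k = ((List.range k).map h).foldr max 0 := by
  induction k with
  | zero => rfl
  | succ k ih =>
    rw [maxBelow_succ, ih, List.range_succ, List.map_append, List.foldr_append, List.map_singleton, List.foldr_cons,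
      List.foldr_nil, foldr_max_eq (a := max (h k) 0), Nat.max_zero]

section MaxPV

variable {h₂ : ℕ → ℕ → ℕ} {h₃ : ℕ → ℕ → ℕ → ℕ} {K M S : ℕ → ℕ} {K₂ M₂ S₂ : ℕ → ℕ → ℕ}

/-- Maxima stay in Cobham's class, one datum. [cite: Buss1986, Ch. 1] -/
theorem PV₁.maxBelow (hh : PV₂ h₂) (hK : PV₁ K) (hS : PV₁ S) (hKS : ∀ a, K a ≤ (S a).size) (hM : PV₁ M) (hle : ∀ a, ∀ i < K a, h₂ a i ≤ M a) :
    PV₁ fun a => maxBelow (h₂ a) (K a) :=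
  PV₁.loopNat (St₃ := fun a i acc => max acc (h₂ a i)) (PV₁.const 0) ((IsPVDefinable.proj 2).sup (hh.comp (IsPVDefinable.proj 0) (IsPVDefinable.proj 1)))
    hK hS hKS hM fun a _ hi => maxBelow_le fun j hj => hle a j (lt_of_lt_of_le hj hi)

/-- Maxima stay in Cobham's class, a datum and a parameter. [cite: Buss1986, Ch. 1] -/
theorem PV₂.maxBelow (hh : PV₃ h₃) (hK : PV₂ K₂) (hS : PV₂ S₂) (hKS : ∀ a p, K₂ a p ≤ (S₂ a p).size) (hM : PV₂ M₂)
    (hle : ∀ a p, ∀ i < K₂ a p, h₃ a p i ≤ M₂ a p) : PV₂ fun a p => maxBelow (h₃ a p) (K₂ a p) :=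
  PV₂.loopNat (St₄ := fun a p i acc => max acc (h₃ a p i)) (IsPVDefinable.const 0)
    ((IsPVDefinable.proj 3).sup (hh.comp (IsPVDefinable.proj 0) (IsPVDefinable.proj 1) (IsPVDefinable.proj 2)))
    hK hS hKS hM fun a p _ hi => maxBelow_le fun j hj => hle a p j (lt_of_lt_of_le hj hi)

/-- Curried bounded count, a datum and two parameters. [cite: Buss1986, Ch. 1] -/
theorem PV₃.countBelow {P₄ : ℕ → ℕ → ℕ → ℕ → ℕ} {K₃ S₃ : ℕ → ℕ → ℕ → ℕ} (hP : PV₄ P₄) (hK : PV₃ K₃) (hS : PV₃ S₃)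
    (hKS : ∀ a p q, K₃ a p q ≤ (S₃ a p q).size) : PV₃ fun a p q => countBelow (P₄ a p q) (K₃ a p q) :=
  IsPVDefinable.of_countBelow (n := 3) (P := fun x => P₄ (x 0) (x 1) (x 2)) (K := fun x => K₃ (x 0) (x 1) (x 2)) (S := fun x => S₃ (x 0) (x 1) (x 2))
    (hP.comp (IsPVDefinable.proj 0) (IsPVDefinable.proj 1) (IsPVDefinable.proj 2) (IsPVDefinable.proj 3)) hK hS fun _ => hKS _ _ _

end MaxPV

/-! ### The first stage: `ofCNF q₀` of the parsed formula -/

/-- `numVars` of the parsed formula: the maximum of `variable + 1` over all literals. [cite: AroraBarakCC2009, §11.3.1] -/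
def numVarsN (N : ℕ) : ℕ := maxBelow (fun j => maxBelow (fun i => pVar N j i + 1) (pK N j)) (pM N)

/-- `numVarsN ≤ 2^{|N|}`. [folklore] -/
theorem numVarsN_le (N : ℕ) : numVarsN N ≤ 2 ^ N.size :=
  maxBelow_le fun _ _ => maxBelow_le fun _ _ => vVal_lt N _ _

/-- `numVarsN` is in Cobham's class. [cite: Buss1986, Ch. 1] -/
theorem pv_numVarsN : PV₁ numVarsN := by
  have hin : PV₂ fun N j => maxBelow (fun i => pVar N j i + 1) (pK N j) :=
    PV₂.maxBelow (S₂ := fun N _ => N) (M₂ := fun N _ => 2 ^ N.size) (pv_pVar.comp (IsPVDefinable.proj 0) (IsPVDefinable.proj 1) (IsPVDefinable.proj 2)).succ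
      pv_pK (IsPVDefinable.proj 0) (fun N _ => vEnd_le N _ _) ((IsPVDefinable.proj 0).pow_len) fun N _ _ _ => vVal_lt N _ _
  exact PV₁.maxBelow (S := fun N => N) (M := fun N => 2 ^ N.size) hin pv_pM (IsPVDefinable.proj 0) (fun N => vEnd_le N 0 1)
    ((IsPVDefinable.proj 0).pow_len) fun N _ _ => maxBelow_le fun _ _ => vVal_lt N _ _

/-- **`numVarsN N` is `numVars` of the parsed formula.** [cite: AroraBarakCC2009, §11.3.1] -/
theorem numVarsN_eq (N : ℕ) : numVarsN N = (parsed N).numVars := by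
  unfold numVarsN CNF.numVars parsed descCNF
  rw [maxBelow_eq_foldr]
  -- both sides are `foldr max 0` of the same flattened list
  have key : ∀ (L : List ℕ) (g : ℕ → List ℕ), (L.map fun j => (g j).foldr max 0).foldr max 0 = (L.flatMap g).foldr max 0 := by
    intro L g
    induction L with
    | nil => rfl
    | cons j L ih => rw [List.map_cons, List.foldr_cons, List.flatMap_cons, List.foldr_append, ih, ← foldr_max_eq]
  rw [List.map_congr_left (fun j _ => maxBelow_eq_foldr (fun i => pVar N j i + 1) (pK N j)), key, List.flatten_eq_flatMap,
    List.flatMap_map, List.map_flatMap]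
  congr 1
  refine List.flatMap_congr fun j _ => ?_
  dsimp only [id]
  rw [List.map_map]
  rfl

/-- The variable read at position `k` of constraint `s`. [cite: AroraBarakCC2009, §11.3.1] -/
def ofVar (N s k : ℕ) : ℕ := if k < pK N s then min (pVar N s k) (numVarsN N) else numVarsN N

/-- `ofVar` is in Cobham's class. [cite: Cobham1965] -/
theorem pv_ofVar : PV₃ ofVar :=
  (IsPVDefinable.proj 2).ite_lt (pv_pK.comp (IsPVDefinable.proj 0) (IsPVDefinable.proj 1))
    ((pv_pVar.comp (IsPVDefinable.proj 0) (IsPVDefinable.proj 1) (IsPVDefinable.proj 2)).inf (pv_numVarsN.comp (IsPVDefinable.proj 0)))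
    (pv_numVarsN.comp (IsPVDefinable.proj 0))

/-- The number of positions `i < min k q₀` whose bit of `t` is the polarity. [folklore] -/
def ofHits (N s t : ℕ) : ℕ := countBelow (fun i => if (Nat.testBit t i).toNat = pPol N s i then 1 else 0) (min (pK N s) q₀)

/-- `ofHits` is in Cobham's class. [cite: Buss1986, Ch. 1] -/
theorem pv_ofHits : PV₃ ofHits :=
  PV₃.countBelow (K₃ := fun N s _ => min (pK N s) q₀) (S₃ := fun N _ _ => N)
    ((pv_tb.comp (IsPVDefinable.proj 2) (IsPVDefinable.proj 3)).eqTest (pv_pPol.comp (IsPVDefinable.proj 0) (IsPVDefinable.proj 1) (IsPVDefinable.proj 3)))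
    (((pv_pK.comp (IsPVDefinable.proj 0) (IsPVDefinable.proj 1)).inf (IsPVDefinable.const q₀))) (IsPVDefinable.proj 0)
    fun N _ _ => (min_le_left _ _).trans (vEnd_le N _ _)

/-- The acceptance bit of constraint `s` at local assignment `t`. [cite: AroraBarakCC2009, §11.3.1] -/
def ofAcc (N s t : ℕ) : ℕ := if ofHits N s t = 0 then 0 else 1

/-- `ofAcc` is in Cobham's class. [cite: Cobham1965] -/
theorem pv_ofAcc : PV₃ ofAcc := (pv_ofHits.comp (IsPVDefinable.proj 0) (IsPVDefinable.proj 1) (IsPVDefinable.proj 2)).cond (IsPVDefinable.const 0) (IsPVDefinable.const 1)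

/-- `ofAcc ≤ 1`. [folklore] -/
theorem ofAcc_le (N s t : ℕ) : ofAcc N s t ≤ 1 := by unfold ofAcc; split_ifs <;> simp

/-- **The coded first stage**: the state of `ofCNF q₀ (parsed N)`. [cite: AroraBarakCC2009, §11.3.1 and §22.2.1] -/
def ofS (N : ℕ) : ℕ := build e (fun N => numVarsN N + 1) pM ofVar ofAcc N

/-- `ofS` is in Cobham's class. [cite: Cobham1965] -/
theorem pv_ofS : PV₁ (ofS e) := pv_build e (pv_numVarsN.comp (IsPVDefinable.proj 0)).succ pv_pM pv_ofVar pv_ofAcc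

/-- The clauses of the parsed formula. [folklore] -/
theorem parsed_getElem {N s : ℕ} (hs : s < (parsed N).length) :
    (parsed N)[s] = (List.range (pK N s)).map fun i => (pVar N s i, decide (pPol N s i = 1)) := by
  unfold parsed descCNF; simp only [List.getElem_map, List.getElem_range]

/-- The variables of `ofCNF`, as numbers. [cite: AroraBarakCC2009, §11.3.1] -/
theorem vars_ofCNF_val (φ : CNF ℕ) {s : ℕ} (hs : s < (ofCNF q₀ φ).cons.length) (k : Fin q₀) :
    ((ofCNF q₀ φ).vars ⟨s, hs⟩ k).val =
      if h : k.val < (φ[s]'(lt_length_of_fin q₀ ⟨s, hs⟩)).length then min (((φ[s]'(lt_length_of_fin q₀ ⟨s, hs⟩))[k.val]'h).1) φ.numVars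
      else φ.numVars := by
  unfold BCSP.vars; rw [ofCNF_cons_getElem]; unfold clauseCons; simp only; split_ifs <;> rfl

/-- The acceptance of `ofCNF`. [cite: AroraBarakCC2009, §11.3.1] -/
theorem acc_ofCNF_eq (φ : CNF ℕ) {s : ℕ} (hs : s < (ofCNF q₀ φ).cons.length) (τ : Fin q₀ → Bool) :
    (ofCNF q₀ φ).acc ⟨s, hs⟩ τ = (clauseCons q₀ φ (φ[s]'(lt_length_of_fin q₀ ⟨s, hs⟩))).2 τ := by
  unfold BCSP.acc; rw [ofCNF_cons_getElem]

/-- When the clause constraint accepts. [cite: AroraBarakCC2009, §11.3.1] -/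
theorem clauseCons_acc_true_iff (φ : CNF ℕ) (cl : Clause ℕ) (τ : Fin q₀ → Bool) :
    (clauseCons q₀ φ cl).2 τ = true ↔ ∃ i : Fin q₀, ∃ h : i.val < cl.length, τ i = (cl[i.val]).2 := by
  unfold clauseCons; simp only [decide_eq_true_eq]

/-- Polarity bits as Booleans. [folklore] -/
theorem pPol_toNat (N s i : ℕ) : (decide (pPol N s i = 1)).toNat = pPol N s i := by
  have := Bool.toNat_le (Nat.testBit N (vRest N (pLit N s i) 4))
  unfold pPol at this ⊢
  interval_cases ((Nat.testBit N (vRest N (pLit N s i) 4)).toNat) <;> simp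

/-- **The first stage is correctly coded**: `Rep e N (ofS e N) (ofCNF q₀ (parsed N))` (cap exponent `e ≥ 2`).
[cite: AroraBarakCC2009, §11.3.1 and §22.2.1] -/
theorem rep_ofS (he : 2 ≤ e) (N : ℕ) : Rep e N (ofS e N) (ofCNF q₀ (parsed N)) := by
  have hq := q₀_pos'
  refine rep_build e (by rw [numVarsN_eq]; rfl) (by rw [ofCNF_length, length_parsed]) (fun s hs k => ?_) (fun s hs t ht => ?_)
    (fun s t => ofAcc_le N s t) ?_ ?_
  · -- variables
    have hs' : s < (parsed N).length := lt_length_of_fin q₀ ⟨s, hs⟩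
    rw [vars_ofCNF_val]
    simp only [parsed_getElem hs', List.length_map, List.length_range, List.getElem_map, List.getElem_range]
    unfold ofVar
    rw [numVarsN_eq]
    split_ifs <;> rfl
  · -- tables
    have hs' : s < (parsed N).length := lt_length_of_fin q₀ ⟨s, hs⟩
    rw [acc_ofCNF_eq]
    have hiff : (clauseCons q₀ (parsed N) ((parsed N)[s]'hs')).2 (τof t) = true ↔ ofHits N s t ≠ 0 := by
      rw [clauseCons_acc_true_iff]
      simp only [parsed_getElem hs', List.length_map, List.length_range, List.getElem_map, List.getElem_range]
      unfold ofHits countBelow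
      rw [Ne, Finset.card_eq_zero, ← Ne, ← Finset.nonempty_iff_ne_empty]
      constructor
      · rintro ⟨i, hi, hτ⟩
        refine ⟨i.val, ?_⟩
        rw [Finset.mem_filter, Finset.mem_range, lt_min_iff]
        refine ⟨⟨hi, i.2⟩, ?_⟩
        show (if (Nat.testBit t i.val).toNat = pPol N s i.val then 1 else 0) ≠ 0
        rw [if_pos]
        · exact one_ne_zero
        · rw [show Nat.testBit t i.val = τof t i from rfl, hτ, pPol_toNat]
      · rintro ⟨i, hi⟩
        rw [Finset.mem_filter, Finset.mem_range, lt_min_iff] at hi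
        obtain ⟨⟨hi1, hi2⟩, hne⟩ := hi
        refine ⟨⟨i, hi2⟩, hi1, ?_⟩
        by_cases hb : (Nat.testBit t i).toNat = pPol N s i
        · show t.testBit i = decide (pPol N s i = 1)
          rw [← hb]
          cases t.testBit i <;> rfl
        · exact absurd (if_neg hb) hne
    unfold ofAcc
    cases hb : (clauseCons q₀ (parsed N) ((parsed N)[s]'hs')).2 (τof t)
    · have h0 : ofHits N s t = 0 := by
        by_contra h
        rw [hiff.2 h] at hb
        exact Bool.noConfusion hb
      rw [if_pos h0]; rfl
    · rw [if_neg (hiff.1 hb)]; rfl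
  · -- `nV ≤ 2^{capL}`
    show (parsed N).numVars + 1 ≤ 2 ^ capL e N
    rw [← numVarsN_eq]
    have h1 := numVarsN_le N
    have h2 : N.size + 1 ≤ capL e N := by
      unfold capL
      calc N.size + 1 ≤ Bsz N := size_succ_le_size_yd N
        _ = Bsz N ^ 1 := (pow_one _).symm
        _ ≤ Bsz N ^ (e + 1) := Nat.pow_le_pow_right (by have := size_yd_ge N; unfold Bsz; omega) (by omega)
    calc numVarsN N + 1 ≤ 2 ^ N.size + 2 ^ N.size := by have := Nat.one_le_two_pow (n := N.size); omega
      _ = 2 ^ (N.size + 1) := by rw [pow_succ]; ring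
      _ ≤ 2 ^ capL e N := Nat.pow_le_pow_right two_pos h2
  · -- `2 + m (q₀ + 1) ≤ capL`
    rw [ofCNF_length, length_parsed]
    have hm : pM N ≤ Bsz N := (vEnd_le N 0 1).trans (size_le_size_yd N)
    have hB : 65 ≤ Bsz N := size_yd_ge N
    unfold capL
    have h3 : Bsz N ^ 3 ≤ Bsz N ^ (e + 1) := Nat.pow_le_pow_right (by omega) (by omega)
    rw [q₀_eq]
    have hsq : 65 * 65 ≤ Bsz N * Bsz N := Nat.mul_le_mul hB hB
    calc 2 + pM N * (864 + 1) ≤ 2 + Bsz N * 865 := by nlinarith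
      _ ≤ 65 * 65 * Bsz N := by omega
      _ ≤ Bsz N * Bsz N * Bsz N := Nat.mul_le_mul_right _ hsq
      _ = Bsz N ^ 3 := by ring
      _ ≤ Bsz N ^ (e + 1) := h3

end GapPV

end Literature.Computability.Complexity

/-!
## V. Indexing into concatenations (`flatMap` over a range)

The last stage of the reduction (`BCSP.toE3CNF`) and the round itself produce lists of the shape
`(List.range n).flatMap g` with blocks `g u` of varying lengths.  To describe such a list by definable
functions of the position `J` one needs the block `blk J` containing position `J` and the offset
`off J` inside it — prefix sums and a bounded search:

* `length_flatMap_range`, `getElem_flatMap_range_add` (position `pref u + j` holds `(g u)[j]`);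
* `blk cnt n J`, `off cnt n J` with `blk_lt`, `pref_blk_le`, `lt_pref_blk_succ`, `off_lt`, `pref_blk_add_off`,
  and **`getElem_flatMap_range`**: `L[J] = (g (blk J))[off J]`;
* definability with a datum and a parameter (`(N, S, ·)`): `pv_pref₃`, `pv_blk₃`, `pv_off₃`, `pv_total₂`, given a
  yardstick for the number of blocks; the yardstick `ydT e N` of length `≥ (tQ + 1) · capL e N`.

## References

* S. R. Buss, *Bounded Arithmetic*, 1986, Ch. 1 (bounded sums and minimisation in Cobham's class).
-/

set_option exponentiation.threshold 4096

namespace Literature.Computability.Complexity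

open _root_.Computability Literature.Analysis.FunctionSpaces

namespace GapPV

open StrNum

/-! ### Lists: positions in a `flatMap` over a range -/

section Lists

variable {α : Type} (g : ℕ → List α)

/-- The length of a `flatMap` over a range is the sum of the block lengths. [folklore] -/
theorem length_flatMap_range (n : ℕ) : ((List.range n).flatMap g).length = sumBelow (fun u => (g u).length) n := by
  induction n with
  | zero => rfl
  | succ n ih => rw [List.range_succ, List.flatMap_append, List.length_append, ih, sumBelow, sumBelow, Finset.sum_range_succ]; simp

/-- Prefix sums are monotone. [folklore] -/
theorem sumBelow_mono (c : ℕ → ℕ) {u v : ℕ} (h : u ≤ v) : sumBelow c u ≤ sumBelow c v := by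
  unfold sumBelow; exact Finset.sum_le_sum_of_subset (Finset.range_subset_range.2 h)

/-- One more term. [folklore] -/
theorem sumBelow_succ (c : ℕ → ℕ) (u : ℕ) : sumBelow c (u + 1) = sumBelow c u + c u := by
  unfold sumBelow; rw [Finset.sum_range_succ]

/-- **Position `pref u + j` holds `(g u)[j]`.** [folklore] -/
theorem getElem_flatMap_range_add {n u j : ℕ} (hu : u < n) (hj : j < (g u).length)
    (hp : sumBelow (fun u => (g u).length) u + j < ((List.range n).flatMap g).length) :
    ((List.range n).flatMap g)[sumBelow (fun u => (g u).length) u + j] = (g u)[j] := by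
  induction n with
  | zero => exact absurd hu (Nat.not_lt_zero _)
  | succ n ih =>
    have hsplit : (List.range (n + 1)).flatMap g = (List.range n).flatMap g ++ g n := by
      rw [List.range_succ, List.flatMap_append]; simp
    simp only [hsplit]
    rcases Nat.lt_succ_iff_lt_or_eq.1 hu with hu' | rfl
    · have hlt : sumBelow (fun u => (g u).length) u + j < ((List.range n).flatMap g).length := by
        rw [length_flatMap_range]
        calc sumBelow (fun u => (g u).length) u + j < sumBelow (fun u => (g u).length) u + (g u).length := by omega
          _ = sumBelow (fun u => (g u).length) (u + 1) := (sumBelow_succ _ _).symm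
          _ ≤ _ := sumBelow_mono _ hu'
      rw [List.getElem_append_left hlt]
      exact ih hu' hlt
    · rw [List.getElem_append_right (by rw [length_flatMap_range]; omega)]
      simp only [length_flatMap_range, Nat.add_sub_cancel_left]

end Lists

/-! ### Numbers: block and offset of a flat position -/

/-- The block containing flat position `J`: the least `u < n` with `J < pref (u+1)` (`n` if none). [folklore] -/
def blk (cnt : ℕ → ℕ) (n J : ℕ) : ℕ := muNat (fun u => if J < sumBelow cnt (u + 1) then 1 else 0) n

/-- The offset of flat position `J` in its block. [folklore] -/
def off (cnt : ℕ → ℕ) (n J : ℕ) : ℕ := J - sumBelow cnt (blk cnt n J)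

section Blk

variable (cnt : ℕ → ℕ) {n J : ℕ} (hJ : J < sumBelow cnt n)
include hJ

/-- The block is `< n`. [folklore] -/
theorem blk_lt : blk cnt n J < n := by
  unfold blk
  by_contra h
  rw [not_lt] at h
  have hle := muNat_le (fun u => if J < sumBelow cnt (u + 1) then 1 else 0) n
  have heq : muNat (fun u => if J < sumBelow cnt (u + 1) then 1 else 0) n = n := le_antisymm hle h
  rcases n with _ | n
  · simp [sumBelow] at hJ
  · have := eq_zero_of_lt_muNat (P := fun u => if J < sumBelow cnt (u + 1) then 1 else 0) (k := n + 1) (i := n) (by rw [heq]; exact Nat.lt_succ_self n)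
    have h2 : (if J < sumBelow cnt (n + 1) then 1 else 0) = 0 := this
    rw [if_pos hJ] at h2
    exact one_ne_zero h2

/-- `J` lies before the end of its block. [folklore] -/
theorem lt_pref_blk_succ : J < sumBelow cnt (blk cnt n J + 1) := by
  have h := ne_zero_muNat (P := fun u => if J < sumBelow cnt (u + 1) then 1 else 0) (blk_lt cnt hJ)
  by_contra hc
  have h2 : (if J < sumBelow cnt (blk cnt n J + 1) then 1 else 0) ≠ 0 := h
  rw [if_neg hc] at h2
  exact h2 rfl

omit hJ in
/-- `J` lies after the start of its block. [folklore] -/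
theorem pref_blk_le : sumBelow cnt (blk cnt n J) ≤ J := by
  rcases Nat.eq_zero_or_pos (blk cnt n J) with h0 | hpos
  · rw [h0]; simp [sumBelow]
  · have h := eq_zero_of_lt_muNat (P := fun u => if J < sumBelow cnt (u + 1) then 1 else 0) (k := n) (i := blk cnt n J - 1)
      (Nat.sub_lt hpos one_pos)
    have h2 : (if J < sumBelow cnt (blk cnt n J - 1 + 1) then 1 else 0) = 0 := h
    rw [Nat.sub_add_cancel hpos] at h2
    by_contra hc
    rw [not_le] at hc
    rw [if_pos hc] at h2
    exact one_ne_zero h2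

/-- The offset is inside the block. [folklore] -/
theorem off_lt : off cnt n J < cnt (blk cnt n J) := by
  unfold off
  have h1 := lt_pref_blk_succ cnt hJ
  have h2 := pref_blk_le cnt (n := n) (J := J)
  rw [sumBelow_succ] at h1
  omega

omit hJ in
/-- `J = pref (blk J) + off J`. [folklore] -/
theorem pref_blk_add_off : sumBelow cnt (blk cnt n J) + off cnt n J = J := by
  unfold off; have := pref_blk_le cnt (n := n) (J := J); omega

end Blk

/-- **Indexing into a `flatMap`**: `L[J] = (g (blk J))[off J]`. [folklore] -/
theorem getElem_flatMap_range {α : Type} (g : ℕ → List α) {n J : ℕ} (hJ : J < ((List.range n).flatMap g).length) :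
    ((List.range n).flatMap g)[J] =
      (g (blk (fun u => (g u).length) n J))[off (fun u => (g u).length) n J]'(off_lt _ (by rwa [length_flatMap_range] at hJ)) := by
  have hJ' : J < sumBelow (fun u => (g u).length) n := by rwa [length_flatMap_range] at hJ
  have h := getElem_flatMap_range_add g (blk_lt _ hJ') (off_lt _ hJ') (by rw [pref_blk_add_off]; exact hJ)
  simp only [pref_blk_add_off] at h
  exact h

/-! ### Definability, with a datum and a parameter -/

section PV

variable {cnt : ℕ → ℕ → ℕ → ℕ} {nb Y : ℕ → ℕ → ℕ}

/-- Prefix sums `(N, S, u) ↦ ∑_{u' < min u nb} cnt N S u'` are in Cobham's class (blocks `nb ≤ |Y|`, block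
lengths `≤ M`). [cite: Buss1986, Ch. 1] -/
theorem pv_pref₃ {M : ℕ → ℕ → ℕ} (hcnt : PV₃ cnt) (hnb : PV₂ nb) (hY : PV₂ Y) (hnY : ∀ N S, nb N S ≤ (Y N S).size) (hM : PV₂ M)
    (hle : ∀ N S u, cnt N S u ≤ M N S) : PV₃ fun N S u => sumBelow (cnt N S) (min u (nb N S)) :=
  PV₃.sumBelow (K₃ := fun N S u => min u (nb N S)) (S₃ := fun N S _ => Y N S) (M₃ := fun N S _ => M N S)
    (hcnt.comp (IsPVDefinable.proj 0) (IsPVDefinable.proj 1) (IsPVDefinable.proj 3))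
    ((IsPVDefinable.proj 2).inf (hnb.comp (IsPVDefinable.proj 0) (IsPVDefinable.proj 1))) (hY.comp (IsPVDefinable.proj 0) (IsPVDefinable.proj 1))
    (fun N S _ => (min_le_right _ _).trans (hnY N S)) (hM.comp (IsPVDefinable.proj 0) (IsPVDefinable.proj 1)) fun N S _ i _ => hle N S i

/-- The block function `(N, S, J) ↦ blk (cnt N S) (nb N S) J` is in Cobham's class. [cite: Buss1986, Ch. 1] -/
theorem pv_blk₃ {M : ℕ → ℕ → ℕ} (hcnt : PV₃ cnt) (hnb : PV₂ nb) (hY : PV₂ Y) (hnY : ∀ N S, nb N S ≤ (Y N S).size) (hM : PV₂ M)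
    (hle : ∀ N S u, cnt N S u ≤ M N S) : PV₃ fun N S J => blk (cnt N S) (nb N S) J := by
  -- the test `J < pref (u+1)` with the prefix clocked by `nb` (agrees for `u < nb`)
  have hp := pv_pref₃ hcnt hnb hY hnY hM hle
  have hP : PV₄ fun N S J u => if J < sumBelow (cnt N S) (min (u + 1) (nb N S)) then 1 else 0 :=
    (IsPVDefinable.proj 2).ltTest (hp.comp (IsPVDefinable.proj 0) (IsPVDefinable.proj 1) (IsPVDefinable.proj 3).succ)
  have h := PV₃.muNat (K₃ := fun N S _ => nb N S) (S₃ := fun N S _ => Y N S) hP (hnb.comp (IsPVDefinable.proj 0) (IsPVDefinable.proj 1))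
    (hY.comp (IsPVDefinable.proj 0) (IsPVDefinable.proj 1)) fun N S _ => hnY N S
  refine h.of_eq fun N S J => ?_
  unfold blk muNat
  exact loopNat_congr fun u hu acc => by simp only [min_eq_left (Nat.succ_le_of_lt hu)]

/-- The offset function is in Cobham's class. [cite: Buss1986, Ch. 1] -/
theorem pv_off₃ {M : ℕ → ℕ → ℕ} (hcnt : PV₃ cnt) (hnb : PV₂ nb) (hY : PV₂ Y) (hnY : ∀ N S, nb N S ≤ (Y N S).size) (hM : PV₂ M)
    (hle : ∀ N S u, cnt N S u ≤ M N S) : PV₃ fun N S J => off (cnt N S) (nb N S) J := by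
  have hb := pv_blk₃ hcnt hnb hY hnY hM hle
  have hp := pv_pref₃ hcnt hnb hY hnY hM hle
  refine ((IsPVDefinable.proj 2).sub (hp.comp (IsPVDefinable.proj 0) (IsPVDefinable.proj 1)
    (hb.comp (IsPVDefinable.proj 0) (IsPVDefinable.proj 1) (IsPVDefinable.proj 2)))).of_eq fun v => ?_
  show _ = v 2 - sumBelow (cnt (v 0) (v 1)) (blk (cnt (v 0) (v 1)) (nb (v 0) (v 1)) (v 2))
  unfold blk
  rw [min_eq_left (muNat_le _ _)]

/-- The total length `(N, S) ↦ pref nb` is in Cobham's class. [cite: Buss1986, Ch. 1] -/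
theorem pv_total₂ {M : ℕ → ℕ → ℕ} (hcnt : PV₃ cnt) (hnb : PV₂ nb) (hY : PV₂ Y) (hnY : ∀ N S, nb N S ≤ (Y N S).size) (hM : PV₂ M)
    (hle : ∀ N S u, cnt N S u ≤ M N S) : PV₂ fun N S => sumBelow (cnt N S) (nb N S) :=
  ((pv_pref₃ hcnt hnb hY hnY hM hle).comp (IsPVDefinable.proj 0) (IsPVDefinable.proj 1) (hnb.comp (IsPVDefinable.proj 0) (IsPVDefinable.proj 1))).of_eq
    fun v => by simp only [min_self]

end PV

/-! ### The yardstick for block counts -/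

variable (e : ℕ)

/-- `ydT e N = 2^{tQ} # ypow (yd N) (e+1)`, of length `≥ (tQ + 1) capL e N`. [folklore] -/
def ydT (N : ℕ) : ℕ := 2 ^ ((2 ^ tQ).size * (ypow (yd N) (e + 1)).size)

/-- `ydT` is in Cobham's class. [cite: Buss1986, §2.2] -/
theorem pv_ydT : PV₁ (ydT e) := (IsPVDefinable.const _).smash ((pv_yd.comp (IsPVDefinable.proj 0)).ypow (e + 1))

/-- `(tQ + 1) capL ≤ |ydT|`. [folklore] -/
theorem mul_capL_le_size_ydT (N : ℕ) : (tQ + 1) * capL e N ≤ (ydT e N).size := by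
  unfold ydT
  rw [Nat.size_pow, Nat.size_pow]
  have := capL_le_size_ypow e N
  calc (tQ + 1) * capL e N ≤ (tQ + 1) * (ypow (yd N) (e + 1)).size := Nat.mul_le_mul_left _ this
    _ ≤ _ := Nat.le_succ _

end GapPV

end Literature.Computability.Complexity

/-!
## Counting lemmas

Generic facts about the bounded loops of `PVSeq.lean` used by several stages of the machine:
`countBelow_succ/mono/eq_zero_iff/congr`, counting as the length of a filtered range
(`countBelow_eq_length_filter`), `muNat_succ_of_lt`, and **the `r`-th element of a filtered range as a
bounded search** (`getElem_filter_range`), plus the index of an element of a filtered range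
(`idxOf_filter_range`).

## References

* S. R. Buss, *Bounded Arithmetic*, Bibliopolis 1986, Ch. 1 (bounded counting / minimisation).
-/

namespace Literature.Computability.Complexity

open Literature.Analysis.FunctionSpaces StrNum

namespace GapPV

/-! ### Generic facts: counts, filters, the `r`-th kept index -/

/-- One more candidate in a count. [folklore] -/
theorem countBelow_succ (P : ℕ → ℕ) (k : ℕ) : countBelow P (k + 1) = countBelow P k + (if P k = 0 then 0 else 1) := by
  rw [countBelow_eq_sumBelow, countBelow_eq_sumBelow, sumBelow_succ]

/-- Counts are monotone. [folklore] -/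
theorem countBelow_mono (P : ℕ → ℕ) {u v : ℕ} (h : u ≤ v) : countBelow P u ≤ countBelow P v := by
  rw [countBelow_eq_sumBelow, countBelow_eq_sumBelow]; exact sumBelow_mono _ h

/-- A count vanishes iff all tests fail. [folklore] -/
theorem countBelow_eq_zero_iff (P : ℕ → ℕ) (k : ℕ) : countBelow P k = 0 ↔ ∀ i < k, P i = 0 := by
  unfold countBelow
  rw [Finset.card_eq_zero, Finset.filter_eq_empty_iff]
  simp only [Finset.mem_range, not_not]

/-- Counts with tests agreeing below the bound agree. [folklore] -/
theorem countBelow_congr {P Q : ℕ → ℕ} {k : ℕ} (h : ∀ i < k, P i = Q i) : countBelow P k = countBelow Q k := by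
  rw [countBelow_eq_sumBelow, countBelow_eq_sumBelow]; exact sumBelow_congr fun i hi => by rw [h i hi]

/-- **Counting is the length of the filtered range.** [folklore] -/
theorem countBelow_eq_length_filter (p : ℕ → Prop) [DecidablePred p] (k : ℕ) :
    countBelow (fun i => if p i then 1 else 0) k = ((List.range k).filter fun i => p i).length := by
  induction k with
  | zero => rfl
  | succ k ih =>
    rw [countBelow_succ, ih, List.range_succ, List.filter_append, List.length_append]
    by_cases h : p k <;> simp [h]

/-- `muNat` does not change once found. [folklore] -/
theorem muNat_succ_of_lt {P : ℕ → ℕ} {k : ℕ} (h : muNat P k < k) : muNat P (k + 1) = muNat P k :=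
  muNat_eq_of ((muNat_le P k).trans (Nat.le_succ k)) (fun _ hz => eq_zero_of_lt_muNat hz) fun _ => ne_zero_muNat h

/-- **The `r`-th element of a filtered range is a bounded search**: the least `i` with more than `r` kept
indices `≤ i`. [folklore] -/
theorem getElem_filter_range (p : ℕ → Prop) [DecidablePred p] (k r : ℕ) (hr : r < ((List.range k).filter fun i => p i).length) :
    ((List.range k).filter fun i => p i)[r] = muNat (fun i => if r < countBelow (fun i' => if p i' then 1 else 0) (i + 1) then 1 else 0) k := by
  induction k with
  | zero => simp at hr
  | succ k ih =>
    have hsplit : ((List.range (k + 1)).filter fun i => p i) = ((List.range k).filter fun i => p i) ++ (if p k then [k] else []) := by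
      rw [List.range_succ, List.filter_append]; by_cases h : p k <;> simp [h]
    by_cases hlt : r < ((List.range k).filter fun i => p i).length
    · have h1 := ih hlt
      have hmem : ((List.range k).filter fun i => p i)[r] ∈ (List.range k).filter fun i => p i := List.getElem_mem hlt
      rw [List.mem_filter, List.mem_range] at hmem
      simp only [hsplit]
      rw [List.getElem_append_left hlt, h1, muNat_succ_of_lt (by rw [← h1]; exact hmem.1)]
    · -- `r` is the new element `k`
      have hpk : p k := by
        by_contra h; rw [hsplit, if_neg h, List.append_nil] at hr; exact hlt hr
      have hr' : r = ((List.range k).filter fun i => p i).length := by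
        rw [hsplit, if_pos hpk, List.length_append, List.length_singleton] at hr; omega
      simp only [hsplit]
      rw [List.getElem_append_right (not_lt.1 hlt)]
      simp only [if_pos hpk, List.getElem_singleton]
      symm
      refine muNat_eq_of (Nat.le_succ k) (fun z hz => ?_) (fun _ => ?_)
      · rw [if_neg]
        rw [not_lt, countBelow_eq_length_filter, hr']
        have := countBelow_mono (fun i' => if p i' then 1 else 0) (Nat.succ_le_of_lt hz)
        rw [countBelow_eq_length_filter, countBelow_eq_length_filter] at this
        exact this
      · rw [if_pos]
        · exact one_ne_zero
        · rw [countBelow_eq_length_filter, List.range_succ, List.filter_append, List.length_append, hr']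
          simp [hpk]

/-- **The index of a kept element in the filtered range is the count of kept elements below it.** [folklore] -/
theorem idxOf_filter_range (p : ℕ → Prop) [DecidablePred p] (k x : ℕ) (hx : x < k) (hpx : p x) :
    ((List.range k).filter fun i => p i).idxOf x = countBelow (fun i' => if p i' then 1 else 0) x := by
  induction k with
  | zero => exact absurd hx (Nat.not_lt_zero _)
  | succ k ih =>
    rw [List.range_succ, List.filter_append]
    by_cases hxk : x < k
    · have hmem : x ∈ (List.range k).filter fun i => p i := by rw [List.mem_filter, List.mem_range]; exact ⟨hxk, by simpa using hpx⟩
      rw [List.idxOf_append_of_mem hmem, ih hxk]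
    · have hxe : x = k := by omega
      subst hxe
      have hnot : x ∉ (List.range x).filter fun i => p i := by rw [List.mem_filter, List.mem_range]; omega
      rw [List.idxOf_append_of_notMem hnot, countBelow_eq_length_filter]
      simp [hpx]

end GapPV

end Literature.Computability.Complexity


/-!
# Part B — one round of Dinur's reduction on coded instances

The round `ggP.round` of `Round.lean` on the Gabber–Galil kit (`GabberGalilKit.lean`) — arity reduction,
degree reduction on the cloud expanders `Xc k`, expanderizing with `XM n`, lazy powering and alphabet
reduction by the Walsh–Hadamard assignment tester — *mirrored by number-theoretic functions* on the
digits of a coded state: rotation maps as closed arithmetic formulas (`Mirrors G nb lb`), walks and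
balls as counted loops, the tester's coins, tables and queries as digit manipulations, and finally
`roundS e N S` with **`rep_roundS : Rep e N S φ → … → Rep e N (roundS e N S) (ggP.round φ)`**.
The parts (stage 1; walks; graph operations; stage 2; the explicit expanders; balls and the walk
constraint; coins; quadratic-equation tables; queries and verdict; the round) keep their own headers.
Definability of all these functions is proved in `ApproximationProofs.lean` (Part D).
-/

/-!
## IX. The round, stage 1 (arity reduction, Claim 22.36)

The first stage of `RoundParams.round` is `arityW φ = ⟨nV + m, m q₀, W, arEdge vars, arR acc⟩`
(`ArityReduction.lean`): binary constraints `x < m q₀`, `x ↦ (s, j) = (x / q₀, x mod q₀)`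
(`finProdFinEquiv`), on the ordered pair `(y_s, u_{vars s j}) = (nV + s, vars s j)` (`finSumFinEquiv`),
with relation `arR x a b = [a < 2^{q₀} ∧ acc s τ_a ∧ b = bit (τ_a j)]`.  On a coded instance
(`Rep e N S φ`) these are the definable functions `aE1`, `aE2` (the two endpoints) and `aR`
(the relation, `0/1`-valued), with the correctness lemmas `aE1_eq`, `aE2_eq`, `aR_eq`.

## References

* S. Arora, B. Barak, *Computational Complexity: A Modern Approach*, CUP 2009, §22.A, Claim 22.36.
-/

set_option exponentiation.threshold 4096

namespace Literature.Computability.Complexity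

open _root_.Computability Literature.Analysis.FunctionSpaces

namespace GapPV

open StrNum Expander Expander.BCSP Expander.ArityReduction BLR.Table

variable (e : ℕ)

/-- The first endpoint `y_s = nV + x / q₀` of binary constraint `x`. [cite: AroraBarakCC2009, Claim 22.36] -/
def aE1 (N S x : ℕ) : ℕ := stNV e N S + x / q₀

/-- The second endpoint `u_{vars s j}` of binary constraint `x`. [cite: AroraBarakCC2009, Claim 22.36] -/
def aE2 (N S x : ℕ) : ℕ := stVar e N S (x / q₀) (x % q₀)

/-- The relation of binary constraint `x` on the values `(a, b)`, as `0/1`. [cite: AroraBarakCC2009, Claim 22.36] -/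
def aR (N S x a b : ℕ) : ℕ :=
  if a < tQ then (if stAcc e N S (x / q₀) a = 1 then (if b = (Nat.testBit a (x % q₀)).toNat then 1 else 0) else 0) else 0

/-- `aE1` is in Cobham's class. [cite: Cobham1965] -/
theorem pv_aE1 : PV₃ (aE1 e) :=
  ((pv_stNV e).comp (IsPVDefinable.proj 0) (IsPVDefinable.proj 1)).add ((IsPVDefinable.proj 2).div (IsPVDefinable.const _))

/-- `aE2` is in Cobham's class. [cite: Cobham1965] -/
theorem pv_aE2 : PV₃ (aE2 e) :=
  (pv_stVar e).comp (IsPVDefinable.proj 0) (IsPVDefinable.proj 1) ((IsPVDefinable.proj 2).div (IsPVDefinable.const _))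
    ((IsPVDefinable.proj 2).mod (IsPVDefinable.const _))

/-- `aR` is in Cobham's class. [cite: Cobham1965] -/
theorem pv_aR : PV₅ (aR e) := by
  unfold PV₅ aR
  have ha := IsPVDefinable.proj (n := 5) 3
  have hb := IsPVDefinable.proj (n := 5) 4
  have hx := IsPVDefinable.proj (n := 5) 2
  refine ha.ite_lt (IsPVDefinable.const _) ?_ (IsPVDefinable.const 0)
  refine ((pv_stAcc e).comp (IsPVDefinable.proj 0) (IsPVDefinable.proj 1) (hx.div (IsPVDefinable.const _)) ha).ite_eq (IsPVDefinable.const 1)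
    ?_ (IsPVDefinable.const 0)
  exact hb.ite_eq (pv_tb.comp ha (hx.mod (IsPVDefinable.const _))) (IsPVDefinable.const 1) (IsPVDefinable.const 0)

/-- `aR ≤ 1`. [folklore] -/
theorem aR_le (N S x a b : ℕ) : aR e N S x a b ≤ 1 := by unfold aR; split_ifs <;> simp

section Correct

variable {e} {N S : ℕ} {φ : BCSP q₀} (hR : Rep e N S φ)
include hR

omit hR in
/-- The pair `(s, j)` of constraint `x < m q₀`. [folklore] -/
theorem arity_index {x : ℕ} (hx : x < φ.cons.length * q₀) :
    (finProdFinEquiv.symm (⟨x, hx⟩ : Fin (φ.cons.length * q₀))) = (⟨x / q₀, Nat.div_lt_of_lt_mul (by rwa [mul_comm] at hx)⟩, ⟨x % q₀, Nat.mod_lt _ q₀_pos'⟩) := by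
  ext <;> rfl

/-- **The first endpoint.** [cite: AroraBarakCC2009, Claim 22.36] -/
theorem aE1_eq {x : ℕ} (hx : x < φ.cons.length * q₀) : aE1 e N S x = (arEdge φ.vars ⟨x, hx⟩).1.val := by
  unfold aE1 arEdge newVar
  rw [arity_index hx, hR.nV_eq]
  simp

/-- **The second endpoint.** [cite: AroraBarakCC2009, Claim 22.36] -/
theorem aE2_eq {x : ℕ} (hx : x < φ.cons.length * q₀) : aE2 e N S x = (arEdge φ.vars ⟨x, hx⟩).2.val := by
  unfold aE2 arEdge newVar
  rw [arity_index hx]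
  simp only [finSumFinEquiv_apply_left, Fin.val_castAdd]
  exact hR.var_eq (x / q₀) _ ⟨x % q₀, Nat.mod_lt _ q₀_pos'⟩

/-- **The relation.** [cite: AroraBarakCC2009, Claim 22.36] -/
theorem aR_eq {x : ℕ} (hx : x < φ.cons.length * q₀) (a b : ℕ) : aR e N S x a b = (arR φ.acc ⟨x, hx⟩ a b).toNat := by
  unfold aR arR arRel
  rw [arity_index hx]
  simp only
  by_cases ha : a < tQ
  · have ha' : a < 2 ^ q₀ := by rwa [tQ_eq] at ha
    rw [if_pos ha, dif_pos ha']
    have hdec : ArityReduction.dec a ha' = τof a := by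
      unfold ArityReduction.dec; funext k; exact boolVecEquiv_symm_apply ⟨a, ha'⟩ k
    rw [hdec, hR.acc_eq _ (Nat.div_lt_of_lt_mul (by rwa [mul_comm] at hx)) _ ha]
    cases φ.acc ⟨x / q₀, _⟩ (τof a)
    · simp
    · simp only [Bool.toNat_true, if_true, Bool.true_and]
      unfold ArityReduction.bit τof
      cases a.testBit (x % q₀) <;> by_cases hb : b = 0 <;> by_cases hb1 : b = 1 <;> simp_all
  · rw [if_neg ha, dif_neg (by rwa [tQ_eq] at ha)]
    rfl

end Correct

end GapPV

end Literature.Computability.Complexity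

/-!
## X. Rotation maps as numbers — walks, laziness, powering

The expanders and constraint graphs of Dinur's round are rotation graphs (`RegularWalks.RotGraph n d`:
an involution `rot` on `Fin n × Fin d`).  At the machine level a rotation map is a pair of
number-theoretic functions `(nb, lb)` — neighbour and reverse label of the dart `(v, i)` — and this file
renders the generic constructions on such pairs together with their agreement with the spec:

* `Mirrors G nb lb` — `(nb v i, lb v i)` are the components of `G.rot (v, i)` for `v < n`, `i < d`;
* `lazyNb`/`lazyLb` (`mirrors_lazy`, `LazyWalks.lazy`);
* walks along the digits of a power label: `digitL d lab k = lab / d^k % d` (`listOfLab_getElem`),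
  `walkV nb d v lab j` (the vertex after `j` steps; `walkV_eq_endpt_take`), `powNb`, `powLb`
  (`mirrors_power`, `ExpanderOps.power`: the endpoint and the code `∑ₖ revLab[k] dᵏ` of the reversed
  labels);
* definability: `pv_walkV`, `pv_powNb`, `pv_powLb` from definable `nb`, `lb` (all loops have the
  constant length `p`).

## References

* S. Arora, B. Barak, *Computational Complexity: A Modern Approach*, CUP 2009, §21.1, §21.3.
* O. Reingold, S. Vadhan, A. Wigderson, Ann. Math. 155 (2002), §2 (rotation maps, powering).
-/

set_option exponentiation.threshold 4096

namespace Literature.Computability.Complexity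

open _root_.Computability Literature.Analysis.FunctionSpaces

namespace GapPV

open StrNum Expander Expander.RotGraph

/-! ### Mirrors of rotation maps -/

/-- `(nb, lb)` mirrors the rotation map of `G`. [folklore] -/
def Mirrors {n d : ℕ} (G : RotGraph n d) (nb lb : ℕ → ℕ → ℕ) : Prop :=
  ∀ (v : Fin n) (i : Fin d), nb v i = (G.rot (v, i)).1.val ∧ lb v i = (G.rot (v, i)).2.val

namespace Mirrors

variable {n d : ℕ} {G : RotGraph n d} {nb lb : ℕ → ℕ → ℕ} (h : Mirrors G nb lb)
include h

/-- The neighbour. [folklore] -/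
theorem nbr_eq (v : Fin n) (i : Fin d) : nb v i = (G.nbr v i).val := (h v i).1

/-- The reverse label. [folklore] -/
theorem rlab_eq (v : Fin n) (i : Fin d) : lb v i = (G.rlab v i).val := (h v i).2

/-- Neighbours are vertices. [folklore] -/
theorem nb_lt (v : Fin n) (i : Fin d) : nb v i < n := by rw [h.nbr_eq]; exact (G.nbr v i).2

/-- Reverse labels are labels. [folklore] -/
theorem lb_lt (v : Fin n) (i : Fin d) : lb v i < d := by rw [h.rlab_eq]; exact (G.rlab v i).2

end Mirrors

/-! ### Laziness -/

/-- The lazy neighbour: labels `≥ d` are self-loops. [cite: AroraBarakCC2009, Claim 22.38 (self-loops)] -/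
def lazyNb (d : ℕ) (nb : ℕ → ℕ → ℕ) (v i : ℕ) : ℕ := if i < d then nb v i else v

/-- The lazy reverse label. [folklore] -/
def lazyLb (d : ℕ) (lb : ℕ → ℕ → ℕ) (v i : ℕ) : ℕ := if i < d then lb v i else i

/-- **The lazy pair mirrors `G.lazy`.** [cite: AroraBarakCC2009, Claim 22.38] -/
theorem mirrors_lazy {n d : ℕ} {G : RotGraph n d} {nb lb : ℕ → ℕ → ℕ} (h : Mirrors G nb lb) : Mirrors G.lazy (lazyNb d nb) (lazyLb d lb) := by
  intro v i
  unfold lazyNb lazyLb RotGraph.lazy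
  simp only
  unfold RotGraph.lazyRot
  by_cases hi : i.val < d
  · rw [if_pos hi, if_pos hi, dif_pos hi]
    exact ⟨(h v ⟨i.val, hi⟩).1, by rw [(h v ⟨i.val, hi⟩).2]; rfl⟩
  · rw [if_neg hi, if_neg hi, dif_neg hi]; exact ⟨rfl, rfl⟩

/-! ### Digits of power labels -/

/-- Digit `k` of a power label in base `d`. [folklore] -/
def digitL (d lab k : ℕ) : ℕ := lab / d ^ k % d

/-- The label list of a power label is `ofFn` of its digits. [folklore] -/
theorem listOfLab_eq_ofFn {d : ℕ} (p : ℕ) (i : Fin (d ^ p)) : listOfLab p i = List.ofFn fun j : Fin p => finFunctionFinEquiv.symm i j := by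
  unfold listOfLab labEquiv
  simp only [Equiv.trans_apply]
  show (List.Vector.ofFn (finFunctionFinEquiv.symm i)).toList = _
  rw [List.Vector.toList_ofFn]

/-- **The label list of a power label**: entry `k` is digit `k`. [folklore] -/
theorem listOfLab_getElem {d : ℕ} (p : ℕ) (i : Fin (d ^ p)) (k : ℕ) (hk : k < (listOfLab p i).length) :
    ((listOfLab p i)[k]).val = digitL d i.val k := by
  have hk' : k < p := by simpa using hk
  simp only [listOfLab_eq_ofFn, List.getElem_ofFn]
  exact finFunctionFinEquiv_symm_apply_val i ⟨k, hk'⟩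

/-- The code of a label vector: `∑ₖ w[k] dᵏ`. [folklore] -/
theorem labEquiv_symm_val {d p : ℕ} (L : List (Fin d)) (hL : L.length = p) :
    ((labEquiv d p).symm ⟨L, hL⟩).val = ∑ k : Fin p, (L[k.val]'(by rw [hL]; exact k.2)).val * d ^ k.val := by
  unfold labEquiv
  simp only [Equiv.symm_trans_apply, Equiv.symm_symm]
  show (finFunctionFinEquiv (List.Vector.get ⟨L, hL⟩)).val = _
  rw [finFunctionFinEquiv_apply]
  rfl

/-! ### Walks -/

/-- The vertex after `j` steps along the digits of `lab`, clamped to `n` (the number of vertices; the clamp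
is the identity on real walks and keeps the accumulator polynomially bounded on junk inputs). [cite: AroraBarakCC2009, §21.1] -/
def walkV (nb : ℕ → ℕ → ℕ) (d n v lab j : ℕ) : ℕ := loopNat v (fun k acc => min (nb acc (digitL d lab k)) n) j

/-- `walkV` at `0` and `j + 1`. [folklore] -/
theorem walkV_zero (nb : ℕ → ℕ → ℕ) (d n v lab : ℕ) : walkV nb d n v lab 0 = v := rfl

/-- One more step. [folklore] -/
theorem walkV_succ (nb : ℕ → ℕ → ℕ) (d n v lab j : ℕ) : walkV nb d n v lab (j + 1) = min (nb (walkV nb d n v lab j) (digitL d lab j)) n := rfl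

/-- The clamp: `walkV ≤ max v n`. [folklore] -/
theorem walkV_le (nb : ℕ → ℕ → ℕ) (d n v lab j : ℕ) : walkV nb d n v lab j ≤ v + n := by
  cases j with
  | zero => rw [walkV_zero]; exact Nat.le_add_right _ _
  | succ j => rw [walkV_succ]; exact (min_le_right _ _).trans (Nat.le_add_left _ _)

/-- **`walkV` is the endpoint of the walk along the first `j` labels.** [cite: AroraBarakCC2009, §21.1] -/
theorem walkV_eq_endpt_take {n d : ℕ} {G : RotGraph n d} {nb lb : ℕ → ℕ → ℕ} (h : Mirrors G nb lb) (p : ℕ) (v : Fin n) (i : Fin (d ^ p)) :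
    ∀ j ≤ p, walkV nb d n v i.val j = (G.endpt v ((listOfLab p i).take j)).val := by
  intro j hj
  induction j with
  | zero => simp [walkV_zero]
  | succ j ih =>
    have hjp : j < p := Nat.lt_of_succ_le hj
    have hjl : j < (listOfLab p i).length := by simpa using hjp
    rw [walkV_succ, ih hjp.le, List.take_add_one, List.getElem?_eq_getElem hjl, Option.toList_some, RotGraph.endpt_append,
      RotGraph.endpt_cons, RotGraph.endpt_nil, ← listOfLab_getElem p i j hjl, h.nbr_eq]
    exact min_eq_left (Fin.is_lt _).le

/-- The endpoint of the power dart. [cite: AroraBarakCC2009, §21.1 (powering)] -/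
def powNb (nb : ℕ → ℕ → ℕ) (d p n v lab : ℕ) : ℕ := walkV nb d n v lab p

/-- The code of the reversed label list of the power dart: `∑ₖ revLab[k] dᵏ`, `revLab[k]` being the reverse
label of step `p - 1 - k`. [cite: AroraBarakCC2009, §21.3.1 (the reversed walk)] -/
def powLb (nb lb : ℕ → ℕ → ℕ) (d p n v lab : ℕ) : ℕ :=
  sumBelow (fun k => lb (walkV nb d n v lab (p - 1 - k)) (digitL d lab (p - 1 - k)) * d ^ k) p

/-- The reversed labels of a walk, entry by entry. [folklore] -/
theorem revLab_getElem {n d : ℕ} (G : RotGraph n d) : ∀ (v : Fin n) (l : List (Fin d)) (k : ℕ) (hk : k < (G.revLab v l).length),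
    (G.revLab v l)[k] = G.rlab (G.endpt v (l.take (l.length - 1 - k))) (l[l.length - 1 - k]'(by rw [RotGraph.length_revLab] at hk; omega))
  | v, [], k, hk => by simp at hk
  | v, i :: l, k, hk => by
    rw [RotGraph.length_revLab, List.length_cons] at hk
    simp only [RotGraph.revLab_cons, List.length_cons]
    by_cases hkl : k < (G.revLab (G.nbr v i) l).length
    · rw [List.getElem_append_left hkl, revLab_getElem G (G.nbr v i) l k hkl]
      rw [RotGraph.length_revLab] at hkl
      have e1 : l.length + 1 - 1 - k = (l.length - 1 - k) + 1 := by omega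
      simp only [e1, List.take_succ_cons, RotGraph.endpt_cons, List.getElem_cons_succ]
    · rw [RotGraph.length_revLab] at hkl
      have hk0 : k = l.length := by omega
      subst hk0
      rw [List.getElem_append_right (by rw [RotGraph.length_revLab])]
      simp [RotGraph.length_revLab]

/-- **The power pair mirrors `G.power p`.** [cite: AroraBarakCC2009, §21.1 and §21.3.1] -/
theorem mirrors_power {n d : ℕ} {G : RotGraph n d} {nb lb : ℕ → ℕ → ℕ} (h : Mirrors G nb lb) (p : ℕ) :
    Mirrors (G.power p) (powNb nb d p n) (powLb nb lb d p n) := by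
  intro v i
  constructor
  · -- the endpoint
    unfold powNb
    rw [walkV_eq_endpt_take h p v i p le_rfl, List.take_of_length_le (by simp)]
    rfl
  · -- the reversed labels
    unfold powLb
    show _ = ((labEquiv d p).symm ⟨G.revLab v (listOfLab p i), by rw [RotGraph.length_revLab, length_listOfLab]⟩).val
    rw [labEquiv_symm_val, sumBelow, Finset.sum_range]
    refine Finset.sum_congr rfl fun k _ => ?_
    congr 1
    have hlen : (G.revLab v (listOfLab p i)).length = p := by rw [RotGraph.length_revLab, length_listOfLab]
    have hk : k.val < (G.revLab v (listOfLab p i)).length := by rw [hlen]; exact k.2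
    rw [revLab_getElem G v (listOfLab p i) k.val hk]
    simp only [length_listOfLab]
    have hidx : p - 1 - k.val < (listOfLab p i).length := by rw [length_listOfLab]; have := k.2; omega
    rw [walkV_eq_endpt_take h p v i (p - 1 - k.val) (by omega), ← listOfLab_getElem p i _ hidx]
    exact h.rlab_eq _ _

end GapPV

end Literature.Computability.Complexity

/-!
## XI. The concrete graph constructions as numbers

Continuing chapter X (rotation maps as pairs `(nb, lb)` of number-theoretic functions,
`Mirrors`): the constructions used by the round — contraction (`Quotient.quot`), union and thickening
(`ExpanderOps.union/thick`, hence `Expanderize.prep`), padding (`Expanderize.pad`) —, each as a pair of closed-form functions with its `mirrors_*` lemma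
(the Margulis–Gabber–Galil graph itself is mirrored in chapter XIII).

## References

* S. Arora, B. Barak, *Computational Complexity: A Modern Approach*, CUP 2009, §21.3, §22.A, Exercise 21.16.
* J. R. Lee, *On expanders from the action of GL(2,ℤ)*, 2013, §2 (the graph `G_n`).
-/

set_option exponentiation.threshold 4096

namespace Literature.Computability.Complexity

open _root_.Computability Literature.Analysis.FunctionSpaces

namespace GapPV

open StrNum Expander Expander.RotGraph

/-! ### Contraction -/

section Quot

variable {M dd : ℕ} {Gb : RotGraph M dd} {nb lb : ℕ → ℕ → ℕ} (k C : ℕ) (hC : 0 < k → M ≤ C * k)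

/-- The neighbour in the contraction `quot Gb k C`. [cite: AroraBarakCC2009, Exercise 21.16] -/
def quotNb (M dd : ℕ) (nb : ℕ → ℕ → ℕ) (k v l : ℕ) : ℕ := if v + l / dd * k < M then nb (v + l / dd * k) (l % dd) % k else v

/-- The reverse label in the contraction. [cite: AroraBarakCC2009, Exercise 21.16] -/
def quotLb (M dd : ℕ) (nb lb : ℕ → ℕ → ℕ) (k v l : ℕ) : ℕ :=
  if v + l / dd * k < M then lb (v + l / dd * k) (l % dd) + dd * (nb (v + l / dd * k) (l % dd) / k) else l

/-- **The contraction pair mirrors `quot`.** [cite: AroraBarakCC2009, Exercise 21.16] -/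
theorem mirrors_quot (h : Mirrors Gb nb lb) : Mirrors (Gb.quot k C hC) (quotNb M dd nb k) (quotLb M dd nb lb k) := by
  intro v l
  have h1v : ((finProdFinEquiv.symm l).1 : ℕ) = l.val / dd := rfl
  have h2v : ((finProdFinEquiv.symm l).2 : ℕ) = l.val % dd := rfl
  simp only [RotGraph.quot, RotGraph.quotRot]
  unfold quotNb quotLb
  by_cases hy : v.val + l.val / dd * k < M
  · have hy' : v.val + (finProdFinEquiv.symm l).1.val * k < M := by rwa [h1v]
    rw [if_pos hy, if_pos hy, dif_pos hy']
    obtain ⟨e1, e2⟩ := h ⟨_, hy'⟩ (finProdFinEquiv.symm l).2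
    simp only [h1v, h2v] at e1 e2
    refine ⟨?_, ?_⟩
    · rw [e1]; rfl
    · rw [e1, e2, finProdFinEquiv_apply_val]; rfl
  · have hy' : ¬ v.val + (finProdFinEquiv.symm l).1.val * k < M := by rwa [h1v]
    rw [if_neg hy, if_neg hy, dif_neg hy']; exact ⟨rfl, rfl⟩

end Quot

/-! ### Union, thickening, `prep` -/

/-- The neighbour in `G.union H`. [folklore] -/
def unionNb (d₁ : ℕ) (nbG nbH : ℕ → ℕ → ℕ) (v i : ℕ) : ℕ := if i < d₁ then nbG v i else nbH v (i - d₁)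

/-- The reverse label in `G.union H`. [folklore] -/
def unionLb (d₁ : ℕ) (lbG lbH : ℕ → ℕ → ℕ) (v i : ℕ) : ℕ := if i < d₁ then lbG v i else d₁ + lbH v (i - d₁)

/-- **The union pair mirrors `union`.** [folklore] -/
theorem mirrors_union {n d₁ d₂ : ℕ} {G : RotGraph n d₁} {H : RotGraph n d₂} {nbG lbG nbH lbH : ℕ → ℕ → ℕ} (hG : Mirrors G nbG lbG)
    (hH : Mirrors H nbH lbH) : Mirrors (G.union H) (unionNb d₁ nbG nbH) (unionLb d₁ lbG lbH) := by
  intro v i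
  unfold unionNb unionLb RotGraph.union
  simp only
  unfold RotGraph.unionRot
  by_cases hi : i.val < d₁
  · rw [if_pos hi, if_pos hi, dif_pos hi]
    obtain ⟨h1, h2⟩ := hG v ⟨i.val, hi⟩
    exact ⟨h1, by rw [h2]; rfl⟩
  · rw [if_neg hi, if_neg hi, dif_neg hi]
    obtain ⟨h1, h2⟩ := hH v ⟨i.val - d₁, by omega⟩
    exact ⟨h1, by rw [h2]; rfl⟩

/-- The neighbour in `G.thick c` (label `l = j + c i`… decoded `(i, j) = (l / c, l % c)`). [folklore] -/
def thickNb (c : ℕ) (nb : ℕ → ℕ → ℕ) (v l : ℕ) : ℕ := nb v (l / c)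

/-- The reverse label in `G.thick c`: `l % c + c · rlab`. [folklore] -/
def thickLb (c : ℕ) (lb : ℕ → ℕ → ℕ) (v l : ℕ) : ℕ := l % c + c * lb v (l / c)

/-- **The thick pair mirrors `thick`.** [folklore] -/
theorem mirrors_thick {n d : ℕ} {G : RotGraph n d} {nb lb : ℕ → ℕ → ℕ} (h : Mirrors G nb lb) (c : ℕ) :
    Mirrors (G.thick c) (thickNb c nb) (thickLb c lb) := by
  intro v l
  have h1v : ((finProdFinEquiv.symm l).1 : ℕ) = l.val / c := rfl
  have h2v : ((finProdFinEquiv.symm l).2 : ℕ) = l.val % c := rfl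
  simp only [RotGraph.thick, RotGraph.thickRot, RotGraph.nbr, RotGraph.rlab]
  unfold thickNb thickLb
  obtain ⟨e1, e2⟩ := h v (finProdFinEquiv.symm l).1
  simp only [h1v] at e1 e2
  refine ⟨e1, ?_⟩
  rw [finProdFinEquiv_apply_val, h2v, e2]

/-- The neighbour in `prep G X = G ∪ X.thick d₁`. [cite: AroraBarakCC2009, Claim 22.38] -/
def prepNb (d₁ : ℕ) (nbG nbX : ℕ → ℕ → ℕ) : ℕ → ℕ → ℕ := unionNb d₁ nbG (thickNb d₁ nbX)

/-- The reverse label in `prep G X`. [cite: AroraBarakCC2009, Claim 22.38] -/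
def prepLb (d₁ : ℕ) (lbG lbX : ℕ → ℕ → ℕ) : ℕ → ℕ → ℕ := unionLb d₁ lbG (thickLb d₁ lbX)

/-- **The `prep` pair mirrors `prep`.** [cite: AroraBarakCC2009, Claim 22.38] -/
theorem mirrors_prep {n d₁ dX : ℕ} {G : RotGraph n d₁} {X : RotGraph n dX} {nbG lbG nbX lbX : ℕ → ℕ → ℕ} (hG : Mirrors G nbG lbG)
    (hX : Mirrors X nbX lbX) : Mirrors (G.prep X) (prepNb d₁ nbG nbX) (prepLb d₁ lbG lbX) :=
  mirrors_union hG (mirrors_thick hX d₁)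

/-! ### Padding -/

/-- The neighbour in `G.pad`: identity on the new vertices `≥ n`. [cite: AroraBarakCC2009, Claim 22.38] -/
def padNb (n : ℕ) (nb : ℕ → ℕ → ℕ) (v i : ℕ) : ℕ := if v < n then nb v i else v

/-- The reverse label in `G.pad`. [folklore] -/
def padLb (n : ℕ) (lb : ℕ → ℕ → ℕ) (v i : ℕ) : ℕ := if v < n then lb v i else i

/-- **The pad pair mirrors `pad`.** [cite: AroraBarakCC2009, Claim 22.38] -/
theorem mirrors_pad {n d N' : ℕ} {G : RotGraph n d} {nb lb : ℕ → ℕ → ℕ} (h : Mirrors G nb lb) (hN : n ≤ N') :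
    Mirrors (G.pad hN) (padNb n nb) (padLb n lb) := by
  intro v i
  unfold padNb padLb RotGraph.pad
  simp only
  unfold RotGraph.padRot
  by_cases hv : v.val < n
  · rw [if_pos hv, if_pos hv, dif_pos hv]
    obtain ⟨h1, h2⟩ := h ⟨v.val, hv⟩ i
    exact ⟨by rw [h1]; rfl, h2⟩
  · rw [if_neg hv, if_neg hv, dif_neg hv]; exact ⟨rfl, rfl⟩

end GapPV

end Literature.Computability.Complexity

/-!
## XII. The round, stage 2 (degree reduction, Claim 22.37)

The numeric mirror of `DegreeReduction.reduced e X` / `reducedC R` (`DegreeReductionGraph.lean`):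
occurrences `(s, b)` are numbered `b + 2 s` (`finProdFinEquiv`), in the same order as `occList`;
`endN` is the old variable of an occurrence, `csize u` the size of the cloud of `u`, `posN v` the
position of `v` in its cloud (a count), `celem u p` the `p`-th occurrence of the cloud (a bounded search),
and `redNb`/`redLb` the rotation map of the reduced graph (label `0`: partner; label `j + 1`: the
expander dart `j` of `X_{|cloud|}` on cloud positions), `redC` the dart constraints.

Main result: `mirrors_reduced` (and `redC_eq`).

## References

* S. Arora, B. Barak, *Computational Complexity: A Modern Approach*, CUP 2009, §22.A, Claim 22.37.
-/

set_option exponentiation.threshold 4096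

namespace Literature.Computability.Complexity

open _root_.Computability Literature.Analysis.FunctionSpaces

namespace GapPV

open StrNum Expander Expander.RotGraph Expander.DegreeReduction

/-! ### List lemmas: the order of `occList` -/

/-- Elements of a product with a pair. [folklore] -/
theorem product_pair_getElem {α β : Type} (l : List α) (a b : β) (i : ℕ) (hi : i < (l ×ˢ ([a, b] : List β)).length) :
    (l ×ˢ ([a, b] : List β))[i] = (l[i / 2]'(by rw [List.length_product] at hi; simp at hi; omega), if i % 2 = 0 then a else b) := by
  induction l generalizing i with
  | nil => simp at hi
  | cons x l ih =>
    match i, hi with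
    | 0, _ => simp
    | 1, _ => simp
    | i + 2, hi =>
      have hi' : i < (l ×ˢ ([a, b] : List β)).length := by
        rw [List.length_product] at hi ⊢; simp only [List.length_cons, List.length_nil] at hi ⊢; omega
      simp only [List.product_cons, List.map_cons, List.map_nil, List.cons_append, List.nil_append, List.getElem_cons_succ]
      rw [ih i hi']
      have hdiv : (i + 2) / 2 = i / 2 + 1 := by omega
      have hmod : (i + 2) % 2 = i % 2 := by omega
      simp only [hdiv, hmod, List.getElem_cons_succ]

/-- The length of `occList`. [folklore] -/
theorem length_occList (m : ℕ) : (occList m).length = m * 2 := by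
  rw [occList, List.length_product, List.length_finRange]; rfl

/-- **`occList` in numeric order.** [folklore] -/
theorem occList_getElem (m v : ℕ) (hv : v < (occList m).length) :
    (occList m)[v] = (⟨v / 2, by rw [length_occList] at hv; omega⟩, ⟨v % 2, Nat.mod_lt _ two_pos⟩) := by
  unfold occList
  rw [product_pair_getElem]
  ext
  · simp
  · simp only; split_ifs with h <;> simp only [Fin.val_zero, Fin.val_one] <;> omega

/-- `occList = finRange (2m)` decoded. [folklore] -/
theorem occList_eq (m : ℕ) : occList m = (List.finRange (m * 2)).map fun v => (finProdFinEquiv.symm v : Occ m) := by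
  apply List.ext_getElem
  · rw [length_occList, List.length_map, List.length_finRange]
  · intro v h1 h2
    rw [occList_getElem, List.getElem_map, List.getElem_finRange]
    rfl

/-! ### The numeric mirror -/

section Defs

variable (m : ℕ) (E1 E2 : ℕ → ℕ) (xNb xLb : ℕ → ℕ → ℕ → ℕ)

/-- The old variable of occurrence `v = b + 2 s`. [cite: AroraBarakCC2009, Claim 22.37 (proof)] -/
def endN (v : ℕ) : ℕ := if v % 2 = 0 then E1 (v / 2) else E2 (v / 2)

/-- The size of the cloud of `u`. [cite: AroraBarakCC2009, Claim 22.37 (proof)] -/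
def csize (u : ℕ) : ℕ := countBelow (fun v => if endN E1 E2 v = u then 1 else 0) (m * 2)

/-- The position of occurrence `v` in its cloud. [cite: AroraBarakCC2009, Claim 22.37 (proof)] -/
def posN (v : ℕ) : ℕ := countBelow (fun v' => if endN E1 E2 v' = endN E1 E2 v then 1 else 0) (min v (m * 2))

/-- The `p`-th occurrence of the cloud of `u`. [cite: AroraBarakCC2009, Claim 22.37 (proof)] -/
def celem (u p : ℕ) : ℕ :=
  muNat (fun v => if p < countBelow (fun v' => if endN E1 E2 v' = u then 1 else 0) (min (v + 1) (m * 2)) then 1 else 0) (m * 2)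

/-- The expander rotation on cloud positions (identity outside). [folklore] -/
def xrotP (k p j : ℕ) : ℕ := if p < k then xNb k p j else p

/-- Its reverse label. [folklore] -/
def xrotL (k p j : ℕ) : ℕ := if p < k then xLb k p j else j

/-- **The neighbour in the reduced graph.** [cite: AroraBarakCC2009, Claim 22.37] -/
def redNb (v i : ℕ) : ℕ :=
  if i = 0 then (1 - v % 2) + 2 * (v / 2)
  else celem m E1 E2 (endN E1 E2 v) (xrotP xNb (csize m E1 E2 (endN E1 E2 v)) (posN m E1 E2 v) (i - 1))

/-- **The reverse label in the reduced graph.** [cite: AroraBarakCC2009, Claim 22.37] -/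
def redLb (v i : ℕ) : ℕ := if i = 0 then 0 else xrotL xLb (csize m E1 E2 (endN E1 E2 v)) (posN m E1 E2 v) (i - 1) + 1

/-- **The dart constraints of the reduced instance** (`R01 s a b ∈ {0,1}` the old relation). [cite: AroraBarakCC2009, Claim 22.37] -/
def redC (R01 : ℕ → ℕ → ℕ → ℕ) (v i a b : ℕ) : ℕ :=
  if i = 0 then (if v % 2 = 0 then R01 (v / 2) a b else R01 (v / 2) b a) else (if a = b then 1 else 0)

end Defs

/-! ### Agreement with `reduced` -/

/-- The numeric cloud. [folklore] -/
def cloudN (E1 E2 : ℕ → ℕ) (m u : ℕ) : List ℕ := (List.range (m * 2)).filter fun v => endN E1 E2 v = u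

section Correct

variable {n₀ m d₀ : ℕ} {e : Fin m → Fin n₀ × Fin n₀} {X : (k : ℕ) → RotGraph k d₀} {E1 E2 : ℕ → ℕ} {xNb xLb : ℕ → ℕ → ℕ → ℕ}
  (HE : ∀ s : Fin m, E1 s = (e s).1.val ∧ E2 s = (e s).2.val) (HX : ∀ k, Mirrors (X k) (xNb k) (xLb k))

omit HE HX in
/-- The code of an occurrence. [folklore] -/
theorem code_occ (o : Occ m) : (finProdFinEquiv o).val = o.2.val + 2 * o.1.val := by simp [finProdFinEquiv]

omit HE HX in
/-- Decoding a code. [folklore] -/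
theorem code_div_mod (o : Occ m) : (finProdFinEquiv o).val / 2 = o.1.val ∧ (finProdFinEquiv o).val % 2 = o.2.val := by
  rw [code_occ]; have := o.2.2; omega

include HE

/-- **The old variable.** [cite: AroraBarakCC2009, Claim 22.37 (proof)] -/
theorem endN_code (o : Occ m) : endN E1 E2 (finProdFinEquiv o).val = (endpoint e o).val := by
  unfold endN endpoint
  rw [(code_div_mod o).1, (code_div_mod o).2]
  by_cases hb : o.2 = 0
  · rw [if_pos (by rw [hb]; rfl), if_pos hb]; exact (HE o.1).1
  · have hb1 : o.2.val = 1 := by have : o.2.val ≠ 0 := fun h => hb (Fin.ext h); have := o.2.2; omega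
    rw [if_neg (by rw [hb1]; decide), if_neg hb]; exact (HE o.1).2

/-- **The cloud, in codes.** [cite: AroraBarakCC2009, Claim 22.37 (proof)] -/
theorem cloud_map_code (u : Fin n₀) : (cloud e u).map (fun o => (finProdFinEquiv o).val) = cloudN E1 E2 m u.val := by
  unfold cloud cloudN
  rw [occList_eq, List.filter_map, List.map_map, ← List.map_coe_finRange_eq_range, List.filter_map]
  have h1 : ((fun o : Occ m => (finProdFinEquiv o).val) ∘ fun v : Fin (m * 2) => (finProdFinEquiv.symm v : Occ m)) = fun v => v.val :=
    funext fun v => by show (finProdFinEquiv (finProdFinEquiv.symm v)).val = v.val; rw [Equiv.apply_symm_apply]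
  have h2 : ((fun o : Occ m => decide (endpoint e o = u)) ∘ fun v : Fin (m * 2) => (finProdFinEquiv.symm v : Occ m)) =
      ((fun v : ℕ => decide (endN E1 E2 v = u.val)) ∘ fun v : Fin (m * 2) => v.val) := by
    funext v
    simp only [Function.comp_apply]
    have h := endN_code HE (finProdFinEquiv.symm v)
    rw [Equiv.apply_symm_apply] at h
    rw [h]
    simp only [decide_eq_decide]
    exact Fin.ext_iff
  rw [h1, h2]

/-- The size of a cloud. [folklore] -/
theorem csize_eq (u : Fin n₀) : csize m E1 E2 u.val = (cloud e u).length := by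
  rw [← List.length_map (f := fun o => (finProdFinEquiv o).val), cloud_map_code HE, cloudN, ← countBelow_eq_length_filter]; rfl

/-- The elements of a cloud, in codes. [folklore] -/
theorem cloud_getElem_code (u : Fin n₀) (p : ℕ) (hp : p < (cloud e u).length) :
    (finProdFinEquiv ((cloud e u)[p])).val = celem m E1 E2 u.val p := by
  have h1 : (finProdFinEquiv ((cloud e u)[p])).val = ((cloud e u).map fun o => (finProdFinEquiv o).val)[p]'(by rw [List.length_map]; exact hp) := by
    rw [List.getElem_map]
  rw [h1, List.getElem_of_eq (cloud_map_code HE u) (by rw [List.length_map]; exact hp)]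
  unfold cloudN celem
  rw [getElem_filter_range]
  exact loopNat_congr fun v hv acc => by simp only [min_eq_left (Nat.succ_le_of_lt hv)]

omit HE in
/-- `idxOf` under the (injective) coding. [folklore] -/
theorem idxOf_map_code (o : Occ m) : ∀ l : List (Occ m), (l.map fun o' => (finProdFinEquiv o').val).idxOf (finProdFinEquiv o).val = l.idxOf o
  | [] => rfl
  | x :: l => by
    rw [List.map_cons, List.idxOf_cons, List.idxOf_cons, idxOf_map_code o l]
    by_cases hx : x = o
    · subst hx; simp
    · have hne : ((finProdFinEquiv x).val == (finProdFinEquiv o).val) = false := by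
        rw [beq_eq_false_iff_ne]; exact fun h => hx (finProdFinEquiv.injective (Fin.ext h))
      have hxo : (x == o) = false := by rw [beq_eq_false_iff_ne]; exact hx
      rw [hne, hxo]

/-- **The position in the cloud.** [cite: AroraBarakCC2009, Claim 22.37 (proof)] -/
theorem posN_code (o : Occ m) : posN m E1 E2 (finProdFinEquiv o).val = pos e o := by
  unfold pos posN
  rw [min_eq_left (finProdFinEquiv o).2.le, ← idxOf_map_code o (cloud e (endpoint e o)), cloud_map_code HE, cloudN,
    idxOf_filter_range _ _ _ (finProdFinEquiv o).2 (endN_code HE o), endN_code HE o]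

include HX

/-- **The numeric pair mirrors the reduced graph.** [cite: AroraBarakCC2009, Claim 22.37] -/
theorem mirrors_reduced : Mirrors (reduced e X) (redNb m E1 E2 xNb) (redLb m E1 E2 xLb) := by
  intro v i
  obtain ⟨o, rfl⟩ := finProdFinEquiv.surjective v
  show _ = (reducedRot e X (finProdFinEquiv o, i)).1.val ∧ _ = (reducedRot e X (finProdFinEquiv o, i)).2.val
  refine Fin.cases ?_ (fun j => ?_) i
  · -- the constraint dart
    rw [reducedRot_zero, Equiv.symm_apply_apply]
    unfold redNb redLb
    rw [if_pos (Fin.val_zero _), if_pos (Fin.val_zero _)]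
    refine ⟨?_, (Fin.val_zero _).symm⟩
    rw [code_occ, code_occ]
    unfold partner
    simp only [Fin.val_rev]
    have := o.2.2; omega
  · -- the expander dart
    rw [reducedRot_succ, Equiv.symm_apply_apply]
    unfold redNb redLb xStep
    simp only [Fin.val_succ, Nat.add_one_ne_zero, if_false, Nat.add_sub_cancel]
    have hk := csize_eq HE (m := m) (endpoint e o)
    have hp := posN_code HE o
    rw [endN_code HE o, hk, hp]
    have hxr : xrotP xNb (cloud e (endpoint e o)).length (pos e o) j = (xrot X (cloud e (endpoint e o)).length (pos e o) j).1 ∧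
        xrotL xLb (cloud e (endpoint e o)).length (pos e o) j = (xrot X (cloud e (endpoint e o)).length (pos e o) j).2.val := by
      unfold xrotP xrotL xrot
      rw [if_pos (pos_lt e o), if_pos (pos_lt e o), dif_pos (pos_lt e o)]
      exact HX _ ⟨pos e o, pos_lt e o⟩ j
    rw [hxr.1, hxr.2]
    refine ⟨?_, by simp⟩
    have hlt := xrot_lt X (pos_lt e o) j
    rw [List.getD_eq_getElem _ _ hlt, cloud_getElem_code HE]

omit HE HX in
/-- **The dart constraints.** [cite: AroraBarakCC2009, Claim 22.37] -/
theorem redC_eq {R : Fin m → ℕ → ℕ → Bool} {R01 : ℕ → ℕ → ℕ → ℕ} (HR : ∀ (s : Fin m) (a b : ℕ), R01 s a b = (R s a b).toNat)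
    (v : Fin (m * 2)) (i : Fin (d₀ + 1)) (a b : ℕ) : redC R01 v i a b = (reducedC R v i a b).toNat := by
  obtain ⟨o, rfl⟩ := finProdFinEquiv.surjective v
  refine Fin.cases ?_ (fun j => ?_) i
  · rw [reducedC_zero, Equiv.symm_apply_apply]
    unfold redC
    rw [if_pos (Fin.val_zero _), (code_div_mod o).1, (code_div_mod o).2]
    by_cases hb : o.2 = 0
    · rw [if_pos (by rw [hb]; rfl), if_pos hb, HR]
    · have hb1 : o.2.val = 1 := by have : o.2.val ≠ 0 := fun h => hb (Fin.ext h); have := o.2.2; omega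
      rw [if_neg (by rw [hb1]; decide), if_neg hb, HR]
  · rw [reducedC_succ]
    unfold redC
    rw [if_neg (by rw [Fin.val_succ]; exact Nat.add_one_ne_zero _)]
    by_cases hab : a = b <;> simp [hab]

end Correct

end GapPV

end Literature.Computability.Complexity

/-!
## XIII. The Gabber–Galil expanders as numbers

The numeric mirrors (`GapPVWalks.Mirrors`) of the explicit expanders of the round:
the Margulis–Gabber–Galil graph `GabberGalil.graph m` (eight affine maps modulo `m`: `ggNb`, `ggLb`,
`mirrors_gg`), the expanderizing graphs `XM n = (lazy G_{side n})^{pw}` (`xmNb`, `xmLb`, `mirrors_XM`)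
and the cloud expanders `Xc k = quot (XM (2k)) k 8` (`xcNb`, `xcLb`, `mirrors_Xc`).

## References

* J. R. Lee, *On expanders from the action of GL(2,ℤ)*, 2013, §2 (the graph `G_n`).
* S. Arora, B. Barak, *Computational Complexity: A Modern Approach*, CUP 2009, §21.3, Exercise 21.16.
-/

set_option exponentiation.threshold 4096

namespace Literature.Computability.Complexity

open _root_.Computability Literature.Analysis.FunctionSpaces

namespace GapPV

open StrNum Expander Expander.RotGraph GabberGalil

/-! ### The Gabber–Galil graph -/

/-- The first torus coordinate of the neighbour `i` of `(a, b)` modulo `m`. [cite: Lee2013GL2Z, §2] -/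
def ggA (m a b i : ℕ) : ℕ :=
  if i = 0 then (a + 1 % m) % m else if i = 1 then (a + (m - 1 % m)) % m else if i = 2 then a else if i = 3 then a
  else if i = 4 then (a + b) % m else if i = 5 then (a + (m - b)) % m else a

/-- The second torus coordinate of the neighbour `i` of `(a, b)` modulo `m`. [cite: Lee2013GL2Z, §2] -/
def ggB (m a b i : ℕ) : ℕ :=
  if i = 0 then b else if i = 1 then b else if i = 2 then (b + 1 % m) % m else if i = 3 then (b + (m - 1 % m)) % m
  else if i = 4 then b else if i = 5 then b else if i = 6 then (b + a) % m else (b + (m - a)) % m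

/-- **The neighbour `i` of vertex `v = b + m a` in `G_m`**, as a number. [cite: Lee2013GL2Z, §2] -/
def ggNb (m v i : ℕ) : ℕ := ggB m (v / m) (v % m) i + m * ggA m (v / m) (v % m) i

/-- The inverse labels `0 ↔ 1, 2 ↔ 3, 4 ↔ 5, 6 ↔ 7`. [folklore] -/
def ggLb (_v i : ℕ) : ℕ := if i % 2 = 0 then i + 1 else i - 1

/-- Values in `ZMod (k+1)`: addition. [folklore] -/
theorem zval_add {k : ℕ} (x y : ZMod (k + 1)) : (x + y).val = (x.val + y.val) % (k + 1) := ZMod.val_add x y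

/-- Values in `ZMod (k+1)`: subtraction. [folklore] -/
theorem zval_sub {k : ℕ} (x y : ZMod (k + 1)) : (x - y).val = (x.val + (k + 1 - y.val)) % (k + 1) := by
  rw [sub_eq_add_neg, ZMod.val_add, ZMod.neg_val', Nat.add_mod_mod]

/-- Values in `ZMod (k+1)`: one. [folklore] -/
theorem zval_one {k : ℕ} : (1 : ZMod (k + 1)).val = 1 % (k + 1) := ZMod.val_one_eq_one_mod _

/-- **The numeric pair mirrors `G_m`.** [cite: Lee2013GL2Z, §2] -/
theorem mirrors_gg (m : ℕ) [NeZero m] : Mirrors (graph m) (ggNb m) ggLb := by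
  obtain ⟨k, rfl⟩ := Nat.exists_eq_succ_of_ne_zero (NeZero.ne m)
  intro v i
  have hsymm : ∀ z : ZMod (k + 1) × ZMod (k + 1), ((vert (k + 1)).symm z).val = z.2.val + (k + 1) * z.1.val := fun z => by
    simp only [vert, Equiv.symm_trans_apply, Equiv.symm_symm, Equiv.prodCongr_symm, Equiv.prodCongr_apply, Prod.map,
      finProdFinEquiv_apply_val]
    rfl
  have hv1 : ((vert (k + 1) v).1).val = v.val / (k + 1) := rfl
  have hv2 : ((vert (k + 1) v).2).val = v.val % (k + 1) := rfl
  show ggNb (k + 1) v i = ((vert (k + 1)).symm (mv (k + 1) i (vert (k + 1) v))).val ∧ ggLb v i = (il i).val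
  rw [hsymm]
  unfold ggNb
  rw [← hv1, ← hv2]
  fin_cases i <;>
    simp [mv, il, uT, dT, uS, dS, zval_add, zval_sub, zval_one, ggA, ggB, ggLb]

/-! ### The expanderizing graphs `XM n` and the cloud expanders `Xc k` -/

/-- The neighbour in `XM n = (lazy G_{side n})^{pw}`. [cite: Lee2013GL2Z, Thm. 2.3] -/
def xmNb (n : ℕ) : ℕ → ℕ → ℕ := powNb (lazyNb 8 (ggNb (side n))) 16 pw (NM n)

/-- The reverse label in `XM n`. [folklore] -/
def xmLb (n : ℕ) : ℕ → ℕ → ℕ := powLb (lazyNb 8 (ggNb (side n))) (lazyLb 8 ggLb) 16 pw (NM n)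

/-- **The numeric pair mirrors `XM n`.** [cite: Lee2013GL2Z, Thm. 2.3] -/
theorem mirrors_XM (n : ℕ) : Mirrors (XM n) (xmNb n) (xmLb n) := mirrors_power (mirrors_lazy (mirrors_gg (side n))) pw

/-- The neighbour in the cloud expander `Xc k`. [cite: AroraBarakCC2009, Exercise 21.16] -/
def xcNb (k : ℕ) : ℕ → ℕ → ℕ := quotNb (NM (2 * k)) dM (xmNb (2 * k)) k

/-- The reverse label in `Xc k`. [folklore] -/
def xcLb (k : ℕ) : ℕ → ℕ → ℕ := quotLb (NM (2 * k)) dM (xmNb (2 * k)) (xmLb (2 * k)) k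

/-- **The numeric pair mirrors `Xc k`.** [cite: AroraBarakCC2009, Exercise 21.16] -/
theorem mirrors_Xc (k : ℕ) : Mirrors (Xc k) (xcNb k) (xcLb k) := mirrors_quot k Cq _ (mirrors_XM (2 * k))

end GapPV

end Literature.Computability.Complexity

/-!
## XIV. Balls and the walk constraints of the powering (Lemma 22.9)

The numeric mirror of the combinatorics of `PoweringConstruction.lean` used by stage 4 of the round,
over a mirror `(nb, lb)` of a rotation graph `G : RotGraph n d` (`GapPVWalks.Mirrors`):

* `walkOf d s x` — the labels of the `x`-th walk of length `s` (`x / d^(s-1-j) % d`, big-endian):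
  `seqList_map_val : (seqList d s).map (map val) = ofFn (walkOf d s ·)`;
* `wEnd` — the endpoint of that walk (`wEnd_eq`), `bEnd` — the `p`-th entry of the enumeration
  `endList T v` of the ball by (length, lexicographic labels) (blocks of sizes `d^s`, `GapPVFlat.blk/off`);
* `memN v u` — membership of `u` in the ball of radius `T` around `v`, `idxN v u` — the position of `u`
  in `ballList T v` (the ball in increasing vertex order: a bounded count);
* `wrelN` — the decision procedure for `WalkRel W T C v (listOfLab p lab) a b` (`wrelN_eq_one_iff`).

## References

* S. Arora, B. Barak, *Computational Complexity: A Modern Approach*, CUP 2009, §22.2.4, Lemma 22.9.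
-/

set_option exponentiation.threshold 4096

namespace Literature.Computability.Complexity

open _root_.Computability Literature.Analysis.FunctionSpaces

namespace GapPV

open StrNum Expander Expander.RotGraph

/-! ### Big-endian digits and the walks of `seqList` -/

/-- A lower digit of `x mod d^s` is the same digit of `x`. [folklore] -/
theorem mod_pow_div_mod {d s m : ℕ} (hm : m < s) (x : ℕ) : x % d ^ s / d ^ m % d = x / d ^ m % d := by
  have hdvd : d ^ m * d ∣ d ^ s := by rw [← pow_succ]; exact pow_dvd_pow d hm
  rw [← Nat.mod_mul_right_div_self, Nat.mod_mod_of_dvd _ hdvd, Nat.mod_mul_right_div_self]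

/-- The labels of the `x`-th walk of length `s` (big-endian base-`d` digits of `x`). [folklore] -/
def walkOf (d s x : ℕ) : List ℕ := List.ofFn fun j : Fin s => x / d ^ (s - 1 - j.val) % d

/-- `walkOf` has length `s`. [folklore] -/
@[simp] theorem length_walkOf (d s x : ℕ) : (walkOf d s x).length = s := List.length_ofFn

/-- `walkOf` only sees `x mod d^s`. [folklore] -/
theorem walkOf_mod {d : ℕ} (s x : ℕ) : walkOf d s (x % d ^ s) = walkOf d s x := by
  unfold walkOf
  congr 1; funext j
  exact mod_pow_div_mod (by have := j.2; omega) x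

/-- One more leading label. [folklore] -/
theorem walkOf_succ {d : ℕ} (s x : ℕ) : walkOf d (s + 1) x = (x / d ^ s % d) :: walkOf d s x := by
  unfold walkOf
  rw [List.ofFn_succ]
  refine congrArg₂ List.cons ?_ (congrArg List.ofFn (funext fun j => ?_))
  · simp
  · rw [Fin.val_succ, show s + 1 - 1 - (j.val + 1) = s - 1 - j.val by omega]

/-- **The list of walks of length `s`, in codes.** [folklore] -/
theorem seqList_map_val {d : ℕ} (hd : 0 < d) : ∀ s : ℕ,
    (seqList d s).map (List.map Fin.val) = List.ofFn fun x : Fin (d ^ s) => walkOf d s x.val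
  | 0 => by simp [seqList, walkOf]
  | s + 1 => by
    have ih := seqList_map_val hd s
    rw [seqList, List.map_flatMap]
    have h1 : (fun i : Fin d => ((seqList d s).map fun p => i :: p).map (List.map Fin.val)) =
        fun i : Fin d => List.ofFn fun x : Fin (d ^ s) => i.val :: walkOf d s x.val := by
      funext i
      rw [List.map_map, show (List.map Fin.val ∘ fun p : List (Fin d) => i :: p) = (fun q => i.val :: q) ∘ List.map Fin.val from rfl,
        ← List.map_map, ih, List.map_ofFn]
      rfl
    rw [h1]
    show ((List.finRange d).map fun i : Fin d => List.ofFn fun x : Fin (d ^ s) => i.val :: walkOf d s x.val).flatten = _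
    rw [← List.ofFn_eq_map, List.ofFn_congr (pow_succ' d s), List.ofFn_mul]
    refine congrArg List.flatten (congrArg List.ofFn (funext fun i => congrArg List.ofFn (funext fun x => ?_)))
    simp only [Fin.cast_mk]
    rw [walkOf_succ]
    have hx := x.2
    have hds : 0 < d ^ s := Nat.pow_pos hd
    have hdiv : (i.val * d ^ s + x.val) / d ^ s = i.val := by
      rw [add_comm, Nat.add_mul_div_right _ _ hds, Nat.div_eq_of_lt hx, zero_add]
    rw [hdiv, Nat.mod_eq_of_lt i.2, ← walkOf_mod s (i.val * d ^ s + x.val), add_comm, Nat.add_mul_mod_self_right, Nat.mod_eq_of_lt hx]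

/-- The `x`-th walk of length `s`, label by label. [folklore] -/
theorem seqList_getElem_map_val {d : ℕ} (hd : 0 < d) (s x : ℕ) (hx : x < (seqList d s).length) :
    ((seqList d s)[x]).map Fin.val = walkOf d s x := by
  have h := congrArg (fun L => L[x]?) (seqList_map_val hd s)
  simp only [List.getElem?_map, List.getElem?_eq_getElem hx, Option.map_some] at h
  rw [List.getElem?_ofFn] at h
  have hx' : x < d ^ s := by rwa [length_seqList] at hx
  simp only [hx', dite_true] at h
  exact Option.some.inj h

/-! ### Endpoints of enumerated walks -/

section Walks

variable {n d : ℕ} {G : RotGraph n d} {nb lb : ℕ → ℕ → ℕ} (h : Mirrors G nb lb)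
include h

/-- **A clamped loop along a digit function follows the walk.** [cite: AroraBarakCC2009, §21.1] -/
theorem loop_eq_endpt_take (g : ℕ → ℕ) (l : List (Fin d)) (hg : ∀ j (hj : j < l.length), g j = (l[j]).val) (v : Fin n) :
    ∀ j ≤ l.length, loopNat v.val (fun j acc => min (nb acc (g j)) n) j = (G.endpt v (l.take j)).val := by
  intro j hj
  induction j with
  | zero => simp [loopNat]
  | succ j ih =>
    have hjl : j < l.length := Nat.lt_of_succ_le hj
    rw [loopNat_succ, ih hjl.le, List.take_add_one, List.getElem?_eq_getElem hjl, Option.toList_some, RotGraph.endpt_append,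
      RotGraph.endpt_cons, RotGraph.endpt_nil, hg j hjl, h.nbr_eq]
    exact min_eq_left (Fin.is_lt _).le

/-- The endpoint of the `x`-th walk of length `s` from `v`. [cite: AroraBarakCC2009, §22.2.4] -/
def wEnd (nb : ℕ → ℕ → ℕ) (d n v s x : ℕ) : ℕ := loopNat v (fun j acc => min (nb acc (x / d ^ (s - 1 - j) % d)) n) s

omit h in
/-- The clamp: `wEnd ≤ v + n`. [folklore] -/
theorem wEnd_le (nb : ℕ → ℕ → ℕ) (d n v s x : ℕ) : wEnd nb d n v s x ≤ v + n := by
  unfold wEnd; cases s with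
  | zero => exact Nat.le_add_right _ _
  | succ s => rw [loopNat_succ]; exact (min_le_right _ _).trans (Nat.le_add_left _ _)

/-- **The endpoint of the `x`-th walk of length `s`.** [cite: AroraBarakCC2009, §22.2.4] -/
theorem wEnd_eq (hd : 0 < d) (v : Fin n) (s x : ℕ) (hx : x < (seqList d s).length) :
    wEnd nb d n v s x = (G.endpt v ((seqList d s)[x])).val := by
  have hlen : ((seqList d s)[x]).length = s := mem_seqList.1 (List.getElem_mem hx)
  have hmap := seqList_getElem_map_val hd s x hx
  have hg : ∀ j (hj : j < ((seqList d s)[x]).length), x / d ^ (s - 1 - j) % d = (((seqList d s)[x])[j]).val := fun j hj => by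
    have h1 := congrArg (fun L => L[j]?) hmap
    simp only [List.getElem?_map, List.getElem?_eq_getElem hj, Option.map_some, walkOf, List.getElem?_ofFn] at h1
    rw [hlen] at hj
    simp only [hj, dite_true, Option.some.injEq] at h1
    exact h1.symm
  have := loop_eq_endpt_take h (fun j => x / d ^ (s - 1 - j) % d) ((seqList d s)[x]) hg v s (by rw [hlen])
  rw [List.take_of_length_le hlen.le] at this
  exact this

/-! ### The enumeration of a ball -/

/-- The enumeration of the ball by (length, lexicographic labels), with repetitions (= `endList`). [cite: AroraBarakCC2009, §22.2.4] -/
def endL (G : RotGraph n d) (T : ℕ) (v : Fin n) : List (Fin n) := (List.range (T + 1)).flatMap fun s => (seqList d s).map fun p => G.endpt v p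

/-- The number of enumerated walks of length `≤ T`: `∑_{s ≤ T} d^s = ballBound d T`. [folklore] -/
def bb (d T : ℕ) : ℕ := sumBelow (fun s => d ^ s) (T + 1)

omit h in
/-- `bb = ballBound`. [folklore] -/
theorem bb_eq (d T : ℕ) : bb d T = ballBound d T := rfl

omit h in
/-- The length of the enumeration. [folklore] -/
theorem length_endL (T : ℕ) (v : Fin n) : (endL G T v).length = bb d T := by
  unfold endL bb; rw [length_flatMap_range]; exact sumBelow_congr fun s _ => by rw [List.length_map, length_seqList]

/-- **The `p`-th enumerated endpoint**: walk `off p` of length `blk p`. [cite: AroraBarakCC2009, §22.2.4] -/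
def bEnd (nb : ℕ → ℕ → ℕ) (d n T v p : ℕ) : ℕ := wEnd nb d n v (blk (fun s => d ^ s) (T + 1) p) (off (fun s => d ^ s) (T + 1) p)

omit h in
/-- The clamp: `bEnd ≤ v + n`. [folklore] -/
theorem bEnd_le (nb : ℕ → ℕ → ℕ) (d n T v p : ℕ) : bEnd nb d n T v p ≤ v + n := wEnd_le _ _ _ _ _ _

/-- **The enumeration, entry by entry.** [cite: AroraBarakCC2009, §22.2.4] -/
theorem bEnd_eq (hd : 0 < d) (T : ℕ) (v : Fin n) (p : ℕ) (hp : p < (endL G T v).length) : bEnd nb d n T v p = ((endL G T v)[p]).val := by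
  unfold endL at hp ⊢
  rw [getElem_flatMap_range _ hp]
  simp only [List.getElem_map]
  have hlen : (fun u => ((seqList d u).map fun p => G.endpt v p).length) = fun s => d ^ s := by
    funext s; rw [List.length_map, length_seqList]
  unfold bEnd
  simp only [hlen]
  exact wEnd_eq h hd v _ _ _

/-- Membership in the ball of radius `T` around `v`, as `0/1`. [cite: AroraBarakCC2009, §22.2.4] -/
def memN (nb : ℕ → ℕ → ℕ) (d n T v u : ℕ) : ℕ := if countBelow (fun p => if bEnd nb d n T v p = u then 1 else 0) (bb d T) = 0 then 0 else 1

omit h in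
/-- `memN ≤ 1`. [folklore] -/
theorem memN_le (nb : ℕ → ℕ → ℕ) (d n T v u : ℕ) : memN nb d n T v u ≤ 1 := by unfold memN; split_ifs <;> simp

/-- **Membership in the ball.** [cite: AroraBarakCC2009, §22.2.4] -/
theorem memN_eq_one_iff (hd : 0 < d) (T : ℕ) (v u : Fin n) : memN nb d n T v u = 1 ↔ u ∈ endL G T v := by
  unfold memN
  rw [List.mem_iff_getElem]
  constructor
  · intro hm
    have hc : countBelow (fun p => if bEnd nb d n T v p = u then 1 else 0) (bb d T) ≠ 0 := fun h0 => by rw [h0] at hm; simp at hm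
    rw [Ne, countBelow_eq_zero_iff] at hc
    push Not at hc
    obtain ⟨p, hp, hne⟩ := hc
    have hpu : bEnd nb d n T v p = u := by by_contra hx; rw [if_neg hx] at hne; exact hne rfl
    have hp' : p < (endL G T v).length := by rwa [length_endL]
    refine ⟨p, hp', Fin.ext ?_⟩
    rw [← bEnd_eq h hd T v p hp', hpu]
  · rintro ⟨p, hp, hpu⟩
    have hp' : p < bb d T := by rwa [length_endL] at hp
    rw [if_neg]
    rw [countBelow_eq_zero_iff]
    push Not
    refine ⟨p, hp', ?_⟩
    rw [if_pos (by rw [bEnd_eq h hd T v p hp, hpu])]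
    exact one_ne_zero

/-- The position of `u` in the ball of `v` (increasing vertex order): the members below `u`. [cite: AroraBarakCC2009, §22.2.4] -/
def idxN (nb : ℕ → ℕ → ℕ) (d n T v u : ℕ) : ℕ := min (countBelow (fun w => memN nb d n T v w) (min u n)) (bb d T)

/-- **The position in the vertex-ordered ball** `(finRange n).filter (· ∈ endL T v)`. [cite: AroraBarakCC2009, §22.2.4] -/
theorem idxOf_filter_endL (hd : 0 < d) (T : ℕ) (v u : Fin n) (hu : u ∈ endL G T v) :
    ((List.finRange n).filter fun w => w ∈ endL G T v).idxOf u = idxN nb d n T v u := by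
  -- pass to values
  have hinj : ∀ (l : List (Fin n)), (l.map Fin.val).idxOf u.val = l.idxOf u := by
    intro l; induction l with
    | nil => rfl
    | cons x l ih =>
      rw [List.map_cons, List.idxOf_cons, List.idxOf_cons, ih]
      by_cases hx : x = u
      · subst hx; simp
      · have h1 : (x.val == u.val) = false := by rw [beq_eq_false_iff_ne]; exact fun e => hx (Fin.ext e)
        have h2 : (x == u) = false := by rw [beq_eq_false_iff_ne]; exact hx
        rw [h1, h2]
  set Pn : ℕ → Prop := fun m => ∃ hw : m < n, (⟨m, hw⟩ : Fin n) ∈ endL G T v with hPn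
  have hmap : ((List.finRange n).filter fun w => w ∈ endL G T v).map Fin.val = (List.range n).filter fun m => Pn m := by
    rw [← List.map_coe_finRange_eq_range, List.filter_map]
    congr 1
    refine List.filter_congr fun w _ => ?_
    simp only [Function.comp_apply, decide_eq_decide, hPn]
    exact ⟨fun hw => ⟨w.2, hw⟩, fun ⟨_, hw⟩ => hw⟩
  have hP : ∀ w < u.val, (if Pn w then 1 else 0) = memN nb d n T v w := by
    intro w hw
    have hwn : w < n := hw.trans u.2
    by_cases hm : (⟨w, hwn⟩ : Fin n) ∈ endL G T v
    · rw [if_pos ⟨hwn, hm⟩, ((memN_eq_one_iff h hd T v ⟨w, hwn⟩).2 hm)]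
    · rw [if_neg (fun ⟨_, hm'⟩ => hm hm')]
      have := memN_le nb d n T v w
      have hne : memN nb d n T v w ≠ 1 := fun h1 => hm ((memN_eq_one_iff h hd T v ⟨w, hwn⟩).1 h1)
      omega
  have hlen : ((List.finRange n).filter fun w => w ∈ endL G T v).idxOf u < bb d T := by
    refine (List.idxOf_lt_length_of_mem (List.mem_filter.2 ⟨List.mem_finRange u, by simpa using hu⟩)).trans_le ?_
    rw [← length_endL (G := G) T v]
    exact (((List.nodup_finRange n).filter _).subperm fun w hw => by simpa using (List.mem_filter.1 hw).2).length_le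
  rw [← hinj, hmap, idxOf_filter_range Pn n u.val u.2 ⟨u.2, hu⟩]
  rw [← hinj, hmap, idxOf_filter_range Pn n u.val u.2 ⟨u.2, hu⟩] at hlen
  unfold idxN
  rw [min_eq_left u.2.le, countBelow_congr hP] at *
  exact (min_eq_left hlen.le).symm

/-! ### The walk constraints -/

/-- The ball in increasing vertex order (= `ballList` after its reordering). [cite: AroraBarakCC2009, §22.2.4] -/
def ballV (G : RotGraph n d) (T : ℕ) (v : Fin n) : List (Fin n) := (List.finRange n).filter fun w => w ∈ endL G T v

omit h in
/-- Membership in `ballV`. [folklore] -/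
theorem mem_ballV {T : ℕ} {v u : Fin n} : u ∈ ballV G T v ↔ u ∈ endL G T v := by simp [ballV]

omit h in
/-- `ballList` is `ballV` (the tree's `ballList` lists the ball in increasing vertex order). [folklore] -/
theorem ballList_eq_ballV (G : RotGraph n d) (T : ℕ) (v : Fin n) : G.ballList T v = ballV G T v := rfl

/-- `WalkRel` with the vertex-ordered balls. [cite: AroraBarakCC2009, Lemma 22.9 (the constraint C_p)] -/
def WalkRelV (G : RotGraph n d) (W T : ℕ) (C : Fin n → Fin d → ℕ → ℕ → Bool) (v : Fin n) (l : List (Fin d)) (a b : ℕ) : Prop :=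
  ∀ (j : ℕ) (i : Fin d), l[j]? = some i →
    G.endpt v (l.take j) ∈ ballV G T v →
    G.nbr (G.endpt v (l.take j)) i ∈ ballV G T (G.endpt v l) →
    C (G.endpt v (l.take j)) i (digit W a ((ballV G T v).idxOf (G.endpt v (l.take j))))
      (digit W b ((ballV G T (G.endpt v l)).idxOf (G.nbr (G.endpt v (l.take j)) i))) = true

omit h in
/-- `WalkRel` is `WalkRelV`. [folklore] -/
theorem walkRel_iff_walkRelV (G : RotGraph n d) (W T : ℕ) (C : Fin n → Fin d → ℕ → ℕ → Bool) (v : Fin n) (l : List (Fin d)) (a b : ℕ) :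
    G.WalkRel W T C v l a b ↔ WalkRelV G W T C v l a b := Iff.rfl

variable (nb) in
/-- A violated step `j` of the walk `(v, lab)` on the values `(a, b)`, as `0/1`. [cite: AroraBarakCC2009, Lemma 22.9 (the constraint C_p)] -/
def wviol (C01 : ℕ → ℕ → ℕ → ℕ → ℕ) (d n T W p v lab a b j : ℕ) : ℕ :=
  if memN nb d n T v (walkV nb d n v lab j) = 1 then
    (if memN nb d n T (walkV nb d n v lab p) (min (nb (walkV nb d n v lab j) (digitL d lab j)) n) = 1 then
      (if C01 (walkV nb d n v lab j) (digitL d lab j) (digit W a (idxN nb d n T v (walkV nb d n v lab j)))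
          (digit W b (idxN nb d n T (walkV nb d n v lab p) (min (nb (walkV nb d n v lab j) (digitL d lab j)) n))) = 0 then 1 else 0)
    else 0)
  else 0

variable (nb) in
/-- **The decision procedure for the walk constraint** of `(v, lab)` on `(a, b)`. [cite: AroraBarakCC2009, Lemma 22.9] -/
def wrelN (C01 : ℕ → ℕ → ℕ → ℕ → ℕ) (d n T W p v lab a b : ℕ) : ℕ :=
  if countBelow (wviol nb C01 d n T W p v lab a b) p = 0 then 1 else 0

omit h in
/-- `wrelN ≤ 1`. [folklore] -/
theorem wrelN_le (C01 : ℕ → ℕ → ℕ → ℕ → ℕ) (d n T W p v lab a b : ℕ) : wrelN nb C01 d n T W p v lab a b ≤ 1 := by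
  unfold wrelN; split_ifs <;> simp

/-- **Correctness of the decision procedure.** [cite: AroraBarakCC2009, Lemma 22.9] -/
theorem wrelN_eq_one_iff (hd : 0 < d) {C : Fin n → Fin d → ℕ → ℕ → Bool} {C01 : ℕ → ℕ → ℕ → ℕ → ℕ}
    (hC : ∀ (u : Fin n) (i : Fin d) (a b : ℕ), C01 u i a b = (C u i a b).toNat) (T W p : ℕ) (v : Fin n) (lab : Fin (d ^ p)) (a b : ℕ) :
    wrelN nb C01 d n T W p v lab a b = 1 ↔ WalkRelV G W T C v (listOfLab p lab) a b := by
  have hlen : (listOfLab p lab).length = p := length_listOfLab p lab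
  -- the data of step `j`
  have hu : ∀ j ≤ p, walkV nb d n v lab.val j = (G.endpt v ((listOfLab p lab).take j)).val := walkV_eq_endpt_take h p v lab
  have he : walkV nb d n v lab.val p = (G.endpt v (listOfLab p lab)).val := by
    rw [hu p le_rfl, List.take_of_length_le hlen.le]
  have hi : ∀ j (hj : j < p), digitL d lab.val j = ((listOfLab p lab)[j]'(by rw [hlen]; exact hj)).val := fun j hj =>
    (listOfLab_getElem p lab j (by rw [hlen]; exact hj)).symm
  have hmem : ∀ (x u : Fin n), memN nb d n T x u = 1 ↔ u ∈ ballV G T x := fun x u => by rw [mem_ballV]; exact memN_eq_one_iff h hd T x u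
  have hidx : ∀ (x u : Fin n), u ∈ ballV G T x → (ballV G T x).idxOf u = idxN nb d n T x u := fun x u hux =>
    idxOf_filter_endL h hd T x u (mem_ballV.1 hux)
  -- the clean form of a violation
  have hviol : ∀ j (hj : j < p), wviol nb C01 d n T W p v lab a b j = 0 ↔
      (G.endpt v ((listOfLab p lab).take j) ∈ ballV G T v →
        G.nbr (G.endpt v ((listOfLab p lab).take j)) ((listOfLab p lab)[j]'(by rw [hlen]; exact hj)) ∈ ballV G T (G.endpt v (listOfLab p lab)) →
        C (G.endpt v ((listOfLab p lab).take j)) ((listOfLab p lab)[j]'(by rw [hlen]; exact hj))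
          (digit W a ((ballV G T v).idxOf (G.endpt v ((listOfLab p lab).take j))))
          (digit W b ((ballV G T (G.endpt v (listOfLab p lab))).idxOf
            (G.nbr (G.endpt v ((listOfLab p lab).take j)) ((listOfLab p lab)[j]'(by rw [hlen]; exact hj))))) = true) := by
    intro j hj
    set U := G.endpt v ((listOfLab p lab).take j) with hU
    set I := (listOfLab p lab)[j]'(by rw [hlen]; exact hj) with hI
    set E := G.endpt v (listOfLab p lab) with hE
    have hwj : min (nb U.val I.val) n = (G.nbr U I).val := by rw [h.nbr_eq]; exact min_eq_left (Fin.is_lt _).le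
    unfold wviol
    rw [hu j hj.le, he, hi j hj]
    rw [hwj]
    by_cases hb1 : U ∈ ballV G T v
    · rw [if_pos ((hmem v U).2 hb1)]
      by_cases hb2 : G.nbr U I ∈ ballV G T E
      · rw [if_pos ((hmem E _).2 hb2), ← hidx v U hb1, ← hidx E _ hb2, hC]
        cases C U I (digit W a ((ballV G T v).idxOf U)) (digit W b ((ballV G T E).idxOf (G.nbr U I))) <;> simp [hb1, hb2]
      · have hne : memN nb d n T E (G.nbr U I) ≠ 1 := fun h1 => hb2 ((hmem E _).1 h1)
        rw [if_neg hne]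
        simp [hb2]
    · have hne : memN nb d n T v U ≠ 1 := fun h1 => hb1 ((hmem v U).1 h1)
      rw [if_neg hne]
      simp [hb1]
  -- assemble
  have hone : wrelN nb C01 d n T W p v lab a b = 1 ↔ ∀ j < p, wviol nb C01 d n T W p v lab a b j = 0 := by
    unfold wrelN
    rw [← countBelow_eq_zero_iff]
    constructor
    · intro hh; by_contra hc; rw [if_neg hc] at hh; exact zero_ne_one hh
    · intro hh; rw [if_pos hh]
  rw [hone]
  unfold WalkRelV
  constructor
  · intro H j i hji hb1 hb2
    have hj : j < p := by have := (List.getElem?_eq_some_iff.1 hji).1; rwa [hlen] at this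
    have hij : (listOfLab p lab)[j]'(by rw [hlen]; exact hj) = i := (List.getElem?_eq_some_iff.1 hji).2
    subst hij
    exact (hviol j hj).1 (H j hj) hb1 hb2
  · intro H j hj
    exact (hviol j hj).2 (H j _ (List.getElem?_eq_getElem (by rw [hlen]; exact hj)))

end Walks


end GapPV

end Literature.Computability.Complexity

/-!
## XV. Decoding the tester's coin tuples

Stage 4 of the round numbers the constraints `(walk constraint, coin tuple)`; the coin tuple of code `z`
is `(Enc.tcoinsFin k).symm z` (`Round.lean`, nested `pairFin`/`funFin`/`vecFin`).  This file renders
every leaf of that tuple — the bit vectors of the `T₁` BLR pairs for `f` and `g`, the `T₂` tensor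
triples, the `T₃` equation pairs, the `T₁ + T₁` BLR pairs for `π₁`, `π₂` and the `T₄` concatenation
triples — as a closed-form arithmetic function of `(k, z, t)` (its number `toNat`), with the `rfl`-level
decoding lemmas `toNat_*`.

## References

* S. Arora, B. Barak, *Computational Complexity: A Modern Approach*, CUP 2009, §11.5.2 and Cor. 22.13.
-/

set_option exponentiation.threshold 4096

namespace Literature.Computability.Complexity

open _root_.Computability Literature.Analysis.FunctionSpaces

namespace GapPV

open StrNum Expander Expander.Enc BLR BLR.Table
open Expander.LazyCSP (toNat)

/-! ### Sizes of the nested components -/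

/-- `|B₃| = (2^k · 2^k · 2^{nv})^{T₄}` (concatenation triples). [folklore] -/
def sB3 (k : ℕ) : ℕ := (2 ^ k * (2 ^ k * 2 ^ nv k)) ^ T₄

/-- `|B₂ × B₃|`. [folklore] -/
def sB2 (k : ℕ) : ℕ := (2 ^ k * 2 ^ k) ^ T₁ * sB3 k

/-- `|B₁ × B₂ × B₃|`. [folklore] -/
def sB1 (k : ℕ) : ℕ := (2 ^ k * 2 ^ k) ^ T₁ * sB2 k

/-- `|A₄| = (2^{ne} · 2^{nv²})^{T₃}` (equation pairs). [folklore] -/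
def sA4 (k : ℕ) : ℕ := (2 ^ ne k * 2 ^ (nv k * nv k)) ^ T₃

/-- `|A₃ × A₄|`. [folklore] -/
def sA3 (k : ℕ) : ℕ := (2 ^ nv k * (2 ^ nv k * 2 ^ (nv k * nv k))) ^ T₂ * sA4 k

/-- `|A₂ × A₃ × A₄|`. [folklore] -/
def sA2 (k : ℕ) : ℕ := (2 ^ (nv k * nv k) * 2 ^ (nv k * nv k)) ^ T₁ * sA3 k

/-! ### The component codes -/

/-- The code of the Hadamard coins `c.1`. [folklore] -/
def cCoins (k z : ℕ) : ℕ := z / sB1 k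
/-- The code of the `π₁` BLR pairs `c.2.1`. [folklore] -/
def cP1 (k z : ℕ) : ℕ := z % sB1 k / sB2 k
/-- The code of the `π₂` BLR pairs `c.2.2.1`. [folklore] -/
def cP2 (k z : ℕ) : ℕ := z % sB1 k % sB2 k / sB3 k
/-- The code of the concatenation triples `c.2.2.2`. [folklore] -/
def cCat (k z : ℕ) : ℕ := z % sB1 k % sB2 k % sB3 k
/-- The code of the `f` BLR pairs `c.1.1`. [folklore] -/
def cBF (k z : ℕ) : ℕ := cCoins k z / sA2 k
/-- The code of the `g` BLR pairs `c.1.2.1`. [folklore] -/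
def cBG (k z : ℕ) : ℕ := cCoins k z % sA2 k / sA3 k
/-- The code of the tensor triples `c.1.2.2.1`. [folklore] -/
def cTen (k z : ℕ) : ℕ := cCoins k z % sA2 k % sA3 k / sA4 k
/-- The code of the equation pairs `c.1.2.2.2`. [folklore] -/
def cEqn (k z : ℕ) : ℕ := cCoins k z % sA2 k % sA3 k % sA4 k

/-- Entry `t` of a function code `w` with entries of size `a` (the exponent clamped by `T₁ = 70`, the largest
number of trials, so that the function is polynomially bounded in `t`). [folklore] -/
def fget (a w t : ℕ) : ℕ := w / a ^ (min t T₁) % a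

/-! ### The leaves -/

/-- `(c.1.1 t).1`. [folklore] -/
def lF1 (k z t : ℕ) : ℕ := fget (2 ^ nv k * 2 ^ nv k) (cBF k z) t / 2 ^ nv k
/-- `(c.1.1 t).2`. [folklore] -/
def lF2 (k z t : ℕ) : ℕ := fget (2 ^ nv k * 2 ^ nv k) (cBF k z) t % 2 ^ nv k
/-- `(c.1.2.1 t).1`. [folklore] -/
def lG1 (k z t : ℕ) : ℕ := fget (2 ^ (nv k * nv k) * 2 ^ (nv k * nv k)) (cBG k z) t / 2 ^ (nv k * nv k)
/-- `(c.1.2.1 t).2`. [folklore] -/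
def lG2 (k z t : ℕ) : ℕ := fget (2 ^ (nv k * nv k) * 2 ^ (nv k * nv k)) (cBG k z) t % 2 ^ (nv k * nv k)
/-- `(c.1.2.2.1 t).1` (`r`). [folklore] -/
def lT1 (k z t : ℕ) : ℕ := fget (2 ^ nv k * (2 ^ nv k * 2 ^ (nv k * nv k))) (cTen k z) t / (2 ^ nv k * 2 ^ (nv k * nv k))
/-- `(c.1.2.2.1 t).2.1` (`r'`). [folklore] -/
def lT2 (k z t : ℕ) : ℕ := fget (2 ^ nv k * (2 ^ nv k * 2 ^ (nv k * nv k))) (cTen k z) t % (2 ^ nv k * 2 ^ (nv k * nv k)) / 2 ^ (nv k * nv k)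
/-- `(c.1.2.2.1 t).2.2` (`Z`). [folklore] -/
def lT3 (k z t : ℕ) : ℕ := fget (2 ^ nv k * (2 ^ nv k * 2 ^ (nv k * nv k))) (cTen k z) t % (2 ^ nv k * 2 ^ (nv k * nv k)) % 2 ^ (nv k * nv k)
/-- `(c.1.2.2.2 t).1` (the equation selector). [folklore] -/
def lE1 (k z t : ℕ) : ℕ := fget (2 ^ ne k * 2 ^ (nv k * nv k)) (cEqn k z) t / 2 ^ (nv k * nv k)
/-- `(c.1.2.2.2 t).2` (`Z`). [folklore] -/
def lE2 (k z t : ℕ) : ℕ := fget (2 ^ ne k * 2 ^ (nv k * nv k)) (cEqn k z) t % 2 ^ (nv k * nv k)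
/-- `(c.2.1 t).1`. [folklore] -/
def lP11 (k z t : ℕ) : ℕ := fget (2 ^ k * 2 ^ k) (cP1 k z) t / 2 ^ k
/-- `(c.2.1 t).2`. [folklore] -/
def lP12 (k z t : ℕ) : ℕ := fget (2 ^ k * 2 ^ k) (cP1 k z) t % 2 ^ k
/-- `(c.2.2.1 t).1`. [folklore] -/
def lP21 (k z t : ℕ) : ℕ := fget (2 ^ k * 2 ^ k) (cP2 k z) t / 2 ^ k
/-- `(c.2.2.1 t).2`. [folklore] -/
def lP22 (k z t : ℕ) : ℕ := fget (2 ^ k * 2 ^ k) (cP2 k z) t % 2 ^ k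
/-- `(c.2.2.2 t).1` (`x`). [folklore] -/
def lC1 (k z t : ℕ) : ℕ := fget (2 ^ k * (2 ^ k * 2 ^ nv k)) (cCat k z) t / (2 ^ k * 2 ^ nv k)
/-- `(c.2.2.2 t).2.1` (`y`). [folklore] -/
def lC2 (k z t : ℕ) : ℕ := fget (2 ^ k * (2 ^ k * 2 ^ nv k)) (cCat k z) t % (2 ^ k * 2 ^ nv k) / 2 ^ nv k
/-- `(c.2.2.2 t).2.2` (`r`). [folklore] -/
def lC3 (k z t : ℕ) : ℕ := fget (2 ^ k * (2 ^ k * 2 ^ nv k)) (cCat k z) t % (2 ^ k * 2 ^ nv k) % 2 ^ nv k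

/-! ### Decoding lemmas -/

/-- The code of a pair. [folklore] -/
theorem pairFin_val {α β : Type} {a b : ℕ} (ea : α ≃ Fin a) (eb : β ≃ Fin b) (p : α × β) :
    (pairFin ea eb p).val = (eb p.2).val + b * (ea p.1).val := by
  unfold pairFin; simp [finProdFinEquiv_apply_val]

/-- The first component of a pair code. [folklore] -/
theorem pairFin_val_div {α β : Type} {a b : ℕ} (ea : α ≃ Fin a) (eb : β ≃ Fin b) (p : α × β) :
    (pairFin ea eb p).val / b = (ea p.1).val := by
  rw [pairFin_val, Nat.add_mul_div_left _ _ (Fin.pos (eb p.2)), Nat.div_eq_of_lt (eb p.2).2, zero_add]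

/-- The second component of a pair code. [folklore] -/
theorem pairFin_val_mod {α β : Type} {a b : ℕ} (ea : α ≃ Fin a) (eb : β ≃ Fin b) (p : α × β) :
    (pairFin ea eb p).val % b = (eb p.2).val := by
  rw [pairFin_val, Nat.add_mul_mod_self_left, Nat.mod_eq_of_lt (eb p.2).2]

/-- The entries of a function code. [folklore] -/
theorem fget_funFin {α : Type} {a : ℕ} (T : ℕ) (hT : T ≤ T₁) (ea : α ≃ Fin a) (f : Fin T → α) (t : Fin T) :
    fget a (funFin T ea f).val t.val = (ea (f t)).val := by
  unfold fget funFin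
  rw [min_eq_left (t.2.le.trans hT)]
  have h := finFunctionFinEquiv_symm_apply_val (finFunctionFinEquiv (ea ∘ f)) t
  rw [Equiv.symm_apply_apply] at h
  exact h.symm

/-- `toNat` is the code of `vecFin`. [folklore] -/
theorem toNat_eq_vecFin {ι : ℕ} (x : Fin ι → Bool) : toNat x = (vecFin ι x).val := rfl

section Leaves

variable (k : ℕ) (c : TCoins k)

/-- The code of the Hadamard coins. [folklore] -/
theorem cCoins_eq : cCoins k (tcoinsFin k c).val = (coinsFin (nv k) (ne k) c.1).val := by
  unfold cCoins tcoinsFin sB1 sB2 sB3; exact pairFin_val_div _ _ c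

/-- The code of `c.2`. [folklore] -/
theorem cRest_eq : (tcoinsFin k c).val % sB1 k =
    (pairFin (funFin T₁ (pairFin (vecFin k) (vecFin k)))
      (pairFin (funFin T₁ (pairFin (vecFin k) (vecFin k))) (funFin T₄ (pairFin (vecFin k) (pairFin (vecFin k) (vecFin (nv k)))))) c.2).val := by
  unfold tcoinsFin sB1 sB2 sB3; exact pairFin_val_mod _ _ c

/-- The code of the `π₁` pairs. [folklore] -/
theorem cP1_eq : cP1 k (tcoinsFin k c).val = (funFin T₁ (pairFin (vecFin k) (vecFin k)) c.2.1).val := by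
  unfold cP1; rw [cRest_eq]; unfold sB2 sB3; exact pairFin_val_div _ _ c.2

/-- The code of the `π₂` pairs. [folklore] -/
theorem cP2_eq : cP2 k (tcoinsFin k c).val = (funFin T₁ (pairFin (vecFin k) (vecFin k)) c.2.2.1).val := by
  unfold cP2; rw [cRest_eq]; unfold sB2 sB3; rw [pairFin_val_mod]; exact pairFin_val_div _ _ c.2.2

/-- The code of the concatenation triples. [folklore] -/
theorem cCat_eq : cCat k (tcoinsFin k c).val = (funFin T₄ (pairFin (vecFin k) (pairFin (vecFin k) (vecFin (nv k)))) c.2.2.2).val := by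
  unfold cCat; rw [cRest_eq]; unfold sB2 sB3; rw [pairFin_val_mod]; exact pairFin_val_mod _ _ c.2.2

/-- The code of the `f` pairs. [folklore] -/
theorem cBF_eq : cBF k (tcoinsFin k c).val = (funFin T₁ (pairFin (vecFin (nv k)) (vecFin (nv k))) c.1.1).val := by
  unfold cBF; rw [cCoins_eq]; unfold coinsFin sA2 sA3 sA4; exact pairFin_val_div _ _ c.1

/-- The code of `c.1.2`. [folklore] -/
theorem cRestA_eq : cCoins k (tcoinsFin k c).val % sA2 k =
    (pairFin (funFin T₁ (pairFin (vecFin (nv k * nv k)) (vecFin (nv k * nv k))))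
      (pairFin (funFin T₂ (pairFin (vecFin (nv k)) (pairFin (vecFin (nv k)) (vecFin (nv k * nv k)))))
        (funFin T₃ (pairFin (vecFin (ne k)) (vecFin (nv k * nv k))))) c.1.2).val := by
  rw [cCoins_eq]; unfold coinsFin sA2 sA3 sA4; exact pairFin_val_mod _ _ c.1

/-- The code of the `g` pairs. [folklore] -/
theorem cBG_eq : cBG k (tcoinsFin k c).val = (funFin T₁ (pairFin (vecFin (nv k * nv k)) (vecFin (nv k * nv k))) c.1.2.1).val := by
  unfold cBG; rw [cRestA_eq]; unfold sA3 sA4; exact pairFin_val_div _ _ c.1.2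

/-- The code of the tensor triples. [folklore] -/
theorem cTen_eq : cTen k (tcoinsFin k c).val = (funFin T₂ (pairFin (vecFin (nv k)) (pairFin (vecFin (nv k)) (vecFin (nv k * nv k)))) c.1.2.2.1).val := by
  unfold cTen; rw [cRestA_eq]; unfold sA3 sA4; rw [pairFin_val_mod]; exact pairFin_val_div _ _ c.1.2.2

/-- The code of the equation pairs. [folklore] -/
theorem cEqn_eq : cEqn k (tcoinsFin k c).val = (funFin T₃ (pairFin (vecFin (ne k)) (vecFin (nv k * nv k))) c.1.2.2.2).val := by
  unfold cEqn; rw [cRestA_eq]; unfold sA3 sA4; rw [pairFin_val_mod]; exact pairFin_val_mod _ _ c.1.2.2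

/-- `(c.1.1 t).1` decoded. [folklore] -/
theorem toNat_lF1 (t : Fin T₁) : toNat (c.1.1 t).1 = lF1 k (tcoinsFin k c).val t.val := by
  unfold lF1; rw [cBF_eq, fget_funFin _ le_rfl, pairFin_val_div]; rfl
/-- `(c.1.1 t).2` decoded. [folklore] -/
theorem toNat_lF2 (t : Fin T₁) : toNat (c.1.1 t).2 = lF2 k (tcoinsFin k c).val t.val := by
  unfold lF2; rw [cBF_eq, fget_funFin _ le_rfl, pairFin_val_mod]; rfl
/-- `(c.1.2.1 t).1` decoded. [folklore] -/
theorem toNat_lG1 (t : Fin T₁) : toNat (c.1.2.1 t).1 = lG1 k (tcoinsFin k c).val t.val := by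
  unfold lG1; rw [cBG_eq, fget_funFin _ le_rfl, pairFin_val_div]; rfl
/-- `(c.1.2.1 t).2` decoded. [folklore] -/
theorem toNat_lG2 (t : Fin T₁) : toNat (c.1.2.1 t).2 = lG2 k (tcoinsFin k c).val t.val := by
  unfold lG2; rw [cBG_eq, fget_funFin _ le_rfl, pairFin_val_mod]; rfl
/-- `(c.1.2.2.1 t).1` decoded. [folklore] -/
theorem toNat_lT1 (t : Fin T₂) : toNat (c.1.2.2.1 t).1 = lT1 k (tcoinsFin k c).val t.val := by
  unfold lT1; rw [cTen_eq, fget_funFin _ (by decide : T₂ ≤ T₁), pairFin_val_div]; rfl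
/-- `(c.1.2.2.1 t).2.1` decoded. [folklore] -/
theorem toNat_lT2 (t : Fin T₂) : toNat (c.1.2.2.1 t).2.1 = lT2 k (tcoinsFin k c).val t.val := by
  unfold lT2; rw [cTen_eq, fget_funFin _ (by decide : T₂ ≤ T₁), pairFin_val_mod, pairFin_val_div]; rfl
/-- `(c.1.2.2.1 t).2.2` decoded. [folklore] -/
theorem toNat_lT3 (t : Fin T₂) : toNat (c.1.2.2.1 t).2.2 = lT3 k (tcoinsFin k c).val t.val := by
  unfold lT3; rw [cTen_eq, fget_funFin _ (by decide : T₂ ≤ T₁), pairFin_val_mod, pairFin_val_mod]; rfl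
/-- `(c.1.2.2.2 t).1` decoded. [folklore] -/
theorem toNat_lE1 (t : Fin T₃) : toNat (c.1.2.2.2 t).1 = lE1 k (tcoinsFin k c).val t.val := by
  unfold lE1; rw [cEqn_eq, fget_funFin _ (by decide : T₃ ≤ T₁), pairFin_val_div]; rfl
/-- `(c.1.2.2.2 t).2` decoded. [folklore] -/
theorem toNat_lE2 (t : Fin T₃) : toNat (c.1.2.2.2 t).2 = lE2 k (tcoinsFin k c).val t.val := by
  unfold lE2; rw [cEqn_eq, fget_funFin _ (by decide : T₃ ≤ T₁), pairFin_val_mod]; rfl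
/-- `(c.2.1 t).1` decoded. [folklore] -/
theorem toNat_lP11 (t : Fin T₁) : toNat (c.2.1 t).1 = lP11 k (tcoinsFin k c).val t.val := by
  unfold lP11; rw [cP1_eq, fget_funFin _ le_rfl, pairFin_val_div]; rfl
/-- `(c.2.1 t).2` decoded. [folklore] -/
theorem toNat_lP12 (t : Fin T₁) : toNat (c.2.1 t).2 = lP12 k (tcoinsFin k c).val t.val := by
  unfold lP12; rw [cP1_eq, fget_funFin _ le_rfl, pairFin_val_mod]; rfl
/-- `(c.2.2.1 t).1` decoded. [folklore] -/
theorem toNat_lP21 (t : Fin T₁) : toNat (c.2.2.1 t).1 = lP21 k (tcoinsFin k c).val t.val := by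
  unfold lP21; rw [cP2_eq, fget_funFin _ le_rfl, pairFin_val_div]; rfl
/-- `(c.2.2.1 t).2` decoded. [folklore] -/
theorem toNat_lP22 (t : Fin T₁) : toNat (c.2.2.1 t).2 = lP22 k (tcoinsFin k c).val t.val := by
  unfold lP22; rw [cP2_eq, fget_funFin _ le_rfl, pairFin_val_mod]; rfl
/-- `(c.2.2.2 t).1` decoded. [folklore] -/
theorem toNat_lC1 (t : Fin T₄) : toNat (c.2.2.2 t).1 = lC1 k (tcoinsFin k c).val t.val := by
  unfold lC1; rw [cCat_eq, fget_funFin _ (by decide : T₄ ≤ T₁), pairFin_val_div]; rfl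
/-- `(c.2.2.2 t).2.1` decoded. [folklore] -/
theorem toNat_lC2 (t : Fin T₄) : toNat (c.2.2.2 t).2.1 = lC2 k (tcoinsFin k c).val t.val := by
  unfold lC2; rw [cCat_eq, fget_funFin _ (by decide : T₄ ≤ T₁), pairFin_val_mod, pairFin_val_div]; rfl
/-- `(c.2.2.2 t).2.2` decoded. [folklore] -/
theorem toNat_lC3 (t : Fin T₄) : toNat (c.2.2.2 t).2.2 = lC3 k (tcoinsFin k c).val t.val := by
  unfold lC3; rw [cCat_eq, fget_funFin _ (by decide : T₄ ≤ T₁), pairFin_val_mod, pairFin_val_mod]; rfl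

end Leaves

end GapPV

end Literature.Computability.Complexity

/-!
## XVI. The truth-table quadratic system as numbers

The numeric mirror of `TableQuadEq.lean` (the quadratic system of a `k`-bit relation `R`, Cor. 22.13)
and of the GF(2) vector operations of the Hadamard tester, on codes `toNat` of bit vectors:

* bit vectors as numbers: `testBit_toNat`, `toNat_lt`, codes of `xorVec` (`toNat_xorVec`), of
  `tensorVec` (`tensN`), of `embed` (`toNat_embed`);
* the numbering of the gadget variables `varEquiv` (`xvc`, `yvc`, `pvc`, `qvc`) and monomials (`monoN`);
* the coefficient table `tableA R s` at a tensor position (`tabAN`, by cases on the equation code `s`: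
  `p`-chain, `q`-chain, pair equation — the latter reads one truth-table entry `R a b`), the right-hand
  sides `tableb` (`tabBN`), the subset sums `subsetSum sel (tableA R)` (`ssN`) and `dot sel (tableb R)` (`dotBN`).

## References

* S. Arora, B. Barak, *Computational Complexity: A Modern Approach*, CUP 2009, §11.5.2, §22.2.5 (Cor. 22.13).
-/

set_option exponentiation.threshold 4096

namespace Literature.Computability.Complexity

open _root_.Computability Literature.Analysis.FunctionSpaces

namespace GapPV

open StrNum Expander Expander.Enc BLR BLR.Table LowDegree Finset
open Expander.LazyCSP (toNat)

/-! ### Bit vectors as numbers -/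

/-- Decoding a code: bit `i` of `(boolVecEquiv ι)⁻¹ t` is `testBit t i`. [folklore] -/
theorem bve_symm_apply {ι : ℕ} (t : Fin (2 ^ ι)) (i : Fin ι) : (boolVecEquiv ι).symm t i = t.val.testBit i.val := by
  unfold boolVecEquiv
  simp only [Equiv.symm_trans_apply, Equiv.arrowCongr_symm, Equiv.arrowCongr_apply, Equiv.refl_symm, Equiv.coe_refl,
    Function.comp_apply, id_eq, Equiv.symm_symm]
  rw [Nat.testBit_eq_decide_div_mod_eq]
  have h : ((finFunctionFinEquiv.symm t) i : ℕ) = t.val / 2 ^ i.val % 2 := finFunctionFinEquiv_symm_apply_val t i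
  generalize hx : finFunctionFinEquiv.symm t i = x at h
  unfold finTwoEquiv
  simp only [Equiv.coe_fn_mk]
  rcases Nat.mod_two_eq_zero_or_one (t.val / 2 ^ i.val) with h0 | h1
  · rw [h0] at h ⊢; have : x = 0 := Fin.ext h; subst this; decide
  · rw [h1] at h ⊢; have : x = 1 := Fin.ext h; subst this; decide

/-- `toNat x < 2^ι`. [folklore] -/
theorem toNat_lt {ι : ℕ} (x : Fin ι → Bool) : toNat x < 2 ^ ι := (boolVecEquiv ι x).2

/-- **The bits of `toNat x` are `x`.** [folklore] -/
theorem testBit_toNat {ι : ℕ} (x : Fin ι → Bool) (i : Fin ι) : (toNat x).testBit i.val = x i := by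
  have h := bve_symm_apply (boolVecEquiv ι x) i
  rw [Equiv.symm_apply_apply] at h
  exact h.symm

/-- The bits of `toNat x` beyond `ι` vanish. [folklore] -/
theorem testBit_toNat_of_le {ι : ℕ} (x : Fin ι → Bool) {i : ℕ} (hi : ι ≤ i) : (toNat x).testBit i = false :=
  Nat.testBit_eq_false_of_lt ((toNat_lt x).trans_le (Nat.pow_le_pow_right two_pos hi))

/-- All bits of `toNat x`. [folklore] -/
theorem testBit_toNat' {ι : ℕ} (x : Fin ι → Bool) (i : ℕ) : (toNat x).testBit i = if h : i < ι then x ⟨i, h⟩ else false := by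
  split_ifs with h
  · exact testBit_toNat x ⟨i, h⟩
  · exact testBit_toNat_of_le x (not_lt.1 h)

/-- **The code of a coordinatewise sum is the bitwise `xor`.** [folklore] -/
theorem toNat_xorVec {ι : ℕ} (x y : Fin ι → Bool) : toNat (xorVec x y) = toNat x ^^^ toNat y := by
  apply Nat.eq_of_testBit_eq; intro i
  rw [Nat.testBit_xor, testBit_toNat', testBit_toNat', testBit_toNat']
  split_ifs with h
  · rfl
  · rfl

/-- A number from a `0/1` sequence: `∑_{i<ι} f(i) 2^i` (= `seqOf 1`). [folklore] -/
def ofBits (f : ℕ → ℕ) (ι : ℕ) : ℕ := seqOf 1 f ι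

/-- The bits of `ofBits`. [folklore] -/
theorem testBit_ofBits {f : ℕ → ℕ} (hf : ∀ i, f i ≤ 1) (ι i : ℕ) : (ofBits f ι).testBit i = decide (i < ι ∧ f i = 1) := by
  unfold ofBits
  by_cases hi : i < ι
  · have h := dig_seqOf_of_lt (b := 1) (f := f) hi (by have := hf i; simp; omega)
    unfold dig at h
    rw [mul_one, pow_one] at h
    rw [Nat.testBit_eq_decide_div_mod_eq, h]
    by_cases h1 : f i = 1 <;> simp [hi, h1]
  · have hlt : seqOf 1 f ι < 2 ^ i := (seqOf_lt 1 f ι).trans_le (Nat.pow_le_pow_right two_pos (by rw [mul_one]; exact not_lt.1 hi))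
    rw [Nat.testBit_eq_false_of_lt hlt]
    simp [hi]

/-- **A vector from its bits**: if `f i = (x i).toNat` then `toNat x = ofBits f ι`. [folklore] -/
theorem toNat_eq_ofBits {ι : ℕ} (x : Fin ι → Bool) {f : ℕ → ℕ} (hf : ∀ i, f i ≤ 1) (hfx : ∀ i : Fin ι, f i.val = (x i).toNat) :
    toNat x = ofBits f ι := by
  apply Nat.eq_of_testBit_eq; intro i
  rw [testBit_toNat', testBit_ofBits hf]
  split_ifs with h
  · rw [hfx ⟨i, h⟩]; cases x ⟨i, h⟩ <;> simp [h]
  · simp [h]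

/-- The code of a tensor `r ⊗ r'` (position `idx ↦ r (idx / n) ∧ r' (idx % n)`). [cite: AroraBarakCC2009, §11.5.2] -/
def tensN (n R R' : ℕ) : ℕ := ofBits (fun idx => (R.testBit (idx / n)).toNat * (R'.testBit (idx % n)).toNat) (n * n)

/-- **The code of `tensorVec`.** [cite: AroraBarakCC2009, §11.5.2] -/
theorem toNat_tensorVec {n : ℕ} (r r' : Fin n → Bool) : toNat (tensorVec r r') = tensN n (toNat r) (toNat r') := by
  unfold tensN
  refine toNat_eq_ofBits _ (fun idx => ?_) (fun idx => ?_)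
  · cases (toNat r).testBit (idx / n) <;> cases (toNat r').testBit (idx % n) <;> simp
  · have h1 : ((finProdFinEquiv.symm idx).1 : ℕ) = idx.val / n := rfl
    have h2 : ((finProdFinEquiv.symm idx).2 : ℕ) = idx.val % n := rfl
    unfold tensorVec
    rw [← testBit_toNat r, ← testBit_toNat r', h1, h2]
    cases (toNat r).testBit (idx.val / n) <;> cases (toNat r').testBit (idx.val % n) <;> rfl

/-! ### The gadget variables -/

/-- The code of `p_{a,j}`: `2k + (j + (k+1) A)`. [cite: AroraBarakCC2009, §22.2.5] -/
def pvc (k A j : ℕ) : ℕ := k + (k + (j + (k + 1) * A))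

/-- The code of `q_{a,j}`: `2k + 2^k (k+1) + (j + (k+1) A)`. [cite: AroraBarakCC2009, §22.2.5] -/
def qvc (k A j : ℕ) : ℕ := k + (k + (2 ^ k * (k + 1) + (j + (k + 1) * A)))

/-- `varEquiv` on `x_i`. [folklore] -/
theorem varEquiv_inl (k : ℕ) (i : Fin k) : (varEquiv k (Sum.inl i)).val = i.val := rfl

/-- `varEquiv` on `y_i`. [folklore] -/
theorem varEquiv_inr_inl (k : ℕ) (i : Fin k) : (varEquiv k (Sum.inr (Sum.inl i))).val = k + i.val := rfl

/-- `varEquiv` on `p_{a,j}`. [folklore] -/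
theorem varEquiv_pv (k : ℕ) (a : Fin k → Bool) (j : Fin (k + 1)) : (varEquiv k (pv a j)).val = pvc k (toNat a) j.val := by
  rfl

/-- `varEquiv` on `q_{a,j}`. [folklore] -/
theorem varEquiv_qv (k : ℕ) (a : Fin k → Bool) (j : Fin (k + 1)) : (varEquiv k (qv a j)).val = qvc k (toNat a) j.val := by
  rfl

/-- The code of the monomial position `(v, w)`: `w + nv · v`. [folklore] -/
def monoN (k v w : ℕ) : ℕ := w + nv k * v

/-- `unitVec` as a code comparison. [folklore] -/
theorem unitVec_iff (k : ℕ) (v w : Var k) (idx : Fin (nv k * nv k)) :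
    unitVec (varEquiv k v) (varEquiv k w) idx = decide (idx.val = monoN k (varEquiv k v).val (varEquiv k w).val) := by
  unfold unitVec monoN
  simp only [Fin.ext_iff, finProdFinEquiv_apply_val]

/-- `monoVec` on a cons. [folklore] -/
theorem monoVec_cons {n : ℕ} (p : Fin n × Fin n) (M : List (Fin n × Fin n)) (idx : Fin (n * n)) :
    monoVec (p :: M) idx = xor (unitVec p.1 p.2 idx) (monoVec M idx) := rfl

/-- `monoVec []`. [folklore] -/
theorem monoVec_nil {n : ℕ} (idx : Fin (n * n)) : monoVec ([] : List (Fin n × Fin n)) idx = false := rfl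

/-- **The code of the embedding `XY`**: `toNat x + 2^k toNat y`. [cite: AroraBarakCC2009, §22.2.5 (concatenation test)] -/
theorem toNat_embed (k : ℕ) (x y : Fin k → Bool) : toNat (embed x y) = toNat x + 2 ^ k * toNat y := by
  apply Nat.eq_of_testBit_eq; intro i
  rw [testBit_toNat', add_comm, Nat.testBit_two_pow_mul_add _ (toNat_lt x)]
  by_cases hi : i < nv k
  · rw [dif_pos hi]
    unfold embed
    by_cases hik : i < k
    · have hv : (varEquiv k).symm ⟨i, hi⟩ = Sum.inl ⟨i, hik⟩ := by
        rw [Equiv.symm_apply_eq]; exact Fin.ext (varEquiv_inl k ⟨i, hik⟩).symm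
      rw [hv, if_pos hik]
      exact (testBit_toNat x ⟨i, hik⟩).symm
    · rw [if_neg hik]
      by_cases hi2 : i - k < k
      · have hv : (varEquiv k).symm ⟨i, hi⟩ = Sum.inr (Sum.inl ⟨i - k, hi2⟩) := by
          rw [Equiv.symm_apply_eq]; refine Fin.ext ?_; rw [varEquiv_inr_inl]; simp only; omega
        rw [hv]
        exact (testBit_toNat y ⟨i - k, hi2⟩).symm
      · rw [testBit_toNat_of_le y (not_lt.1 hi2)]
        generalize hv : (varEquiv k).symm ⟨i, hi⟩ = v
        rcases v with a | a | b
        · exact absurd (congrArg (fun w => (varEquiv k w).val) hv) (by rw [Equiv.apply_symm_apply, varEquiv_inl]; simp only; omega)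
        · exact absurd (congrArg (fun w => (varEquiv k w).val) hv) (by rw [Equiv.apply_symm_apply, varEquiv_inr_inl]; simp only; omega)
        · rfl
  · rw [dif_neg hi]
    have hk : ¬ i < k := fun h => hi (h.trans_le (by unfold Table.nv; omega))
    rw [if_neg hk, testBit_toNat_of_le y (by unfold Table.nv at hi; omega)]

/-! ### The equations -/

/-- The size `2^k (k+1)` of one chain block of equations. [folklore] -/
def B1 (k : ℕ) : ℕ := 2 ^ k * (k + 1)

/-- `decide` as `0/1`. [folklore] -/
theorem toNat_decide (P : Prop) [Decidable P] : (decide P).toNat = if P then 1 else 0 := by by_cases h : P <;> simp [h]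

/-- `(b₁ + b₂) mod 2` as a Boolean. [folklore] -/
theorem toNat_xor (p q : Bool) : (xor p q).toNat = (p.toNat + q.toNat) % 2 := by cases p <;> cases q <;> rfl

/-- The coefficient, at the tensor position `idx`, of equation `i` of a chain with variables of codes `cv j`,
inputs of codes `iv j` and target bits `A` (as `0/1`). [cite: AroraBarakCC2009, §22.2.5 (chain equations)] -/
def chainAt (k : ℕ) (cv iv : ℕ → ℕ) (A i idx : ℕ) : ℕ :=
  if i = 0 then (if idx = monoN k (cv 0) (cv 0) then 1 else 0)
  else ((if idx = monoN k (cv i) (cv i) then 1 else 0) + (if idx = monoN k (cv (i - 1)) (iv (i - 1)) then 1 else 0) +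
      (if A.testBit (i - 1) then 0 else (if idx = monoN k (cv (i - 1)) (cv (i - 1)) then 1 else 0))) % 2

/-- **The coefficient table `tableA R s idx`** from the equation code `s` and one truth-table entry. [cite: AroraBarakCC2009, §22.2.5] -/
def tabAN (k : ℕ) (R01 : ℕ → ℕ → ℕ) (s idx : ℕ) : ℕ :=
  if s < B1 k then chainAt k (fun j => pvc k (s / (k + 1)) j) (fun j => j) (s / (k + 1)) (s % (k + 1)) idx
  else if s < B1 k + B1 k then chainAt k (fun j => qvc k ((s - B1 k) / (k + 1)) j) (fun j => k + j) ((s - B1 k) / (k + 1)) ((s - B1 k) % (k + 1)) idx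
  else (if R01 ((s - (B1 k + B1 k)) / 2 ^ k) ((s - (B1 k + B1 k)) % 2 ^ k) = 1 then 0
    else (if idx = monoN k (pvc k ((s - (B1 k + B1 k)) / 2 ^ k) k) (qvc k ((s - (B1 k + B1 k)) % 2 ^ k) k) then 1 else 0))

/-- `tabAN ≤ 1`. [folklore] -/
theorem tabAN_le (k : ℕ) (R01 : ℕ → ℕ → ℕ) (s idx : ℕ) : tabAN k R01 s idx ≤ 1 := by
  unfold tabAN chainAt; split_ifs <;> omega

/-- **The right-hand sides `tableb`**: `1` exactly for equation `0` of each chain. [cite: AroraBarakCC2009, §22.2.5] -/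
def tabBN (k s : ℕ) : ℕ :=
  if s < B1 k then (if s % (k + 1) = 0 then 1 else 0) else if s < B1 k + B1 k then (if (s - B1 k) % (k + 1) = 0 then 1 else 0) else 0

/-- The code of a chain block element. [folklore] -/
theorem blockEquiv_val (k : ℕ) (a : Fin k → Bool) (i : Fin (k + 1)) : (blockEquiv k (a, i)).val = i.val + (k + 1) * toNat a := rfl

/-- The codes of the three kinds of equations. [folklore] -/
theorem eqnEquiv_inl (k : ℕ) (a : Fin k → Bool) (i : Fin (k + 1)) : (eqnEquiv k (Sum.inl (a, i))).val = i.val + (k + 1) * toNat a := rfl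

/-- The code of a `q`-chain equation. [folklore] -/
theorem eqnEquiv_inr_inl (k : ℕ) (a : Fin k → Bool) (i : Fin (k + 1)) :
    (eqnEquiv k (Sum.inr (Sum.inl (a, i)))).val = B1 k + (i.val + (k + 1) * toNat a) := rfl

/-- The code of a pair equation. [folklore] -/
theorem eqnEquiv_inr_inr (k : ℕ) (a b : Fin k → Bool) :
    (eqnEquiv k (Sum.inr (Sum.inr (a, b)))).val = B1 k + (B1 k + (toNat b + 2 ^ k * toNat a)) := rfl

/-- A block code, decomposed. [folklore] -/
theorem block_div_mod (k : ℕ) (a : Fin k → Bool) (i : Fin (k + 1)) :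
    (i.val + (k + 1) * toNat a) / (k + 1) = toNat a ∧ (i.val + (k + 1) * toNat a) % (k + 1) = i.val :=
  ⟨by rw [Nat.add_mul_div_left _ _ (Nat.succ_pos k), Nat.div_eq_of_lt i.2, zero_add],
   by rw [Nat.add_mul_mod_self_left, Nat.mod_eq_of_lt i.2]⟩

/-- A block code is `< B1`. [folklore] -/
theorem block_lt (k : ℕ) (a : Fin k → Bool) (i : Fin (k + 1)) : i.val + (k + 1) * toNat a < B1 k := by
  rw [← blockEquiv_val]; exact (blockEquiv k (a, i)).2

/-- **The chain monomials, arithmetized.** [cite: AroraBarakCC2009, §22.2.5] -/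
theorem chainAt_eq (k : ℕ) (c : Fin (k + 1) → Var k) (inp : Fin k → Var k) (a : Fin k → Bool) (cv iv : ℕ → ℕ)
    (hc : ∀ j : Fin (k + 1), cv j.val = (varEquiv k (c j)).val) (hi : ∀ j : Fin k, iv j.val = (varEquiv k (inp j)).val)
    (i : Fin (k + 1)) (idx : Fin (nv k * nv k)) :
    chainAt k cv iv (toNat a) i.val idx.val = (monoVec (chainMonos c inp a i) idx).toNat := by
  unfold chainAt
  refine Fin.cases ?_ (fun j => ?_) i
  · rw [if_pos (show ((0 : Fin (k + 1)) : ℕ) = 0 from rfl)]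
    show _ = (monoVec [mono (c 0) (c 0)] idx).toNat
    have h0 : cv 0 = (varEquiv k (c 0)).val := by rw [← hc 0]; rfl
    rw [monoVec_cons, monoVec_nil, Bool.xor_false]
    unfold mono; rw [unitVec_iff, ← h0]
    by_cases h : idx.val = monoN k (cv 0) (cv 0) <;> simp [h]
  · rw [if_neg (by rw [Fin.val_succ]; exact Nat.succ_ne_zero _)]
    show _ = (monoVec ([mono (c j.succ) (c j.succ), mono (c (Fin.castSucc j)) (inp j)] ++
      (if a j then [] else [mono (c (Fin.castSucc j)) (c (Fin.castSucc j))])) idx).toNat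
    have hj : j.succ.val - 1 = j.val := by rw [Fin.val_succ]; rfl
    have hcs : cv j.val = (varEquiv k (c (Fin.castSucc j))).val := hc (Fin.castSucc j)
    have hcS : cv (j.val + 1) = (varEquiv k (c j.succ)).val := by rw [← Fin.val_succ]; exact hc j.succ
    rw [hj, testBit_toNat a j, Fin.val_succ, List.cons_append, monoVec_cons, List.cons_append, monoVec_cons, List.nil_append]
    unfold mono
    rw [unitVec_iff, unitVec_iff, ← hcS, ← hcs, ← hi j]
    cases ha : a j
    · simp only [Bool.false_eq_true, if_false]
      rw [monoVec_cons, monoVec_nil, Bool.xor_false, unitVec_iff, ← hcs]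
      simp only [toNat_xor, toNat_decide]
      split_ifs <;> omega
    · simp only [if_true]
      rw [monoVec_nil, Bool.xor_false]
      simp only [toNat_xor, toNat_decide]
      split_ifs <;> omega

/-- **The coefficient table, arithmetized.** [cite: AroraBarakCC2009, §22.2.5] -/
theorem tabAN_eq (k : ℕ) {R : (Fin k → Bool) → (Fin k → Bool) → Bool} {R01 : ℕ → ℕ → ℕ}
    (hR : ∀ a b, R01 (toNat a) (toNat b) = (R a b).toNat) (e : Eqn k) (idx : Fin (nv k * nv k)) :
    tabAN k R01 (eqnEquiv k e).val idx.val = (tableA R (eqnEquiv k e) idx).toNat := by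
  unfold tableA
  rw [Equiv.symm_apply_apply]
  rcases e with ⟨a, i⟩ | ⟨a, i⟩ | ⟨a, b⟩
  · rw [eqnEquiv_inl]
    unfold tabAN
    rw [if_pos (block_lt k a i), (block_div_mod k a i).1, (block_div_mod k a i).2]
    exact chainAt_eq k (pv a) Sum.inl a _ _ (fun j => (varEquiv_pv k a j).symm) (fun j => (varEquiv_inl k j).symm) i idx
  · rw [eqnEquiv_inr_inl]
    unfold tabAN
    have hb := block_lt k a i
    rw [if_neg (by omega), if_pos (by omega), Nat.add_sub_cancel_left, (block_div_mod k a i).1, (block_div_mod k a i).2]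
    exact chainAt_eq k (qv a) (fun j => Sum.inr (Sum.inl j)) a _ _ (fun j => (varEquiv_qv k a j).symm) (fun j => (varEquiv_inr_inl k j).symm) i idx
  · rw [eqnEquiv_inr_inr]
    unfold tabAN
    rw [if_neg (by omega), if_neg (by omega), show B1 k + (B1 k + (toNat b + 2 ^ k * toNat a)) - (B1 k + B1 k) = toNat b + 2 ^ k * toNat a by omega,
      Nat.add_mul_div_left _ _ (Nat.two_pow_pos k), Nat.div_eq_of_lt (toNat_lt b), zero_add, Nat.add_mul_mod_self_left,
      Nat.mod_eq_of_lt (toNat_lt b), hR]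
    show _ = (monoVec (if R a b then [] else [mono (pv a (Fin.last k)) (qv b (Fin.last k))]) idx).toNat
    cases R a b
    · rw [if_neg (by simp)]
      simp only [Bool.false_eq_true, if_false]
      rw [monoVec_cons, monoVec_nil, Bool.xor_false]
      unfold mono
      rw [unitVec_iff, varEquiv_pv, varEquiv_qv, Fin.val_last, toNat_decide]
    · simp [monoVec_nil]

/-- **The right-hand sides, arithmetized.** [cite: AroraBarakCC2009, §22.2.5] -/
theorem tabBN_eq (k : ℕ) (R : (Fin k → Bool) → (Fin k → Bool) → Bool) (e : Eqn k) :
    tabBN k (eqnEquiv k e).val = (tableb R (eqnEquiv k e)).toNat := by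
  unfold tableb
  rw [Equiv.symm_apply_apply]
  rcases e with ⟨a, i⟩ | ⟨a, i⟩ | ⟨a, b⟩
  · rw [eqnEquiv_inl]
    unfold tabBN
    rw [if_pos (block_lt k a i), (block_div_mod k a i).2]
    show _ = (chainRhs i).toNat
    unfold chainRhs
    rw [toNat_decide]
    simp only [Fin.ext_iff, Fin.val_zero]
  · rw [eqnEquiv_inr_inl]
    unfold tabBN
    have hb := block_lt k a i
    rw [if_neg (by omega), if_pos (by omega), Nat.add_sub_cancel_left, (block_div_mod k a i).2]
    show _ = (chainRhs i).toNat
    unfold chainRhs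
    rw [toNat_decide]
    simp only [Fin.ext_iff, Fin.val_zero]
  · rw [eqnEquiv_inr_inr]
    unfold tabBN
    rw [if_neg (by omega), if_neg (by omega)]
    rfl

/-! ### Subset sums -/

/-- Cardinalities over `Fin N` as bounded counts. [folklore] -/
theorem card_filter_fin (N : ℕ) (P : ℕ → Prop) [DecidablePred P] :
    (univ.filter fun e : Fin N => P e.val).card = countBelow (fun m => if P m then 1 else 0) N := by
  unfold countBelow
  rw [Finset.card_filter, Finset.card_filter, Fin.sum_univ_eq_sum_range (fun m => if P m then 1 else 0)]
  refine Finset.sum_congr rfl fun m _ => ?_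
  by_cases h : P m <;> simp [h]

/-- `dot`, as a count. [folklore] -/
theorem toNat_dot {N : ℕ} (s v : Fin N → Bool) (f : ℕ → ℕ) (hf : ∀ e : Fin N, f e.val = if s e = true ∧ v e = true then 1 else 0) :
    (dot s v).toNat = countBelow f N % 2 := by
  unfold dot
  rw [toNat_decide]
  have hc : (univ.filter fun i : Fin N => s i = true ∧ v i = true).card = countBelow f N := by
    have h1 : (univ.filter fun i : Fin N => s i = true ∧ v i = true) = univ.filter fun e : Fin N => f e.val = 1 := by
      ext e; simp only [mem_filter, mem_univ, true_and, hf e]; split_ifs with h <;> simp [h]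
    rw [h1, card_filter_fin N (fun m => f m = 1)]
    exact countBelow_congr fun m hm => by rw [hf ⟨m, hm⟩]; split_ifs <;> omega
  rw [hc]
  rcases Nat.mod_two_eq_zero_or_one (countBelow f N) with h | h <;> rw [h] <;> simp [Nat.odd_iff, h]

/-- **The code of the subset sum `∑_{e ∈ sel} A_e`** of the rows of `tableA R`. [cite: AroraBarakCC2009, §11.5.2 (Step 3)] -/
def ssN (k : ℕ) (R01 : ℕ → ℕ → ℕ) (sel : ℕ) : ℕ :=
  ofBits (fun idx => countBelow (fun e => if sel.testBit e then tabAN k R01 e idx else 0) (ne k) % 2) (nv k * nv k)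

/-- **The subset sum, arithmetized.** [cite: AroraBarakCC2009, §11.5.2 (Step 3)] -/
theorem toNat_subsetSum (k : ℕ) {R : (Fin k → Bool) → (Fin k → Bool) → Bool} {R01 : ℕ → ℕ → ℕ}
    (hR : ∀ a b, R01 (toNat a) (toNat b) = (R a b).toNat) (sel : Fin (ne k) → Bool) :
    toNat (BLR.subsetSum sel (tableA R)) = ssN k R01 (toNat sel) := by
  unfold ssN
  refine toNat_eq_ofBits _ (fun idx => Nat.le_of_lt_succ (Nat.mod_lt _ two_pos)) (fun idx => ?_)
  unfold BLR.subsetSum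
  refine (toNat_dot sel (fun e => tableA R e idx) _ fun e => ?_).symm
  rw [testBit_toNat sel e]
  cases sel e
  · simp
  · rw [← Equiv.apply_symm_apply (eqnEquiv k) e, tabAN_eq k hR, Equiv.apply_symm_apply]
    cases tableA R e idx <;> simp

/-- **The parity `sel ⊙ b`** of the selected right-hand sides. [cite: AroraBarakCC2009, §11.5.2 (Step 3)] -/
def dotBN (k sel : ℕ) : ℕ := countBelow (fun e => if sel.testBit e then tabBN k e else 0) (ne k) % 2

/-- **`dot sel (tableb R)`, arithmetized.** [cite: AroraBarakCC2009, §11.5.2 (Step 3)] -/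
theorem toNat_dot_tableb (k : ℕ) (R : (Fin k → Bool) → (Fin k → Bool) → Bool) (sel : Fin (ne k) → Bool) :
    (dot sel (tableb R)).toNat = dotBN k (toNat sel) := by
  unfold dotBN
  refine toNat_dot sel (tableb R) _ fun e => ?_
  rw [testBit_toNat sel e]
  cases sel e
  · simp
  · rw [← Equiv.apply_symm_apply (eqnEquiv k) e, tabBN_eq k R, Equiv.apply_symm_apply]
    cases tableb R e <;> simp

end GapPV

end Literature.Computability.Complexity

/-!
## XVII. The tester's queries and verdict as numbers

The numeric mirror of `TesterQueries.lean`: for a walk constraint `s = (v, lab)` with endpoints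
`(v, u₂)`, a coin tuple of code `z` and a query index `kk < q₀`, the code (`Enc.newVarFin`) of the
queried variable `consVars … s c kk` of the alphabet-reduced instance (`qryN`, `qryN_eq`), and the
accepting table `consAcc … s c τ` on the `2^{q₀}` local assignments `τ = τ_t` (`accN`, `accN_eq`).

## References

* S. Arora, B. Barak, *Computational Complexity: A Modern Approach*, CUP 2009, §22.2.5, Cor. 22.13, Lemma 22.6.
-/

set_option exponentiation.threshold 4096

namespace Literature.Computability.Complexity

open _root_.Computability Literature.Analysis.FunctionSpaces

namespace GapPV

open StrNum Expander Expander.Enc BLR BLR.Table LowDegree Finset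
open Expander.LazyCSP (toNat)

/-! ### The numbering of the new variables -/

section NewVars

variable {N L k : ℕ}

/-- `π`-table positions. [folklore] -/
theorem newVarFin_inl (v : Fin N) (x : Fin k → Bool) : (newVarFin N L k (Sum.inl (v, x))).val = toNat x + 2 ^ k * v.val := rfl

/-- `f`-table positions. [folklore] -/
theorem newVarFin_inr_inl (s : Fin N × Fin L) (z : Fin (nv k) → Bool) :
    (newVarFin N L k (Sum.inr (s, Sum.inl z))).val = N * 2 ^ k + (toNat z + (2 ^ nv k + 2 ^ (nv k * nv k)) * (s.2.val + L * s.1.val)) := rfl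

/-- `g`-table positions. [folklore] -/
theorem newVarFin_inr_inr (s : Fin N × Fin L) (z : Fin (nv k * nv k) → Bool) :
    (newVarFin N L k (Sum.inr (s, Sum.inr z))).val = N * 2 ^ k + (2 ^ nv k + toNat z + (2 ^ nv k + 2 ^ (nv k * nv k)) * (s.2.val + L * s.1.val)) := rfl

end NewVars

/-- The code of the variable holding a position: `kind` `0/1/2/3` = argument of `π₁ / π₂ / f / g` with
vector code `x`. [cite: AroraBarakCC2009, Lemma 22.6 (proof)] -/
def posCode (k N L v u₂ lab kind x : ℕ) : ℕ :=
  if kind = 0 then x + 2 ^ k * v else if kind = 1 then x + 2 ^ k * u₂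
  else if kind = 2 then N * 2 ^ k + (x + (2 ^ nv k + 2 ^ (nv k * nv k)) * (lab + L * v))
  else N * 2 ^ k + (2 ^ nv k + x + (2 ^ nv k + 2 ^ (nv k * nv k)) * (lab + L * v))

/-! ### The numbering of the query indices -/

section QIdx

/-- Block `0` (BLR on `f`). [folklore] -/
theorem qEquiv_b0 (i : Fin T₁) (j : Fin 3) : (qEquiv (Sum.inl (i, j))).val = j.val + 3 * i.val := rfl
/-- Block `1` (BLR on `g`). [folklore] -/
theorem qEquiv_b1 (i : Fin T₁) (j : Fin 3) : (qEquiv (Sum.inr (Sum.inl (i, j)))).val = T₁ * 3 + (j.val + 3 * i.val) := rfl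
/-- Block `2` (tensor). [folklore] -/
theorem qEquiv_b2 (i : Fin T₂) (j : Fin 4) : (qEquiv (Sum.inr (Sum.inr (Sum.inl (i, j))))).val = T₁ * 3 + (T₁ * 3 + (j.val + 4 * i.val)) := rfl
/-- Block `3` (equations). [folklore] -/
theorem qEquiv_b3 (i : Fin T₃) (j : Fin 2) :
    (qEquiv (Sum.inr (Sum.inr (Sum.inr (Sum.inl (i, j)))))).val = T₁ * 3 + (T₁ * 3 + (T₂ * 4 + (j.val + 2 * i.val))) := rfl
/-- Block `4` (BLR on `π₁`). [folklore] -/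
theorem qEquiv_b4 (i : Fin T₁) (j : Fin 3) :
    (qEquiv (Sum.inr (Sum.inr (Sum.inr (Sum.inr (Sum.inl (i, j))))))).val = T₁ * 3 + (T₁ * 3 + (T₂ * 4 + (T₃ * 2 + (j.val + 3 * i.val)))) := rfl
/-- Block `5` (BLR on `π₂`). [folklore] -/
theorem qEquiv_b5 (i : Fin T₁) (j : Fin 3) :
    (qEquiv (Sum.inr (Sum.inr (Sum.inr (Sum.inr (Sum.inr (Sum.inl (i, j)))))))).val =
      T₁ * 3 + (T₁ * 3 + (T₂ * 4 + (T₃ * 2 + (T₁ * 3 + (j.val + 3 * i.val))))) := rfl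
/-- Block `6` (concatenation). [folklore] -/
theorem qEquiv_b6 (i : Fin T₄) (j : Fin 4) :
    (qEquiv (Sum.inr (Sum.inr (Sum.inr (Sum.inr (Sum.inr (Sum.inr (i, j)))))))).val =
      T₁ * 3 + (T₁ * 3 + (T₂ * 4 + (T₃ * 2 + (T₁ * 3 + (T₁ * 3 + (j.val + 4 * i.val)))))) := rfl

end QIdx

/-- Offset of block `1`. [folklore] -/
def o1 : ℕ := T₁ * 3
/-- Offset of block `2`. [folklore] -/
def o2 : ℕ := o1 + T₁ * 3
/-- Offset of block `3`. [folklore] -/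
def o3 : ℕ := o2 + T₂ * 4
/-- Offset of block `4`. [folklore] -/
def o4 : ℕ := o3 + T₃ * 2
/-- Offset of block `5`. [folklore] -/
def o5 : ℕ := o4 + T₁ * 3
/-- Offset of block `6`. [folklore] -/
def o6 : ℕ := o5 + T₁ * 3

/-- **The code of the variable read by query `kk`** of the constraint `(v, lab)` (second endpoint `u₂`) on the
coins of code `z`. [cite: AroraBarakCC2009, §22.2.5 (CSP view of Cor. 22.13)] -/
def qryN (k N L : ℕ) (R01 : ℕ → ℕ → ℕ) (v u₂ lab z kk : ℕ) : ℕ :=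
  if kk < o1 then
    posCode k N L v u₂ lab 2 (if kk % 3 = 0 then lF1 k z (kk / 3) else if kk % 3 = 1 then lF2 k z (kk / 3) else lF1 k z (kk / 3) ^^^ lF2 k z (kk / 3))
  else if kk < o2 then
    posCode k N L v u₂ lab 3 (if (kk - o1) % 3 = 0 then lG1 k z ((kk - o1) / 3) else if (kk - o1) % 3 = 1 then lG2 k z ((kk - o1) / 3)
      else lG1 k z ((kk - o1) / 3) ^^^ lG2 k z ((kk - o1) / 3))
  else if kk < o3 then
    (if (kk - o2) % 4 = 0 then posCode k N L v u₂ lab 3 (lT3 k z ((kk - o2) / 4))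
    else if (kk - o2) % 4 = 1 then posCode k N L v u₂ lab 3 (tensN (nv k) (lT1 k z ((kk - o2) / 4)) (lT2 k z ((kk - o2) / 4)) ^^^ lT3 k z ((kk - o2) / 4))
    else if (kk - o2) % 4 = 2 then posCode k N L v u₂ lab 2 (lT1 k z ((kk - o2) / 4))
    else posCode k N L v u₂ lab 2 (lT2 k z ((kk - o2) / 4)))
  else if kk < o4 then
    (if (kk - o3) % 2 = 0 then posCode k N L v u₂ lab 3 (lE2 k z ((kk - o3) / 2))
    else posCode k N L v u₂ lab 3 (ssN k R01 (lE1 k z ((kk - o3) / 2)) ^^^ lE2 k z ((kk - o3) / 2)))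
  else if kk < o5 then
    posCode k N L v u₂ lab 0 (if (kk - o4) % 3 = 0 then lP11 k z ((kk - o4) / 3) else if (kk - o4) % 3 = 1 then lP12 k z ((kk - o4) / 3)
      else lP11 k z ((kk - o4) / 3) ^^^ lP12 k z ((kk - o4) / 3))
  else if kk < o6 then
    posCode k N L v u₂ lab 1 (if (kk - o5) % 3 = 0 then lP21 k z ((kk - o5) / 3) else if (kk - o5) % 3 = 1 then lP22 k z ((kk - o5) / 3)
      else lP21 k z ((kk - o5) / 3) ^^^ lP22 k z ((kk - o5) / 3))
  else
    (if (kk - o6) % 4 = 0 then posCode k N L v u₂ lab 2 (lC3 k z ((kk - o6) / 4))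
    else if (kk - o6) % 4 = 1 then posCode k N L v u₂ lab 2 ((lC1 k z ((kk - o6) / 4) + 2 ^ k * lC2 k z ((kk - o6) / 4)) ^^^ lC3 k z ((kk - o6) / 4))
    else if (kk - o6) % 4 = 2 then posCode k N L v u₂ lab 0 (lC1 k z ((kk - o6) / 4))
    else posCode k N L v u₂ lab 1 (lC2 k z ((kk - o6) / 4)))

section Correct

variable {k N L : ℕ} {R : (Fin k → Bool) → (Fin k → Bool) → Bool} {R01 : ℕ → ℕ → ℕ}
  (hR : ∀ a b, R01 (toNat a) (toNat b) = (R a b).toNat) (s : Fin N × Fin L) (u₂ : Fin N) (c : TCoins k)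

/-- The kind of a position: argument of `π₁ / π₂ / f / g`. [folklore] -/
def posKind : Pos k → ℕ
  | Sum.inl _ => 0
  | Sum.inr (Sum.inl _) => 1
  | Sum.inr (Sum.inr (Sum.inl _)) => 2
  | Sum.inr (Sum.inr (Sum.inr _)) => 3

/-- The vector code of a position. [folklore] -/
def posVal : Pos k → ℕ
  | Sum.inl x => toNat x
  | Sum.inr (Sum.inl y) => toNat y
  | Sum.inr (Sum.inr (Sum.inl z)) => toNat z
  | Sum.inr (Sum.inr (Sum.inr z)) => toNat z

/-- The code of the variable holding a position. [cite: AroraBarakCC2009, Lemma 22.6 (proof)] -/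
theorem posCode_eq {fst snd : Fin N × Fin L → Fin N} (hfst : fst s = s.1) (hsnd : snd s = u₂) (p : Pos k) :
    (newVarFin N L k (posVar fst snd s p)).val = posCode k N L s.1.val u₂.val s.2.val (posKind p) (posVal p) := by
  rcases p with x | y | z | z
  · show (newVarFin N L k (Sum.inl (fst s, x))).val = _; rw [hfst]; exact newVarFin_inl s.1 x
  · show (newVarFin N L k (Sum.inl (snd s, y))).val = _; rw [hsnd]; exact newVarFin_inl u₂ y
  · exact newVarFin_inr_inl s z
  · exact newVarFin_inr_inr s z

/-- Index arithmetic in a block. [folklore] -/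
theorem blockIdx {w i j : ℕ} (hj : j < w) : (j + w * i) / w = i ∧ (j + w * i) % w = j :=
  ⟨by rw [Nat.add_mul_div_left _ _ (by omega), Nat.div_eq_of_lt hj, zero_add], by rw [Nat.add_mul_mod_self_left, Nat.mod_eq_of_lt hj]⟩

include hR in
/-- **The queried variables, arithmetized.** [cite: AroraBarakCC2009, §22.2.5 (CSP view of Cor. 22.13)] -/
theorem qryN_eq {fst snd : Fin N × Fin L → Fin N} (hfst : fst s = s.1) (hsnd : snd s = u₂) (qi : QIdx) :
    qryN k N L R01 s.1.val u₂.val s.2.val (tcoinsFin k c).val (qEquiv qi).val = (newVarFin N L k (posVar fst snd s (query R c qi))).val := by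
  rw [posCode_eq s u₂ hfst hsnd]
  have hT₁ : o1 = 210 := by simp [o1, T₁]
  have hT₂ : o2 = 420 := by simp [o2, o1, T₁]
  have hT₃ : o3 = 432 := by simp [o3, o2, o1, T₁, T₂]
  have hT₄ : o4 = 436 := by simp [o4, o3, o2, o1, T₁, T₂, T₃]
  have hT₅ : o5 = 646 := by simp [o5, o4, o3, o2, o1, T₁, T₂, T₃]
  have hT₆ : o6 = 856 := by simp [o6, o5, o4, o3, o2, o1, T₁, T₂, T₃]
  rcases qi with ⟨i, j⟩ | ⟨i, j⟩ | ⟨i, j⟩ | ⟨i, j⟩ | ⟨i, j⟩ | ⟨i, j⟩ | ⟨i, j⟩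
  · -- block 0: BLR on `f`
    have hi := i.2; have hj := j.2
    simp only [T₁] at hi
    rw [qEquiv_b0]
    unfold qryN
    rw [if_pos (by rw [hT₁]; omega), (blockIdx hj).1, (blockIdx hj).2]
    unfold query
    fin_cases j <;> simp [posKind, posVal, toNat_lF1, toNat_lF2, toNat_xorVec]
  · -- block 1: BLR on `g`
    have hi := i.2; have hj := j.2
    simp only [T₁] at hi
    rw [qEquiv_b1]
    unfold qryN
    rw [if_neg (by rw [hT₁]; simp only [T₁]; omega), if_pos (by rw [hT₂]; simp only [T₁]; omega),
      show T₁ * 3 + (j.val + 3 * i.val) - o1 = j.val + 3 * i.val by rw [hT₁]; simp only [T₁]; omega, (blockIdx hj).1, (blockIdx hj).2]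
    unfold query
    fin_cases j <;> simp [posKind, posVal, toNat_lG1, toNat_lG2, toNat_xorVec]
  · -- block 2: tensor trials
    have hi := i.2; have hj := j.2
    simp only [T₂] at hi
    rw [qEquiv_b2]
    unfold qryN
    rw [if_neg (by rw [hT₁]; simp only [T₁]; omega), if_neg (by rw [hT₂]; simp only [T₁]; omega), if_pos (by rw [hT₃]; simp only [T₁]; omega),
      show T₁ * 3 + (T₁ * 3 + (j.val + 4 * i.val)) - o2 = j.val + 4 * i.val by rw [hT₂]; simp only [T₁]; omega, (blockIdx hj).1, (blockIdx hj).2]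
    unfold query
    fin_cases j <;> simp [posKind, posVal, toNat_lT1, toNat_lT2, toNat_lT3, toNat_xorVec, toNat_tensorVec]
  · -- block 3: equation trials
    have hi := i.2; have hj := j.2
    simp only [T₃] at hi
    rw [qEquiv_b3]
    unfold qryN
    rw [if_neg (by rw [hT₁]; simp only [T₁, T₂]; omega), if_neg (by rw [hT₂]; simp only [T₁, T₂]; omega),
      if_neg (by rw [hT₃]; simp only [T₁, T₂]; omega), if_pos (by rw [hT₄]; simp only [T₁, T₂]; omega),
      show T₁ * 3 + (T₁ * 3 + (T₂ * 4 + (j.val + 2 * i.val))) - o3 = j.val + 2 * i.val by rw [hT₃]; simp only [T₁, T₂]; omega,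
      (blockIdx hj).1, (blockIdx hj).2]
    unfold query
    fin_cases j <;> simp [posKind, posVal, toNat_lE1, toNat_lE2, toNat_xorVec, toNat_subsetSum k hR]
  · -- block 4: BLR on `π₁`
    have hi := i.2; have hj := j.2
    simp only [T₁] at hi
    rw [qEquiv_b4]
    unfold qryN
    rw [if_neg (by rw [hT₁]; simp only [T₁, T₂, T₃]; omega), if_neg (by rw [hT₂]; simp only [T₁, T₂, T₃]; omega),
      if_neg (by rw [hT₃]; simp only [T₁, T₂, T₃]; omega), if_neg (by rw [hT₄]; simp only [T₁, T₂, T₃]; omega),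
      if_pos (by rw [hT₅]; simp only [T₁, T₂, T₃]; omega),
      show T₁ * 3 + (T₁ * 3 + (T₂ * 4 + (T₃ * 2 + (j.val + 3 * i.val)))) - o4 = j.val + 3 * i.val by rw [hT₄]; simp only [T₁, T₂, T₃]; omega,
      (blockIdx hj).1, (blockIdx hj).2]
    unfold query
    fin_cases j <;> simp [posKind, posVal, toNat_lP11, toNat_lP12, toNat_xorVec]
  · -- block 5: BLR on `π₂`
    have hi := i.2; have hj := j.2
    simp only [T₁] at hi
    rw [qEquiv_b5]
    unfold qryN
    rw [if_neg (by rw [hT₁]; simp only [T₁, T₂, T₃]; omega), if_neg (by rw [hT₂]; simp only [T₁, T₂, T₃]; omega),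
      if_neg (by rw [hT₃]; simp only [T₁, T₂, T₃]; omega), if_neg (by rw [hT₄]; simp only [T₁, T₂, T₃]; omega),
      if_neg (by rw [hT₅]; simp only [T₁, T₂, T₃]; omega), if_pos (by rw [hT₆]; simp only [T₁, T₂, T₃]; omega),
      show T₁ * 3 + (T₁ * 3 + (T₂ * 4 + (T₃ * 2 + (T₁ * 3 + (j.val + 3 * i.val))))) - o5 = j.val + 3 * i.val by
        rw [hT₅]; simp only [T₁, T₂, T₃]; omega,
      (blockIdx hj).1, (blockIdx hj).2]
    unfold query
    fin_cases j <;> simp [posKind, posVal, toNat_lP21, toNat_lP22, toNat_xorVec]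
  · -- block 6: concatenation trials
    have hi := i.2; have hj := j.2
    simp only [T₄] at hi
    rw [qEquiv_b6]
    unfold qryN
    rw [if_neg (by rw [hT₁]; simp only [T₁, T₂, T₃]; omega), if_neg (by rw [hT₂]; simp only [T₁, T₂, T₃]; omega),
      if_neg (by rw [hT₃]; simp only [T₁, T₂, T₃]; omega), if_neg (by rw [hT₄]; simp only [T₁, T₂, T₃]; omega),
      if_neg (by rw [hT₅]; simp only [T₁, T₂, T₃]; omega), if_neg (by rw [hT₆]; simp only [T₁, T₂, T₃]; omega),
      show T₁ * 3 + (T₁ * 3 + (T₂ * 4 + (T₃ * 2 + (T₁ * 3 + (T₁ * 3 + (j.val + 4 * i.val)))))) - o6 = j.val + 4 * i.val by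
        rw [hT₆]; simp only [T₁, T₂, T₃]; omega,
      (blockIdx hj).1, (blockIdx hj).2]
    unfold query
    fin_cases j <;> simp [posKind, posVal, toNat_lC1, toNat_lC2, toNat_lC3, toNat_xorVec, toNat_embed]

omit hR in
/-- **The queried variables of a constraint** (`consVars`), arithmetized. [cite: AroraBarakCC2009, §22.2.5] -/
theorem consVars_eq {fst snd : Fin N × Fin L → Fin N} (rel : Fin N × Fin L → (Fin k → Bool) → (Fin k → Bool) → Bool)
    (hrel : ∀ a b, R01 (toNat a) (toNat b) = (rel s a b).toNat) (hfst : fst s = s.1) (hsnd : snd s = u₂) (kk : Fin q₀) :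
    (newVarFin N L k (consVars fst snd rel s c kk)).val = qryN k N L R01 s.1.val u₂.val s.2.val (tcoinsFin k c).val kk.val := by
  unfold consVars
  rw [Function.comp_apply, Function.comp_apply, ← qryN_eq hrel s u₂ c hfst hsnd, Equiv.apply_symm_apply]

end Correct

/-! ### The verdict -/

/-- A violated trial among `i < T`, as a count. [folklore] -/
theorem forall_fin_iff_count {T : ℕ} (P : ℕ → Prop) [DecidablePred P] :
    (∀ i : Fin T, P i.val) ↔ countBelow (fun i => if P i then 0 else 1) T = 0 := by
  rw [countBelow_eq_zero_iff]
  constructor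
  · intro h i hi; rw [if_pos (h ⟨i, hi⟩)]
  · intro h i; have := h i.val i.2; by_contra hc; rw [if_neg hc] at this; exact one_ne_zero this

/-- **The accepting table of a constraint**: the verdict on the answer bits `testBit t` of the `q₀` queries,
as `0/1` (coins of code `z`). [cite: AroraBarakCC2009, §22.2.5 (CSP view of Cor. 22.13)] -/
def accN (k z t : ℕ) : ℕ :=
  if countBelow (fun i => if t.testBit (2 + 3 * i) = xor (t.testBit (0 + 3 * i)) (t.testBit (1 + 3 * i)) then 0 else 1) T₁ = 0 ∧
      countBelow (fun i => if t.testBit (T₁ * 3 + (2 + 3 * i)) = xor (t.testBit (T₁ * 3 + (0 + 3 * i))) (t.testBit (T₁ * 3 + (1 + 3 * i))) then 0 else 1) T₁ = 0 ∧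
      countBelow (fun i => if xor (t.testBit (T₁ * 3 + (T₁ * 3 + (0 + 4 * i)))) (t.testBit (T₁ * 3 + (T₁ * 3 + (1 + 4 * i)))) = (t.testBit (T₁ * 3 + (T₁ * 3 + (2 + 4 * i))) && t.testBit (T₁ * 3 + (T₁ * 3 + (3 + 4 * i)))) then 0 else 1) T₂ = 0 ∧
      countBelow (fun i => if xor (t.testBit (T₁ * 3 + (T₁ * 3 + (T₂ * 4 + (0 + 2 * i))))) (t.testBit (T₁ * 3 + (T₁ * 3 + (T₂ * 4 + (1 + 2 * i))))) = decide (dotBN k (lE1 k z i) = 1) then 0 else 1) T₃ = 0 ∧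
      countBelow (fun i => if t.testBit (T₁ * 3 + (T₁ * 3 + (T₂ * 4 + (T₃ * 2 + (2 + 3 * i))))) = xor (t.testBit (T₁ * 3 + (T₁ * 3 + (T₂ * 4 + (T₃ * 2 + (0 + 3 * i)))))) (t.testBit (T₁ * 3 + (T₁ * 3 + (T₂ * 4 + (T₃ * 2 + (1 + 3 * i)))))) then 0 else 1) T₁ = 0 ∧
      countBelow (fun i => if t.testBit (T₁ * 3 + (T₁ * 3 + (T₂ * 4 + (T₃ * 2 + (T₁ * 3 + (2 + 3 * i)))))) = xor (t.testBit (T₁ * 3 + (T₁ * 3 + (T₂ * 4 + (T₃ * 2 + (T₁ * 3 + (0 + 3 * i))))))) (t.testBit (T₁ * 3 + (T₁ * 3 + (T₂ * 4 + (T₃ * 2 + (T₁ * 3 + (1 + 3 * i))))))) then 0 else 1) T₁ = 0 ∧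
      countBelow (fun i => if xor (t.testBit (T₁ * 3 + (T₁ * 3 + (T₂ * 4 + (T₃ * 2 + (T₁ * 3 + (T₁ * 3 + (0 + 4 * i)))))))) (t.testBit (T₁ * 3 + (T₁ * 3 + (T₂ * 4 + (T₃ * 2 + (T₁ * 3 + (T₁ * 3 + (1 + 4 * i)))))))) = xor (t.testBit (T₁ * 3 + (T₁ * 3 + (T₂ * 4 + (T₃ * 2 + (T₁ * 3 + (T₁ * 3 + (2 + 4 * i)))))))) (t.testBit (T₁ * 3 + (T₁ * 3 + (T₂ * 4 + (T₃ * 2 + (T₁ * 3 + (T₁ * 3 + (3 + 4 * i)))))))) then 0 else 1) T₄ = 0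
  then 1 else 0

/-- `accN ≤ 1`. [folklore] -/
theorem accN_le (k z t : ℕ) : accN k z t ≤ 1 := by unfold accN; split_ifs <;> simp

/-- `dot sel (tableb R)` through `dotBN`. [folklore] -/
theorem dot_tableb_eq (k : ℕ) (R : (Fin k → Bool) → (Fin k → Bool) → Bool) (sel : Fin (ne k) → Bool) :
    dot sel (tableb R) = decide (dotBN k (toNat sel) = 1) := by
  rw [← toNat_dot_tableb k R sel]; cases dot sel (tableb R) <;> rfl

/-- **The verdict, arithmetized.** [cite: AroraBarakCC2009, §22.2.5 (CSP view of Cor. 22.13)] -/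
theorem accN_eq {k : ℕ} (R : (Fin k → Bool) → (Fin k → Bool) → Bool) (c : TCoins k) (t : ℕ) :
    accN k (tcoinsFin k c).val t = (verdict R c (fun qi => t.testBit (qEquiv qi).val)).toNat := by
  have hite : ∀ (P : Prop) [Decidable P], ((if P then (1 : ℕ) else 0) = 1 ↔ P) := fun P _ => by by_cases h : P <;> simp [h]
  have hiff : accN k (tcoinsFin k c).val t = 1 ↔ verdict R c (fun qi => t.testBit (qEquiv qi).val) = true := by
    unfold accN verdict
    rw [hite]
    simp only [Bool.and_eq_true, decide_eq_true_eq]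
    rw [← forall_fin_iff_count (T := T₁) fun i => t.testBit (2 + 3 * i) = xor (t.testBit (0 + 3 * i)) (t.testBit (1 + 3 * i)),
      ← forall_fin_iff_count (T := T₁) fun i => t.testBit (T₁ * 3 + (2 + 3 * i)) = xor (t.testBit (T₁ * 3 + (0 + 3 * i))) (t.testBit (T₁ * 3 + (1 + 3 * i))),
      ← forall_fin_iff_count (T := T₂) fun i => xor (t.testBit (T₁ * 3 + (T₁ * 3 + (0 + 4 * i)))) (t.testBit (T₁ * 3 + (T₁ * 3 + (1 + 4 * i)))) = (t.testBit (T₁ * 3 + (T₁ * 3 + (2 + 4 * i))) && t.testBit (T₁ * 3 + (T₁ * 3 + (3 + 4 * i)))),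
      ← forall_fin_iff_count (T := T₃) fun i => xor (t.testBit (T₁ * 3 + (T₁ * 3 + (T₂ * 4 + (0 + 2 * i))))) (t.testBit (T₁ * 3 + (T₁ * 3 + (T₂ * 4 + (1 + 2 * i))))) = decide (dotBN k (lE1 k (tcoinsFin k c).val i) = 1),
      ← forall_fin_iff_count (T := T₁) fun i => t.testBit (T₁ * 3 + (T₁ * 3 + (T₂ * 4 + (T₃ * 2 + (2 + 3 * i))))) = xor (t.testBit (T₁ * 3 + (T₁ * 3 + (T₂ * 4 + (T₃ * 2 + (0 + 3 * i)))))) (t.testBit (T₁ * 3 + (T₁ * 3 + (T₂ * 4 + (T₃ * 2 + (1 + 3 * i)))))),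
      ← forall_fin_iff_count (T := T₁) fun i => t.testBit (T₁ * 3 + (T₁ * 3 + (T₂ * 4 + (T₃ * 2 + (T₁ * 3 + (2 + 3 * i)))))) = xor (t.testBit (T₁ * 3 + (T₁ * 3 + (T₂ * 4 + (T₃ * 2 + (T₁ * 3 + (0 + 3 * i))))))) (t.testBit (T₁ * 3 + (T₁ * 3 + (T₂ * 4 + (T₃ * 2 + (T₁ * 3 + (1 + 3 * i))))))),
      ← forall_fin_iff_count (T := T₄) fun i => xor (t.testBit (T₁ * 3 + (T₁ * 3 + (T₂ * 4 + (T₃ * 2 + (T₁ * 3 + (T₁ * 3 + (0 + 4 * i)))))))) (t.testBit (T₁ * 3 + (T₁ * 3 + (T₂ * 4 + (T₃ * 2 + (T₁ * 3 + (T₁ * 3 + (1 + 4 * i)))))))) = xor (t.testBit (T₁ * 3 + (T₁ * 3 + (T₂ * 4 + (T₃ * 2 + (T₁ * 3 + (T₁ * 3 + (2 + 4 * i)))))))) (t.testBit (T₁ * 3 + (T₁ * 3 + (T₂ * 4 + (T₃ * 2 + (T₁ * 3 + (T₁ * 3 + (3 + 4 * i))))))))]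
    have e4 : (∀ i : Fin T₃, (fun i : ℕ => xor (t.testBit (T₁ * 3 + (T₁ * 3 + (T₂ * 4 + (0 + 2 * i))))) (t.testBit (T₁ * 3 + (T₁ * 3 + (T₂ * 4 + (1 + 2 * i))))) = decide (dotBN k (lE1 k (tcoinsFin k c).val i) = 1)) i.val) ↔
        ∀ i : Fin T₃, xor (t.testBit (qEquiv (Sum.inr (Sum.inr (Sum.inr (Sum.inl (i, 0)))))).val)
          (t.testBit (qEquiv (Sum.inr (Sum.inr (Sum.inr (Sum.inl (i, 1)))))).val) = dot (c.1.2.2.2 i).1 (tableb R) :=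
      forall_congr' fun i => by rw [dot_tableb_eq, toNat_lE1 k c i]; exact Iff.rfl
    rw [e4]
    constructor
    · rintro ⟨h1, h2, h3, h4, h5, h6, h7⟩; exact ⟨⟨h1, h2, h3, h4⟩, h5, h6, h7⟩
    · rintro ⟨⟨h1, h2, h3, h4⟩, h5, h6, h7⟩; exact ⟨h1, h2, h3, h4, h5, h6, h7⟩
  have hle := accN_le k (tcoinsFin k c).val t
  cases hv : verdict R c (fun qi => t.testBit (qEquiv qi).val)
  · have hne : accN k (tcoinsFin k c).val t ≠ 1 := fun h => by have := hiff.1 h; rw [hv] at this; exact Bool.false_ne_true this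
    simp only [Bool.toNat_false]; omega
  · rw [hiff.2 hv]; rfl

end GapPV

end Literature.Computability.Complexity

/-!
## XVIII. One round of gap amplification on coded instances

Assembling stages 1–4 (`GapPVArity`, `GapPVDegree`, `GapPVGraphs/GG`, `GapPVBall`, `GapPVQuery`) into
the number-theoretic function `roundS e N S` on states, with the representation theorem: if `S` codes
`φ` then `roundS e N S` codes `ggP.round φ` (the round of `Round.lean` on the Gabber–Galil kit), as
long as the sizes of the output fit under the cap.

* the constants of the round on the Gabber–Galil kit (notations `DD`, `PLEN`, `LL`, `TCN`, all through `ggP`);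
* the graphs and constraints of stages 2–3 as functions of the state (`nb2/lb2/c2`, `nb3/lb3/c3`, `nbZ/lbZ`)
  with `mirrors_G3lazy`, `c3_eq`;
* the constraints of stage 4 (`cv/clab/cz/cu2/cR/rVar/rAcc`), the new sizes `rNV/rM`, `roundS`;
* **`rep_roundS`**.

## References

* S. Arora, B. Barak, *Computational Complexity: A Modern Approach*, CUP 2009, Lemma 22.4, §22.2, §22.A.
-/

set_option exponentiation.threshold 1000000

noncomputable section

namespace Literature.Computability.Complexity

open _root_.Computability Literature.Analysis.FunctionSpaces

namespace GapPV

open StrNum Expander Expander.Enc Expander.RotGraph Expander.BCSP Expander.ArityReduction Expander.DegreeReduction Expander.RoundParams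
  BLR BLR.Table GabberGalil Finset
open Expander.LazyCSP (toNat)

/-! ### The constants of the round

All constants are those of `ggP = ggKit.mkParams` (`GabberGalilKit.lean`): `ggP.d₁ = d₀ + 1`,
`ggP.dH = d₁ + dM d₁`, the lazy degree `D = dH + dH`, `ggP.t`, `ggP.T = t + ⌊√t⌋`, the walk length
`2t + 1`, the number of bits `ggP.k₄ = q₀ · ballBound D T`, `L = D^{2t+1}` walk labels and `tc k₄` coin
tuples.  (They are used through `ggP` itself, never restated, so that no definitional unfolding of the
huge closed numerals is ever required.) -/

/- The closed constants are NOTATIONS, not definitions: the kernel must never be asked to unfold a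
constant whose body mentions `ggP.t` (its definitional unfolding runs into the real-number ceiling of
`Kit.Mbig` and exhausts memory); notations keep both sides of every definitional comparison
syntactically identical. -/
local notation "DD" => (ggP.dH + ggP.dH)
local notation "PLEN" => (2 * ggP.t + 1)
local notation "LL" => ((ggP.dH + ggP.dH) ^ (2 * ggP.t + 1))
local notation "TCN" => (tc ggP.k₄)

/-- `D > 0`. [folklore] -/
theorem DD_pos : 0 < DD := by unfold RoundParams.dH RoundParams.d₁; omega

variable (e : ℕ)

/-! ### Stages 2 and 3 on a coded instance -/

/-- The number of binary constraints `m q₀` of stage 1 (the number of constraints clamped by the cap, so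
that every loop below has polynomial length on junk states too). [folklore] -/
def m1 (N S : ℕ) : ℕ := min (stM e N S) (capL e N) * q₀
/-- The number of occurrences `2 m q₀` (vertices of stage 2). [folklore] -/
def n2 (N S : ℕ) : ℕ := m1 e N S * 2
/-- The padded number of vertices of stage 3. [folklore] -/
def n3 (N S : ℕ) : ℕ := NM (n2 e N S)

/-- The degree-reduced graph: neighbours. [cite: AroraBarakCC2009, Claim 22.37] -/
def nb2 (N S : ℕ) : ℕ → ℕ → ℕ := redNb (m1 e N S) (aE1 e N S) (aE2 e N S) xcNb
/-- The degree-reduced graph: reverse labels. [cite: AroraBarakCC2009, Claim 22.37] -/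
def lb2 (N S : ℕ) : ℕ → ℕ → ℕ := redLb (m1 e N S) (aE1 e N S) (aE2 e N S) xcLb
/-- The degree-reduced constraints. [cite: AroraBarakCC2009, Claim 22.37] -/
def c2 (N S : ℕ) : ℕ → ℕ → ℕ → ℕ → ℕ := redC (aR e N S)

/-- The expanderized graph: neighbours. [cite: AroraBarakCC2009, Claim 22.38] -/
def nb3 (N S : ℕ) : ℕ → ℕ → ℕ := prepNb ggP.d₁ (padNb (n2 e N S) (nb2 e N S)) (xmNb (n2 e N S))
/-- The expanderized graph: reverse labels. [cite: AroraBarakCC2009, Claim 22.38] -/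
def lb3 (N S : ℕ) : ℕ → ℕ → ℕ := prepLb ggP.d₁ (padLb (n2 e N S) (lb2 e N S)) (xmLb (n2 e N S))
/-- The constraints of stage 3 (null on the added darts and labels). [cite: AroraBarakCC2009, Claim 22.38] -/
def c3 (N S v i a b : ℕ) : ℕ :=
  if i < ggP.dH then (if i < ggP.d₁ then (if v < n2 e N S then c2 e N S v i a b else 1) else 1) else 1
/-- The lazy graph of stage 3: neighbours. [cite: AroraBarakCC2009, Claim 22.38] -/
def nbZ (N S : ℕ) : ℕ → ℕ → ℕ := lazyNb ggP.dH (nb3 e N S)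
/-- The lazy graph of stage 3: reverse labels. [folklore] -/
def lbZ (N S : ℕ) : ℕ → ℕ → ℕ := lazyLb ggP.dH (lb3 e N S)

/-! ### Stage 4 on a coded instance -/

/-- The start vertex of constraint `I`. [folklore] -/
def cv (I : ℕ) : ℕ := I / TCN / LL
/-- The walk label of constraint `I`. [folklore] -/
def clab (I : ℕ) : ℕ := I / TCN % LL
/-- The coin code of constraint `I`. [folklore] -/
def cz (I : ℕ) : ℕ := I % TCN
/-- The end vertex of the walk of constraint `I`. [cite: AroraBarakCC2009, Lemma 22.9] -/
def cu2 (N S I : ℕ) : ℕ := powNb (nbZ e N S) DD PLEN (n3 e N S) (cv I) (clab I)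
/-- The walk relation of constraint `I` on value codes. [cite: AroraBarakCC2009, Lemma 22.9] -/
def cR (N S I : ℕ) : ℕ → ℕ → ℕ := wrelN (nbZ e N S) (c3 e N S) DD (n3 e N S) ggP.T W PLEN (cv I) (clab I)
/-- **Variable `kk` of constraint `I` of the round's output.** [cite: AroraBarakCC2009, §22.2.5] -/
def rVar (N S I kk : ℕ) : ℕ := qryN ggP.k₄ (n3 e N S) LL (cR e N S I) (cv I) (cu2 e N S I) (clab I) (cz I) kk
/-- **The accepting table of constraint `I` of the round's output.** [cite: AroraBarakCC2009, §22.2.5] -/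
def rAcc (I t : ℕ) : ℕ := accN ggP.k₄ (cz I) t
/-- The number of variables of the output. [folklore] -/
def rNV (N S : ℕ) : ℕ := nvars (n3 e N S) LL ggP.k₄
/-- The number of constraints of the output. [folklore] -/
def rM (N S : ℕ) : ℕ := n3 e N S * LL * TCN

/-- **One round on states.** [cite: AroraBarakCC2009, Lemma 22.4] -/
def roundS (N S : ℕ) : ℕ :=
  if stM e N S = 0 then S
  else build e (fun N' => rNV e N' S) (fun N' => rM e N' S) (fun N' I kk => rVar e N' S I kk) (fun _ I t => rAcc I t) N

/-! ### Correctness -/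

section Correct

variable {e} {N S : ℕ} {φ : BCSP q₀} (hR : Rep e N S φ)
include hR

/-- `m1 = |arityW φ|`. [folklore] -/
theorem m1_eq : m1 e N S = (arityW φ).m := by
  unfold m1
  rw [hR.m_eq, min_eq_left (by have := hR.m_le; nlinarith [q₀_pos'])]
  rfl

/-- The endpoints of stage 1 mirror `arEdge`. [folklore] -/
theorem HE_arity : ∀ s : Fin (arityW φ).m, aE1 e N S s = ((arityW φ).e s).1.val ∧ aE2 e N S s = ((arityW φ).e s).2.val :=
  fun s => ⟨aE1_eq hR s.2, aE2_eq hR s.2⟩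

/-- **The degree-reduced graph is mirrored.** [cite: AroraBarakCC2009, Claim 22.37] -/
theorem mirrors_G2 : Mirrors (EdgeCSP.degreeG ggP (arityW φ)) (nb2 e N S) (lb2 e N S) := by
  unfold nb2 lb2 EdgeCSP.degreeG
  rw [m1_eq hR]
  exact mirrors_reduced (HE_arity hR) mirrors_Xc

/-- `n2`, `n3` under `Rep`. [folklore] -/
theorem n2_eq : n2 e N S = (arityW φ).m * 2 := by unfold n2; rw [m1_eq hR]

/-- `n3` under `Rep`. [folklore] -/
theorem n3_eq : n3 e N S = (ggP.padExp (EdgeCSP.degreeG ggP (arityW φ)) (EdgeCSP.degreeC ggP (arityW φ)) W).n := by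
  unfold n3; rw [n2_eq hR]; rfl

/-- **The lazy graph of stage 3 is mirrored.** [cite: AroraBarakCC2009, Claim 22.38] -/
theorem mirrors_G3lazy : Mirrors (ggP.padExp (EdgeCSP.degreeG ggP (arityW φ)) (EdgeCSP.degreeC ggP (arityW φ)) W).G.lazy (nbZ e N S) (lbZ e N S) := by
  unfold nbZ lbZ nb3 lb3
  rw [n2_eq hR]
  exact mirrors_lazy (mirrors_prep (mirrors_pad (mirrors_G2 hR) (ggP.Nx_ge _)) (mirrors_XM _))

/-- **The constraints of stage 3 are mirrored.** [cite: AroraBarakCC2009, Claims 22.37–22.38] -/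
theorem c3_eq (v : Fin (ggP.padExp (EdgeCSP.degreeG ggP (arityW φ)) (EdgeCSP.degreeC ggP (arityW φ)) W).n) (i : Fin (ggP.dH + ggP.dH)) (a b : ℕ) :
    c3 e N S v i a b = ((ggP.padExp (EdgeCSP.degreeG ggP (arityW φ)) (EdgeCSP.degreeC ggP (arityW φ)) W).C v i a b).toNat := by
  have hn2 := n2_eq hR
  unfold c3
  rw [hn2]
  simp only [RoundParams.padExp, lazyC, prepC, extendC, padC]
  by_cases h1 : i.val < ggP.d₁ + ggP.dX * ggP.d₁
  · have h1' : i.val < ggP.dH := h1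
    by_cases h2 : i.val < ggP.d₁
    · by_cases h3 : v.val < (arityW φ).m * 2
      · simp only [h1', h2, h3, if_true, dif_pos]
        unfold c2 EdgeCSP.degreeC
        exact redC_eq (fun s a b => aR_eq hR s.2 a b) ⟨v.val, h3⟩ ⟨i.val, h2⟩ a b
      · simp only [h1', h2, h3, if_true, dif_pos, if_false, dif_neg, not_false_eq_true]; rfl
    · simp only [h1', h2, if_true, dif_pos, if_false, dif_neg, not_false_eq_true]; rfl
  · have h1' : ¬ i.val < ggP.dH := h1
    simp only [h1', if_false, dif_neg, not_false_eq_true]; rfl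

/-- The lazy instance of stage 3. [folklore] -/
abbrev ψ3 (φ : BCSP q₀) : LazyCSP := ggP.padExp (EdgeCSP.degreeG ggP (arityW φ)) (EdgeCSP.degreeC ggP (arityW φ)) W

omit hR in
/-- The code of a (walk constraint, coin tuple) pair. [folklore] -/
theorem scEquiv_val (x : (ψ3 φ).S₄ ggP × TCoins ggP.k₄) :
    ((ψ3 φ).scEquiv ggP ggP.k₄ x).val = (tcoinsFin ggP.k₄ x.2).val + TCN * (x.1.2.val + LL * x.1.1.val) := by
  unfold LazyCSP.scEquiv
  rw [pairFin_val, pairFin_val]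
  rfl

omit hR in
/-- Decoding the code of a pair. [folklore] -/
theorem sc_decode (x : (ψ3 φ).S₄ ggP × TCoins ggP.k₄) :
    cv ((ψ3 φ).scEquiv ggP ggP.k₄ x).val = x.1.1.val ∧ clab ((ψ3 φ).scEquiv ggP ggP.k₄ x).val = x.1.2.val ∧
      cz ((ψ3 φ).scEquiv ggP ggP.k₄ x).val = (tcoinsFin ggP.k₄ x.2).val := by
  have htc : 0 < TCN := Fin.pos (tcoinsFin ggP.k₄ x.2)
  have hL : 0 < LL := Fin.pos x.1.2
  have h1 : ((ψ3 φ).scEquiv ggP ggP.k₄ x).val / TCN = x.1.2.val + LL * x.1.1.val := by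
    rw [scEquiv_val, Nat.add_mul_div_left _ _ htc, Nat.div_eq_of_lt (tcoinsFin ggP.k₄ x.2).2, zero_add]
  have hlab : x.1.2.val < LL := x.1.2.2
  unfold cv clab cz
  refine ⟨?_, ?_, ?_⟩
  · rw [h1, Nat.add_mul_div_left _ _ hL, Nat.div_eq_of_lt hlab, zero_add]
  · rw [h1, Nat.add_mul_mod_self_left, Nat.mod_eq_of_lt hlab]
  · rw [scEquiv_val, Nat.add_mul_mod_self_left, Nat.mod_eq_of_lt (tcoinsFin ggP.k₄ x.2).2]

/-- **The end vertex of a walk constraint.** [cite: AroraBarakCC2009, Lemma 22.9] -/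
theorem cu2_eq (x : (ψ3 φ).S₄ ggP) : powNb (nbZ e N S) DD PLEN (n3 e N S) x.1.val x.2.val = ((ψ3 φ).wsnd ggP x).val := by
  rw [n3_eq hR]
  exact (mirrors_power (mirrors_G3lazy hR) PLEN x.1 x.2).1

omit hR in
/-- A `0/1` value from an equivalence with a Boolean. [folklore] -/
theorem eq_toNat_of_iff {w : ℕ} {bP : Bool} (hle : w ≤ 1) (h : w = 1 ↔ bP = true) : w = bP.toNat := by
  cases bP
  · have : w ≠ 1 := fun h1 => Bool.false_ne_true (h.1 h1)
    simp only [Bool.toNat_false]; omega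
  · rw [h.2 rfl]; rfl

/-- **The walk relation of a constraint.** [cite: AroraBarakCC2009, Lemma 22.9] -/
theorem cR_eq (x : (ψ3 φ).S₄ ggP) (a b : Fin ggP.k₄ → Bool) :
    wrelN (nbZ e N S) (c3 e N S) DD (n3 e N S) ggP.T W PLEN x.1.val x.2.val (toNat a) (toNat b) = ((ψ3 φ).wrel ggP ggP.k₄ x a b).toNat := by
  rw [n3_eq hR]
  refine eq_toNat_of_iff (wrelN_le _ _ _ _ _ _ _ _ _ _)
    ((wrelN_eq_one_iff (mirrors_G3lazy hR) DD_pos (C := (ψ3 φ).C) (C01 := c3 e N S) (fun u i a b => c3_eq hR u i a b) ggP.T W PLEN x.1 x.2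
      (toNat a) (toNat b)).trans ?_)
  unfold LazyCSP.wrel
  rw [decide_eq_true_iff]
  exact (walkRel_iff_walkRelV _ _ _ _ _ _ _ _).symm

omit hR in
/-- The variables of the alphabet-reduced instance, constraint by constraint. [folklore] -/
theorem powAlpha_vars_eq (ψ : LazyCSP) (P : RoundParams) (k : ℕ) (s : Fin (ψ.powAlpha P k).cons.length) (kk : Fin q₀) :
    (ψ.powAlpha P k).vars s kk = newVarFin _ _ k (consVars (ψ.wfst P) (ψ.wsnd P) (ψ.wrel P k) (ψ.scOf P k s).1 (ψ.scOf P k s).2 kk) := by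
  have hget : (ψ.powAlpha P k).cons[s] = ψ.consOf P k ⟨s.val, lt_of_lt_of_eq s.2 (ψ.powAlpha_length P k)⟩ := by
    show (List.ofFn (ψ.consOf P k))[s.val] = _
    rw [List.getElem_ofFn]
  unfold BCSP.vars
  rw [hget]
  rfl

omit hR in
/-- The accepting tables of the alphabet-reduced instance, constraint by constraint. [folklore] -/
theorem powAlpha_acc_eq (ψ : LazyCSP) (P : RoundParams) (k : ℕ) (s : Fin (ψ.powAlpha P k).cons.length) (τ : Fin q₀ → Bool) :
    (ψ.powAlpha P k).acc s τ = consAcc (ψ.wrel P k) (ψ.scOf P k s).1 (ψ.scOf P k s).2 τ := by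
  have hget : (ψ.powAlpha P k).cons[s] = ψ.consOf P k ⟨s.val, lt_of_lt_of_eq s.2 (ψ.powAlpha_length P k)⟩ := by
    show (List.ofFn (ψ.consOf P k))[s.val] = _
    rw [List.getElem_ofFn]
  unfold BCSP.acc
  rw [hget]
  rfl

omit hR in
/-- The code of `scOf s` is `s`. [folklore] -/
theorem scEquiv_scOf (ψ : LazyCSP) (P : RoundParams) (k : ℕ) (s : Fin (ψ.powAlpha P k).cons.length) :
    (ψ.scEquiv P k (ψ.scOf P k s)).val = s.val := by
  unfold LazyCSP.scOf; rw [Equiv.apply_symm_apply]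

/-- **The round on states represents the round** (sizes permitting). [cite: AroraBarakCC2009, Lemma 22.4] -/
theorem rep_roundS (hnV : (ggP.round φ).nV ≤ 2 ^ capL e N) (hm : 2 + (ggP.round φ).cons.length * (q₀ + 1) ≤ capL e N) :
    Rep e N (roundS e N S) (ggP.round φ) := by
  unfold roundS RoundParams.round
  by_cases h0 : φ.cons.length = 0
  · rw [if_pos (by rw [hR.m_eq]; exact h0)]
    simp only [h0, if_true]
    exact hR
  · rw [if_neg (by rw [hR.m_eq]; exact h0)]
    simp only [h0, if_false]
    rw [RoundParams.round, if_neg h0] at hnV hm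
    refine rep_build e ?_ ?_ (fun s hs kk => ?_) (fun s hs t ht => ?_) (fun s t => accN_le _ _ _) hnV hm
    · unfold rNV; rw [n3_eq hR]; rfl
    · unfold rM; rw [n3_eq hR, LazyCSP.powAlpha_length]; rfl
    · -- the variables
      set x := (ψ3 φ).scOf ggP ggP.k₄ ⟨s, hs⟩ with hxdef
      have hsx : s = ((ψ3 φ).scEquiv ggP ggP.k₄ x).val := (scEquiv_scOf _ _ _ ⟨s, hs⟩).symm
      have hcv : cv s = x.1.1.val := by
        conv_lhs => rw [hsx]
        exact (sc_decode x).1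
      have hclab : clab s = x.1.2.val := by
        conv_lhs => rw [hsx]
        exact (sc_decode x).2.1
      have hcz : cz s = (tcoinsFin ggP.k₄ x.2).val := by
        conv_lhs => rw [hsx]
        exact (sc_decode x).2.2
      rw [powAlpha_vars_eq]
      refine ((consVars_eq (fst := (ψ3 φ).wfst ggP) (snd := (ψ3 φ).wsnd ggP) (R01 := cR e N S s) x.1 ((ψ3 φ).wsnd ggP x.1) x.2
        ((ψ3 φ).wrel ggP ggP.k₄) (fun a b => ?_) rfl rfl kk).trans ?_).symm
      · unfold cR
        rw [hcv, hclab]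
        exact cR_eq hR x.1 a b
      · unfold rVar cu2
        rw [hcv, hclab, hcz, cu2_eq hR, n3_eq hR]
        rfl
    · -- the tables
      set x := (ψ3 φ).scOf ggP ggP.k₄ ⟨s, hs⟩ with hxdef
      have hsx : s = ((ψ3 φ).scEquiv ggP ggP.k₄ x).val := (scEquiv_scOf _ _ _ ⟨s, hs⟩).symm
      have hcz : cz s = (tcoinsFin ggP.k₄ x.2).val := by
        conv_lhs => rw [hsx]
        exact (sc_decode x).2.2
      rw [powAlpha_acc_eq]
      unfold rAcc consAcc
      rw [hcz]
      exact accN_eq _ _ t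

end Correct

end GapPV

end Literature.Computability.Complexity

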